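import Literature.MathematicalPhysics.QuantumManyBody.LiebSimpleEquationYukawaOps
import Literature.MathematicalPhysics.QuantumManyBody.LiebSimpleEquationResolventDefs
import Literature.MathematicalPhysics.QuantumManyBody.LiebSimpleEquationFacts
import Literature.Analysis.FluidPDE.FujitaKatoMajorant
import HarnessLib

/-!
# Lieb's simple equation (Carlen–Jauslin–Lieb): proof of CJL-I Theorem 1 (existence and uniqueness)

Topic: `Literature/MathematicalPhysics/QuantumManyBody`. This file DISCHARGES the named fact
`CarlenJauslinLieb2020_thm1` of `LiebSimpleEquationFacts.lean`:
`theorem CarlenJauslinLieb2020_thm1_holds : CarlenJauslinLieb2020_thm1` — CJL-I Theorem 1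
(Carlen–Jauslin–Lieb, *Analysis of a simple equation for the ground state energy of the Bose gas*,
Pure Appl. Anal. 2 (2020) 659–684, arXiv:1912.04987, Theorem 1 with its proof in §2, Lemmas 4–8): for
`𝒱 ≥ 0` in `L¹ ∩ Lᵖ(ℝ³)`, `p > 3/2`, `𝒱 ≢ 0`, there is a continuous density function `ρ(e)` on
`(0,∞)` with `ρ(0⁺) = 0`, `ρ(∞) = ∞`, such that for every `e > 0` the simple equation
`(−Δ + 4e + 𝒱)u = 𝒱 + 2eρ u∗u`, `e = (ρ/2)∫(1 − u)𝒱` has exactly one integrable solution `0 ≤ u ≤ 1`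
at `ρ = ρ(e)` and none at `ρ ≠ ρ(e)` (solutions in the sense of `LiebSimpleEquation.IsSolution`:
mild form (1.10) with the Yukawa kernel, energy constraint (1.2)).

## The printed proof and how it is followed

CJL write the equation as `u = K_e(𝒱 + 2eρ u∗u)` with the positive resolvent
`K_e = (−Δ + 4e + 𝒱)⁻¹`, `0 ≤ K_e ≤ G_e = (−Δ + 4e)⁻¹ = Y_{4e}∗` ((1.13)–(1.16)), and solve by
monotone iteration `u₀ = 0`, `u_n = K_e𝒱 + 2eρ_{n−1}K_e u_{n−1}∗u_{n−1}`, `ρ_n = 2e/∫𝒱(1 − u_n)`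
(§2 `(iteration)`–`(rhon)`). Everything here is in `[0,∞]`-valued form with Mathlib's lower-integral convolution
`⋆ₗ` (monotone convergence is then free), the tree's Yukawa theory
(`LiebSimpleEquationYukawa*.lean`: `∫Y_c = 1/c`, the resolvent identity `Y_a∗Y_b = (Y_a − Y_b)/(b − a)`,
`Y_c ∈ L^q`, `q < 3`) and the tree's definitions `kMap/kSup/kRes` of `K` by monotone iteration and
truncation of the potential (`LiebSimpleEquationResolventDefs.lean`); one order lemma
(`iSup_mul_iSup_of_monotone`) is reused from `Literature.Analysis.FluidPDE.FujitaKatoMajorant`.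

* Layer A — the linear theory of `K = kRes c V` (`c = 4e`): the truncated map
  `T w = G_{c+M}(φ + (M − U)w)` (`U = min(V, M)`), its minimal fixed point `kSup` (monotone
  convergence), the bound `kSup ≤ G_c φ` (resolvent identity), the resolvent equation
  `w + G_c(Uw) = G_cφ`, uniqueness of comparable bounded fixed points (a `M/(c+M)`-contraction),
  additivity/homogeneity/monotonicity, monotonicity in `c` and in the truncation level, the limit
  `K = ⨅_M kSup_M` and its resolvent equation `Kφ + G_c(V·Kφ) = G_cφ` (CJL-I (1.14), by dominated
  convergence), the identity `K V + c K 1 = 1`, uniqueness of finite solutions of the resolvent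
  equation, and the resolvent identity in the parameter `K_c = K_{c'} + (c' − c)K_cK_{c'}`.
* Layer B — Lemmas 4 and 5: the joint induction `u_n ≤ u_{n+1} ≤ 1`, `ρ_n ≤ ρ_{n+1}`,
  `2e∫u_n < ∫𝒱(1 − u_n)` (`(simple17)`, via the integrated equation and the elementary
  `simple17_real`).
* Layer C — Lemma 6: the limit `u = ⨆u_n`, `ρ = ⨆ρ_n = 2e/∫𝒱(1 − u)`, its equation in resolvent
  and in mild form, `u = K(𝒱 + 2eρu∗u)`, and `ρ = 1/∫u` ((1.6)).
* Layer D — back to real functions: the constructed `(ρ, e, u)` is an `IsSolution`; every solution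
  with `e > 0` has `ρ > 0`, is measurable, and (Lemma 7) coincides with the constructed one
  (`ũ ≥ u_n`, `ρ̃ ≥ ρ_n` by induction, then `1/ρ̃ = ∫ũ ≥ ∫u = 1/ρ`); everywhere (not only a.e.)
  equality follows from the mild form.
* Layer E — Lemma 8, continuity of `ρ` on `(0,∞)`: `ρ = ⨆ρ_n` with each `ρ_n` continuous (lower
  semicontinuity) and `1/ρ = ∫u = ⨆∫u_n` with each `∫u_n` continuous (upper semicontinuity); the
  continuity of `ρ_n`, `∫u_n` in `e` is proved by `L¹`-estimates along the iteration
  (`‖K_cf − K_{c'}f‖₁ ≤ |c − c'|‖f‖₁/(cc')`, `‖Kf − Kf'‖₁ ≤ ‖f − f'‖₁/c`,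
  `‖u⋆u − v⋆v‖₁ ≤ ‖u − v‖₁(‖u − v‖₁ + 2‖v‖₁)`, `∫𝒱|u − v| → 0`).
* Layer F — Lemma 8, the limits: `ρ(e) ≥ ρ₀(e) = 2e/∫𝒱 → ∞`; and `ρ(e) → 0` as `e → 0⁺`.
* Layer G — assembly; an arbitrary (a.e.-measurable) `𝒱` is replaced by a measurable non-negative
  modification, which does not change the solution set.

## Deviations from the printed argument (recorded, not hidden)

1. Lemma 5 (`u_n ≤ 1`) is printed with a subharmonicity/maximum-principle argument in `W^{2,p}`;
   here it follows from the identity `K_e𝒱 + 4eK_e1 = 1` (i.e. `K_e𝒱 = 1 − 4eK_e1 ≤ 1`) and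
   `u_n∗u_n ≤ ‖u_n‖₁ ≤ 1/ρ_n`, giving `u_{n+1} ≤ K_e(𝒱 + 2e) ≤ 1`.
2. `lim_{e→0} ρ(e) = 0` is printed as a consequence of (1.21) `(con4B)`, `ρ ≤ 4e/‖𝒱‖₁`, which is
   FALSE in general (see `LiebSimpleEquationErratum.lean`; only `2e/‖𝒱‖₁ ≤ ρ` holds). The statement
   is nevertheless true in `d = 3` and is proved here from `1/ρ(e) = ∫u ≥ ∫K_{4e}𝒱 =
   ∫𝒱(1 − K_{4e}𝒱)/(4e) ≥ ℓ/(4e)` with `ℓ := ∫𝒱(1 − φ) > 0`, `φ := sup_e K_{4e}𝒱`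
   (`lowEnergy_L_ne_zero`: `ℓ = 0` would force `K_{4e}𝒱 ≤ G_0(𝒱(1 − K_{4e}𝒱)) ↓ 0`, hence `𝒱 = 0`
   a.e.; this uses the finiteness of the Newton potential `G_0𝒱`, `newton_pot_ne_top`).
3. Continuity of `ρ(e)` is printed via the telescoping identity `(simpleq3C)`–`(rate)` and uniform convergence;
   here the equivalent two-sided semicontinuity argument of Layer E is used.
4. Uniqueness for the LINEAR resolvent equation (needed to identify a given solution with `K` of its
   data, tacit in CJL's use of `K_e` as an operator) is proved by the sub-solution/contraction argument
   `kRes_unique`.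

## References

* [CarlenJauslinLieb2020] E. A. Carlen, I. Jauslin, E. H. Lieb, *Analysis of a simple equation for
  the ground state energy of the Bose gas*, Pure Appl. Anal. 2 (2020) 659–684, arXiv:1912.04987:
  Theorem 1, (1.5)–(1.17), (1.21), §2 Lemmas 4–8 (equation labels of the arXiv version: `(Phidef)`, `(iteration)`, `(rhon)`, `(simple17)`, `(simpleq3C)`, `(rate)`).
* [LiebLoss2001] E. H. Lieb, M. Loss, *Analysis*, 2nd ed., AMS (2001), §6.23 (Yukawa and Newton
  potentials).
-/

noncomputable section

open MeasureTheory Filter Set Real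
open scoped ENNReal NNReal Topology

namespace Literature.MathematicalPhysics.QuantumManyBody

namespace LiebSimpleEquation

open BoseGas (Space)
open Literature.Analysis.FluidPDE.FujitaKato (iSup_mul_iSup_of_monotone)

/-- Local notation: `𝐆[c] f = Y_c ⋆ₗ f`, the positive operator `G = (−Δ + c)⁻¹` on `[0,∞]`-valued
`f` (CJL-I (1.7)–(1.9)). -/
local notation3 "𝐆[" c "] " f:100 =>
  MeasureTheory.lconvolution (ENNReal.ofReal ∘ yukawa c) f MeasureTheory.volume

/-- `𝐋[V, w] = ∫ V (1 − w)` (so that `ρ_n = 2e / 𝐋[V, u_n]`, CJL-I §2 `(rhon)`). -/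
local notation3 (prettyPrint := false) "𝐋[" V ", " w "]" => ∫⁻ z, V z * (1 - w z)

/-- The data `V + 2eρ · w ⋆ w` of one iteration step (CJL-I §2 `(iteration)`). -/
local notation3 (prettyPrint := false) "𝚽[" e ", " ρ ", " V ", " w "]" =>
  fun y => V y + ENNReal.ofReal (2 * e) * ρ * MeasureTheory.lconvolution w w MeasureTheory.volume y

/-- One step of the iteration: `u_{n+1} = K_{4e}(V + 2eρ_n u_n ⋆ u_n)`, `ρ_n = 2e/∫V(1 − u_n)`
(CJL-I §2 `(iteration)`–`(rhon)`). -/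
local notation3 (prettyPrint := false) "𝐍[" e ", " V ", " w "]" =>
  kRes (4 * e) V 𝚽[e, ENNReal.ofReal (2 * e) / 𝐋[V, w], V, w]

/-! ## The operators `𝐆[c]`: algebra -/

section GOps

variable {c : ℝ}

/-- `G_c g` is measurable for measurable `g`. [folklore] -/
theorem G_measurable (c : ℝ) {g : Space → ℝ≥0∞} (hg : Measurable g) : Measurable (𝐆[c] g) :=
  measurable_lconvolution _ (measurable_ofReal_yukawa c) hg

/-- `G_c` is monotone: `g ≤ h ⇒ G_c g ≤ G_c h`. [folklore] -/
theorem G_mono (c : ℝ) {g h : Space → ℝ≥0∞} (hgh : g ≤ h) : 𝐆[c] g ≤ 𝐆[c] h :=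
  lconvolution_mono le_rfl hgh

/-- `G_c` is additive: `G_c(g + h) = G_c g + G_c h` (measurable `g`). [folklore] -/
theorem G_add (c : ℝ) {g : Space → ℝ≥0∞} (hg : Measurable g) (h : Space → ℝ≥0∞) (x : Space) :
    (𝐆[c] fun y => g y + h y) x = (𝐆[c] g) x + (𝐆[c] h) x :=
  lconvolution_add_right (measurable_ofReal_yukawa c) hg h x

/-- `G_{c'} ≤ G_c` for `c ≤ c'`. [folklore] -/
theorem G_anti {c c' : ℝ} (h : c ≤ c') (f : Space → ℝ≥0∞) : 𝐆[c'] f ≤ 𝐆[c] f :=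
  yukawa_lconv_anti h f

/-- `G_c` is homogeneous: `G_c(k g) = k G_c g`. [folklore] -/
theorem G_const_mul (c : ℝ) {g : Space → ℝ≥0∞} (hg : Measurable g) (k : ℝ≥0∞) (x : Space) :
    (𝐆[c] fun y => k * g y) x = k * (𝐆[c] g) x :=
  lconvolution_const_mul_right (measurable_ofReal_yukawa c) hg k x

/-- `G_c g ≤ (1/c)·C` if `g ≤ C` (`∫Y_c = 1/c`). [cite: CarlenJauslinLieb2020, (1.8)] -/
theorem G_le_of_le (hc : 0 < c) {g : Space → ℝ≥0∞} {C : ℝ≥0∞} (hC : ∀ y, g y ≤ C) (x : Space) :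
    (𝐆[c] g) x ≤ ENNReal.ofReal (1 / c) * C :=
  yukawa_lconv_le hc hC x

/-- `G_c 0 = 0`. [folklore] -/
theorem G_zero (c : ℝ) : (𝐆[c] (0 : Space → ℝ≥0∞)) = 0 :=
  lconvolution_zero _ _

/-- `∫ G_c g = (1/c) ∫ g` (Tonelli). [cite: CarlenJauslinLieb2020, (1.11)] -/
theorem lintegral_G (hc : 0 < c) {g : Space → ℝ≥0∞} (hg : Measurable g) :
    ∫⁻ x, (𝐆[c] g) x = ENNReal.ofReal (1 / c) * ∫⁻ y, g y :=
  lintegral_yukawa_lconv hc hg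

/-- The resolvent identity `G_a f = G_b f + (b − a) G_b (G_a f)` (`0 < a < b`), in the order we use.
[folklore] -/
theorem G_resolvent {a b : ℝ} (ha : 0 < a) (hab : a < b) {f : Space → ℝ≥0∞} (hf : Measurable f)
    (x : Space) :
    (𝐆[a] f) x = (𝐆[b] f) x + ENNReal.ofReal (b - a) * (𝐆[b] (𝐆[a] f)) x := by
  rw [yukawa_lconv_resolvent ha hab hf x, yukawa_lconv_comm a b hf]

/-- `G_c f` of a function bounded by `C` with `c > 0`, numerically: `≤ C / c`. [folklore] -/
theorem G_le_div (hc : 0 < c) {g : Space → ℝ≥0∞} {C : ℝ≥0∞} (hC : ∀ y, g y ≤ C) (x : Space) :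
    (𝐆[c] g) x ≤ C / ENNReal.ofReal c := by
  refine (G_le_of_le hc hC x).trans (le_of_eq ?_)
  rw [one_div, ENNReal.ofReal_inv_of_pos hc, mul_comm, div_eq_mul_inv]

end GOps

/-! ## Layer A1: the monotone map `kMap` and its iterates -/

section KMap

variable {c M : ℝ} {U φ : Space → ℝ≥0∞}

/-- The truncated resolvent map `T w = G_{c+M}(φ + (M − U)w)` is monotone in `w`.
[cite: CarlenJauslinLieb2020, (1.13)–(1.16)] -/
theorem kMap_mono (c M : ℝ) (U φ : Space → ℝ≥0∞) : Monotone (kMap c M U φ) := by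
  intro w w' h x
  rw [kMap_apply, kMap_apply]
  exact lconvolution_mono le_rfl (fun y => add_le_add le_rfl (mul_le_mul' le_rfl (h y))) x

/-- `T` is monotone in the data `φ`, antitone in the potential `U`, monotone in `w`.
[cite: CarlenJauslinLieb2020, (1.13)–(1.16)] -/
theorem kMap_mono_data {U U' φ φ' w w' : Space → ℝ≥0∞} (hU : U' ≤ U) (hφ : φ ≤ φ') (hw : w ≤ w') :
    kMap c M U φ w ≤ kMap c M U' φ' w' := by
  intro x
  rw [kMap_apply, kMap_apply]
  exact lconvolution_mono le_rfl
    (fun y => add_le_add (hφ y) (mul_le_mul' (tsub_le_tsub_left (hU y) _) (hw y))) x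

/-- `T w` is measurable for measurable `U, φ, w`. [folklore] -/
theorem measurable_kMap (hU : Measurable U) (hφ : Measurable φ) {w : Space → ℝ≥0∞}
    (hw : Measurable w) : Measurable (kMap c M U φ w) := by
  unfold kMap
  refine measurable_lconvolution _ (measurable_ofReal_yukawa _) ?_
  fun_prop

/-- The iterates `Tⁿ w₀` are measurable. [folklore] -/
theorem measurable_iterate_kMap (hU : Measurable U) (hφ : Measurable φ) {w₀ : Space → ℝ≥0∞}
    (hw₀ : Measurable w₀) (n : ℕ) : Measurable ((kMap c M U φ)^[n] w₀) := by
  induction n with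
  | zero => simpa using hw₀
  | succ n ih =>
    rw [Function.iterate_succ']
    exact measurable_kMap hU hφ ih

/-- From a sub-solution `w₀ ≤ T w₀` the iterates `Tⁿ w₀` increase (CJL-I §2: solution by monotone
iteration). [cite: CarlenJauslinLieb2020, §2 (`(Phidef)`, iteration from `u₀ = 0`)] -/
theorem monotone_iterate_kMap {w₀ : Space → ℝ≥0∞} (h0 : w₀ ≤ kMap c M U φ w₀) :
    Monotone fun n => (kMap c M U φ)^[n] w₀ :=
  (kMap_mono c M U φ).monotone_iterate_of_le_map h0

/-- Unfolding `kSup` as the pointwise supremum of the iterates.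
[cite: CarlenJauslinLieb2020, §2 (`(Phidef)`, iteration from `u₀ = 0`)] -/
theorem kSup_eq (c M : ℝ) (U φ w₀ : Space → ℝ≥0∞) :
    kSup c M U φ w₀ = fun x => ⨆ n : ℕ, ((kMap c M U φ)^[n] w₀) x := rfl

/-- The starting point lies below `kSup`. [folklore] -/
theorem le_kSup_self (c M : ℝ) (U φ w₀ : Space → ℝ≥0∞) : w₀ ≤ kSup c M U φ w₀ :=
  fun x => le_iSup (fun n : ℕ => ((kMap c M U φ)^[n] w₀) x) 0

/-- `kSup` is measurable. [folklore] -/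
theorem measurable_kSup (hU : Measurable U) (hφ : Measurable φ) {w₀ : Space → ℝ≥0∞}
    (hw₀ : Measurable w₀) : Measurable (kSup c M U φ w₀) := by
  rw [kSup_eq]
  exact Measurable.iSup (measurable_iterate_kMap hU hφ hw₀)

/-- **`kSup` is a fixed point of `kMap`** (monotone convergence), from any sub-solution `w₀ ≤ T w₀`.
[cite: CarlenJauslinLieb2020, §2] -/
theorem kMap_kSup (hU : Measurable U) (hφ : Measurable φ) {w₀ : Space → ℝ≥0∞}
    (hw₀ : Measurable w₀) (h0 : w₀ ≤ kMap c M U φ w₀) :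
    kMap c M U φ (kSup c M U φ w₀) = kSup c M U φ w₀ := by
  have hmono := monotone_iterate_kMap h0
  funext x
  rw [kMap_apply]
  have h1 : (fun y => φ y + (ENNReal.ofReal M - U y) * kSup c M U φ w₀ y) =
      fun y => ⨆ n : ℕ, (φ y + (ENNReal.ofReal M - U y) * ((kMap c M U φ)^[n] w₀) y) := by
    funext y
    rw [kSup_apply, ENNReal.mul_iSup, ENNReal.add_iSup]
  have hmeas : ∀ n : ℕ, Measurable fun y => φ y + (ENNReal.ofReal M - U y) * ((kMap c M U φ)^[n] w₀) y := by
    intro n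
    have := measurable_iterate_kMap hU hφ hw₀ n (c := c) (M := M)
    fun_prop
  have hmono' : Monotone fun n : ℕ => fun y => φ y + (ENNReal.ofReal M - U y) * ((kMap c M U φ)^[n] w₀) y := by
    intro n m hnm y
    exact add_le_add le_rfl (mul_le_mul' le_rfl (hmono hnm y))
  rw [h1, lconvolution_iSup_right (measurable_ofReal_yukawa _) hmeas hmono' x, kSup_apply]
  apply le_antisymm
  · refine iSup_le fun n => ?_
    have h2 : ((ENNReal.ofReal ∘ yukawa (c + M)) ⋆ₗ fun y => φ y + (ENNReal.ofReal M - U y) *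
        ((kMap c M U φ)^[n] w₀) y) x = ((kMap c M U φ)^[n + 1] w₀) x := by
      rw [Function.iterate_succ_apply', kMap_apply]
    rw [h2]
    exact le_iSup (fun n : ℕ => ((kMap c M U φ)^[n] w₀) x) (n + 1)
  · refine iSup_le fun n => ?_
    have h2 : ((kMap c M U φ)^[n] w₀) x ≤ ((kMap c M U φ)^[n + 1] w₀) x := hmono n.le_succ x
    refine h2.trans ?_
    rw [Function.iterate_succ_apply', kMap_apply]
    exact le_iSup (fun n : ℕ => ((ENNReal.ofReal ∘ yukawa (c + M)) ⋆ₗ fun y => φ y +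
      (ENNReal.ofReal M - U y) * ((kMap c M U φ)^[n] w₀) y) x) n

/-- Pointwise form of the fixed-point equation. [cite: CarlenJauslinLieb2020, §2] -/
theorem kSup_fixed (hU : Measurable U) (hφ : Measurable φ) {w₀ : Space → ℝ≥0∞}
    (hw₀ : Measurable w₀) (h0 : w₀ ≤ kMap c M U φ w₀) (x : Space) :
    kSup c M U φ w₀ x =
      (𝐆[c + M] fun y => φ y + (ENNReal.ofReal M - U y) * kSup c M U φ w₀ y) x := by
  conv_lhs => rw [← kMap_kSup hU hφ hw₀ h0]
  rfl

/-- If `T z ≤ z` then all iterates from `w₀ ≤ z` stay below `z`; hence `kSup ≤ z`.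
[cite: CarlenJauslinLieb2020, §2] -/
theorem kSup_le_of_kMap_le {z w₀ : Space → ℝ≥0∞} (hz : kMap c M U φ z ≤ z) (h0 : w₀ ≤ z) :
    kSup c M U φ w₀ ≤ z := by
  have : ∀ n : ℕ, (kMap c M U φ)^[n] w₀ ≤ z := by
    intro n
    induction n with
    | zero => simpa using h0
    | succ n ih =>
      rw [Function.iterate_succ_apply']
      exact ((kMap_mono c M U φ) ih).trans hz
  intro x
  rw [kSup_apply]
  exact iSup_le fun n => this n x

/-- Comparison of `kSup` for comparable data and starting points.
[cite: CarlenJauslinLieb2020, §2] -/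
theorem kSup_mono_data {U U' φ φ' w₀ w₀' : Space → ℝ≥0∞} (hU : U' ≤ U) (hφ : φ ≤ φ')
    (hw : w₀ ≤ w₀') : kSup c M U φ w₀ ≤ kSup c M U' φ' w₀' := by
  have : ∀ n : ℕ, (kMap c M U φ)^[n] w₀ ≤ (kMap c M U' φ')^[n] w₀' := by
    intro n
    induction n with
    | zero => simpa using hw
    | succ n ih =>
      rw [Function.iterate_succ_apply', Function.iterate_succ_apply']
      exact kMap_mono_data hU hφ ih
  intro x
  rw [kSup_apply, kSup_apply]
  exact iSup_mono fun n => this n x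

/-! ## Layer A2: the bound `kSup ≤ G_c φ` -/

/-- One step: if `w ≤ G_c φ` then `T w ≤ G_c φ` (resolvent identity).
[cite: CarlenJauslinLieb2020, §2] -/
theorem kMap_le_G (hc : 0 < c) (hM : 0 < M) (hφ : Measurable φ) {w : Space → ℝ≥0∞}
    (hle : w ≤ 𝐆[c] φ) : kMap c M U φ w ≤ 𝐆[c] φ := by
  intro x
  rw [kMap_apply]
  have hGφ : Measurable (𝐆[c] φ) := G_measurable c hφ
  calc ((ENNReal.ofReal ∘ yukawa (c + M)) ⋆ₗ fun y => φ y + (ENNReal.ofReal M - U y) * w y) x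
      ≤ (𝐆[c + M] fun y => φ y + ENNReal.ofReal M * (𝐆[c] φ) y) x :=
        lconvolution_mono le_rfl (fun y => add_le_add le_rfl (mul_le_mul' tsub_le_self (hle y))) x
    _ = (𝐆[c + M] φ) x + ENNReal.ofReal M * (𝐆[c + M] (𝐆[c] φ)) x := by
        rw [G_add (c + M) hφ _ x, G_const_mul (c + M) hGφ]
    _ = (𝐆[c] φ) x := by
        rw [G_resolvent hc (by linarith : c < c + M) hφ x, add_sub_cancel_left]

/-- All iterates from `w₀ ≤ G_c φ` stay below `G_c φ`. [cite: CarlenJauslinLieb2020, (1.15)] -/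
theorem iterate_kMap_le_G (hc : 0 < c) (hM : 0 < M) (hφ : Measurable φ) {w₀ : Space → ℝ≥0∞}
    (h0 : w₀ ≤ 𝐆[c] φ) (n : ℕ) : (kMap c M U φ)^[n] w₀ ≤ 𝐆[c] φ := by
  induction n with
  | zero => simpa using h0
  | succ n ih =>
    rw [Function.iterate_succ_apply']
    exact kMap_le_G hc hM hφ ih

/-- **`kSup ≤ G_c φ`** (`0 ≤ K ≤ G`, CJL-I (1.15)). [cite: CarlenJauslinLieb2020, §2] -/
theorem kSup_le_G (hc : 0 < c) (hM : 0 < M) (hφ : Measurable φ) {w₀ : Space → ℝ≥0∞}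
    (h0 : w₀ ≤ 𝐆[c] φ) : kSup c M U φ w₀ ≤ 𝐆[c] φ := by
  intro x
  rw [kSup_apply]
  exact iSup_le fun n => iterate_kMap_le_G hc hM hφ h0 n x

/-! ## Layer A3: fixed point ⇒ resolvent equation `w + G_c(U w) = G_c φ` -/

/-- A fixed point `w = T w` with `U ≤ M` and `G_c φ` bounded satisfies `w + G_c(U w) = G_c φ`.
[cite: CarlenJauslinLieb2020, §2] -/
theorem resolvent_eq_of_fixed (hc : 0 < c) (hM : 0 < M) (hU : Measurable U)
    (hUM : ∀ y, U y ≤ ENNReal.ofReal M) (hφ : Measurable φ) {B : ℝ≥0∞} (hB : B ≠ ∞)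
    (hφB : ∀ x, (𝐆[c] φ) x ≤ B) {w : Space → ℝ≥0∞} (hw : Measurable w)
    (hfix : kMap c M U φ w = w) (hwG : w ≤ 𝐆[c] φ) (x : Space) :
    w x + (𝐆[c] fun y => U y * w y) x = (𝐆[c] φ) x := by
  -- ψ := φ + (M − U) w, w = G_{c+M} ψ, and G_c ψ = w + M G_c w
  set ψ : Space → ℝ≥0∞ := fun y => φ y + (ENNReal.ofReal M - U y) * w y with hψ
  have hψm : Measurable ψ := by
    rw [hψ]; fun_prop
  have hwψ : w = 𝐆[c + M] ψ := by
    rw [← hfix]; rfl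
  have hUw : Measurable fun y => U y * w y := hU.mul hw
  have hMUw : Measurable fun y => (ENNReal.ofReal M - U y) * w y := by fun_prop
  -- (1) G_c ψ = w + M G_c w
  have h1 : (𝐆[c] ψ) x = w x + ENNReal.ofReal M * (𝐆[c] w) x := by
    rw [yukawa_lconv_resolvent hc (by linarith : c < c + M) hψm x, ← hwψ, add_sub_cancel_left]
  -- (2) G_c ψ = G_c φ + G_c((M−U)w) and G_c((M−U)w) + G_c(Uw) = M G_c w
  have h2 : (𝐆[c] ψ) x = (𝐆[c] φ) x + (𝐆[c] fun y => (ENNReal.ofReal M - U y) * w y) x := by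
    rw [hψ, G_add c hφ _ x]
  have h3 : (𝐆[c] fun y => (ENNReal.ofReal M - U y) * w y) x + (𝐆[c] fun y => U y * w y) x =
      ENNReal.ofReal M * (𝐆[c] w) x := by
    rw [← G_add c hMUw _ x, ← G_const_mul c hw]
    congr 1
    funext y
    rw [← add_mul, tsub_add_cancel_of_le (hUM y)]
  -- finiteness of M G_c w
  have hfin : ENNReal.ofReal M * (𝐆[c] w) x ≠ ∞ := by
    refine ENNReal.mul_ne_top ENNReal.ofReal_ne_top (ne_top_of_le_ne_top ?_ ((G_mono c hwG x).trans
      (G_le_of_le hc hφB x)))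
    exact ENNReal.mul_ne_top ENNReal.ofReal_ne_top hB
  -- assemble: (w + G(Uw)) + M G w = G φ + M G w
  have h4 : w x + (𝐆[c] fun y => U y * w y) x + ENNReal.ofReal M * (𝐆[c] w) x =
      (𝐆[c] φ) x + ENNReal.ofReal M * (𝐆[c] w) x := by
    calc w x + (𝐆[c] fun y => U y * w y) x + ENNReal.ofReal M * (𝐆[c] w) x
        = (w x + ENNReal.ofReal M * (𝐆[c] w) x) + (𝐆[c] fun y => U y * w y) x := by ring
      _ = (𝐆[c] φ) x + (𝐆[c] fun y => (ENNReal.ofReal M - U y) * w y) x +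
            (𝐆[c] fun y => U y * w y) x := by rw [← h1, h2]
      _ = (𝐆[c] φ) x + ENNReal.ofReal M * (𝐆[c] w) x := by rw [add_assoc, h3]
  exact (ENNReal.add_left_inj hfin).1 h4

/-! ## Layer A4: comparable bounded fixed points coincide -/

/-- Contraction: if `d ≤ G_{c+M}((M − U) d')`-type bound... precisely: two fixed points
`w₁ ≤ w₂ ≤ B < ∞` of `T` coincide. [cite: CarlenJauslinLieb2020, §2] -/
theorem fixed_unique_of_le (hc : 0 < c) (hM : 0 < M) (hU : Measurable U) (hφ : Measurable φ)
    {B : ℝ≥0∞} (hB : B ≠ ∞) {w₁ w₂ : Space → ℝ≥0∞} (hw₁ : Measurable w₁) (hw₂ : Measurable w₂)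
    (h1 : kMap c M U φ w₁ = w₁) (h2 : kMap c M U φ w₂ = w₂) (hle : w₁ ≤ w₂) (hB₂ : ∀ x, w₂ x ≤ B) :
    w₁ = w₂ := by
  -- d := w₂ − w₁
  set d : Space → ℝ≥0∞ := fun x => w₂ x - w₁ x with hd
  have hdm : Measurable d := by rw [hd]; fun_prop
  have hw₂d : ∀ x, w₂ x = w₁ x + d x := fun x => (add_tsub_cancel_of_le (hle x)).symm
  have hB₁ : ∀ x, w₁ x ≠ ∞ := fun x => ne_top_of_le_ne_top hB ((hle x).trans (hB₂ x))
  have hMU : Measurable fun y => (ENNReal.ofReal M - U y) * w₁ y := by fun_prop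
  have hMUd : Measurable fun y => (ENNReal.ofReal M - U y) * d y := by fun_prop
  -- d = G_{c+M}((M−U) d)
  have hdeq : ∀ x, d x = (𝐆[c + M] fun y => (ENNReal.ofReal M - U y) * d y) x := by
    intro x
    have e2 : w₂ x = (𝐆[c + M] fun y => φ y + (ENNReal.ofReal M - U y) * w₂ y) x := by
      conv_lhs => rw [← h2]
      rfl
    have e1 : w₁ x = (𝐆[c + M] fun y => φ y + (ENNReal.ofReal M - U y) * w₁ y) x := by
      conv_lhs => rw [← h1]
      rfl
    have e3 : (fun y => φ y + (ENNReal.ofReal M - U y) * w₂ y) =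
        fun y => (φ y + (ENNReal.ofReal M - U y) * w₁ y) + (ENNReal.ofReal M - U y) * d y := by
      funext y
      rw [hw₂d y, mul_add, add_assoc]
    have hm1 : Measurable fun y => φ y + (ENNReal.ofReal M - U y) * w₁ y := by fun_prop
    have e4 : w₂ x = w₁ x + (𝐆[c + M] fun y => (ENNReal.ofReal M - U y) * d y) x := by
      rw [e2, e3, G_add (c + M) hm1 _ x, ← e1]
    have e5 : w₁ x + d x = w₁ x + (𝐆[c + M] fun y => (ENNReal.ofReal M - U y) * d y) x := by
      rw [← hw₂d x, e4]
    exact (ENNReal.add_right_inj (hB₁ x)).1 e5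
  -- s := sup d ≤ B, and s ≤ (M/(c+M)) s
  set s : ℝ≥0∞ := ⨆ x, d x with hs
  have hsB : s ≤ B := iSup_le fun x => (tsub_le_self).trans (hB₂ x)
  have hs_ne : s ≠ ∞ := ne_top_of_le_ne_top hB hsB
  have hds : ∀ x, d x ≤ s := fun x => le_iSup (fun x => d x) x
  have hcM : 0 < c + M := by linarith
  have hbound : ∀ x, d x ≤ ENNReal.ofReal (M / (c + M)) * s := by
    intro x
    rw [hdeq x]
    calc (𝐆[c + M] fun y => (ENNReal.ofReal M - U y) * d y) x
        ≤ ENNReal.ofReal (1 / (c + M)) * (ENNReal.ofReal M * s) :=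
          G_le_of_le hcM (fun y => mul_le_mul' tsub_le_self (hds y)) x
      _ = ENNReal.ofReal (M / (c + M)) * s := by
          rw [← mul_assoc, ← ENNReal.ofReal_mul (by positivity)]
          congr 1
          rw [one_div, ← div_eq_inv_mul]
  have hs0 : s = 0 := by
    by_contra hne
    have hsle : s ≤ ENNReal.ofReal (M / (c + M)) * s := iSup_le hbound
    have hpos : 0 < s.toReal := ENNReal.toReal_pos hne hs_ne
    have hr' : (ENNReal.ofReal (M / (c + M))).toReal = M / (c + M) :=
      ENNReal.toReal_ofReal (by positivity)
    have hlt1 : M / (c + M) < 1 := (div_lt_one hcM).2 (by linarith)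
    have h' := ENNReal.toReal_mono (ENNReal.mul_ne_top ENNReal.ofReal_ne_top hs_ne) hsle
    rw [ENNReal.toReal_mul, hr'] at h'
    nlinarith
  funext x
  have hdx : d x = 0 := le_antisymm (hs0 ▸ hds x) bot_le
  rw [hw₂d x, hdx, add_zero]

/-! ## Layer A5: linearity, monotonicity in the parameters -/

/-- The iterates from `0` are additive in the data `φ`. [cite: CarlenJauslinLieb2020, (1.13)] -/
theorem iterate_kMap_add (hU : Measurable U) {φ₁ : Space → ℝ≥0∞} (hφ₁ : Measurable φ₁)
    (φ₂ : Space → ℝ≥0∞) (n : ℕ) :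
    (kMap c M U (fun y => φ₁ y + φ₂ y))^[n] 0 =
      fun x => ((kMap c M U φ₁)^[n] 0) x + ((kMap c M U φ₂)^[n] 0) x := by
  induction n with
  | zero => funext x; simp
  | succ n ih =>
    funext x
    rw [Function.iterate_succ_apply', ih, kMap_apply, Function.iterate_succ_apply',
      Function.iterate_succ_apply', kMap_apply, kMap_apply]
    have ha : Measurable ((kMap c M U φ₁)^[n] 0) := measurable_iterate_kMap hU hφ₁ measurable_zero n
    have hm : Measurable fun y => φ₁ y + (ENNReal.ofReal M - U y) * ((kMap c M U φ₁)^[n] 0) y := by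
      fun_prop
    rw [← G_add (c + M) hm _ x]
    congr 1
    funext y
    ring

/-- The minimal truncated solution is additive in the data `φ`.
[cite: CarlenJauslinLieb2020, (1.13)] -/
theorem kSup_add (hU : Measurable U) {φ₁ : Space → ℝ≥0∞} (hφ₁ : Measurable φ₁)
    (φ₂ : Space → ℝ≥0∞) (x : Space) :
    kSup c M U (fun y => φ₁ y + φ₂ y) 0 x = kSup c M U φ₁ 0 x + kSup c M U φ₂ 0 x := by
  simp only [kSup_apply, iterate_kMap_add hU hφ₁ φ₂]
  have h1 := monotone_iterate_kMap (c := c) (M := M) (U := U) (φ := φ₁) (w₀ := 0) bot_le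
  have h2 := monotone_iterate_kMap (c := c) (M := M) (U := U) (φ := φ₂) (w₀ := 0) bot_le
  exact (ENNReal.iSup_add_iSup_of_monotone (fun n m h => h1 h x) (fun n m h => h2 h x)).symm

/-- The iterates from `0` are homogeneous in the data `φ`. [cite: CarlenJauslinLieb2020, (1.13)] -/
theorem iterate_kMap_const_mul (hU : Measurable U) (hφ : Measurable φ) (k : ℝ≥0∞) (n : ℕ) :
    (kMap c M U (fun y => k * φ y))^[n] 0 = fun x => k * ((kMap c M U φ)^[n] 0) x := by
  induction n with
  | zero => funext x; simp
  | succ n ih =>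
    funext x
    rw [Function.iterate_succ_apply', ih, kMap_apply, Function.iterate_succ_apply', kMap_apply]
    have ha : Measurable ((kMap c M U φ)^[n] 0) := measurable_iterate_kMap hU hφ measurable_zero n
    have hm : Measurable fun y => φ y + (ENNReal.ofReal M - U y) * ((kMap c M U φ)^[n] 0) y := by
      fun_prop
    rw [← G_const_mul (c + M) hm k x]
    congr 1
    funext y
    ring

/-- The minimal truncated solution is homogeneous in the data `φ`.
[cite: CarlenJauslinLieb2020, (1.13)] -/
theorem kSup_const_mul (hU : Measurable U) (hφ : Measurable φ) (k : ℝ≥0∞) (x : Space) :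
    kSup c M U (fun y => k * φ y) 0 x = k * kSup c M U φ 0 x := by
  simp only [kSup_apply, iterate_kMap_const_mul hU hφ k, ENNReal.mul_iSup]

/-- `kSup` decreases with `c` (the kernels `Y_{c+M}` do). [cite: CarlenJauslinLieb2020, §2] -/
theorem kSup_anti_c {c c' : ℝ} (hcc' : c ≤ c') (M : ℝ) (U φ : Space → ℝ≥0∞) :
    kSup c' M U φ 0 ≤ kSup c M U φ 0 := by
  have : ∀ n : ℕ, (kMap c' M U φ)^[n] 0 ≤ (kMap c M U φ)^[n] 0 := by
    intro n
    induction n with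
    | zero => exact le_rfl
    | succ n ih =>
      rw [Function.iterate_succ_apply', Function.iterate_succ_apply']
      intro x
      rw [kMap_apply, kMap_apply]
      exact lconvolution_mono (fun y => ENNReal.ofReal_le_ofReal (yukawa_antitone (by linarith) y))
        (fun y => add_le_add le_rfl (mul_le_mul' le_rfl (ih y))) x
  intro x
  rw [kSup_apply, kSup_apply]
  exact iSup_mono fun n => this n x

/-- **The truncated solutions decrease with the truncation level**: for `M ≤ M'`, `U ≤ U'`
(`U ≤ M`), `kSup c M' U' φ 0 ≤ kSup c M U φ 0` (the smaller problem's solution is a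
supersolution of the larger one). [cite: CarlenJauslinLieb2020, §2] -/
theorem kSup_anti_trunc (hc : 0 < c) (hM : 0 < M) {M' : ℝ} (hMM' : M ≤ M') (hU : Measurable U)
    (hUM : ∀ y, U y ≤ ENNReal.ofReal M) {U' : Space → ℝ≥0∞} (hUU' : U ≤ U') (hφ : Measurable φ) :
    kSup c M' U' φ 0 ≤ kSup c M U φ 0 := by
  set w := kSup c M U φ 0 with hw
  have hwm : Measurable w := measurable_kSup hU hφ measurable_zero
  have hfix : kMap c M U φ w = w := kMap_kSup hU hφ measurable_zero bot_le
  refine kSup_le_of_kMap_le ?_ bot_le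
  intro x
  -- T' w x ≤ G_{c+M'}(φ + (M' - U) w) x = w x
  have hψm : Measurable fun y => φ y + (ENNReal.ofReal M - U y) * w y := by fun_prop
  have key : (𝐆[c + M'] fun y => φ y + (ENNReal.ofReal M' - U y) * w y) x = w x := by
    rcases eq_or_lt_of_le hMM' with h | h
    · subst h
      conv_rhs => rw [← hfix]
      rfl
    · have hres := G_resolvent (by linarith : 0 < c + M) (by linarith : c + M < c + M') hψm x
      have hwfix : w x = (𝐆[c + M] fun y => φ y + (ENNReal.ofReal M - U y) * w y) x := by
        conv_lhs => rw [← hfix]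
        rfl
      have hGw : (𝐆[c + M] fun y => φ y + (ENNReal.ofReal M - U y) * w y) = w := by
        funext z
        conv_rhs => rw [← hfix]
        rfl
      rw [hwfix, hres, hGw, show c + M' - (c + M) = M' - M by ring, ← G_const_mul (c + M') hwm,
        ← G_add (c + M') hψm]
      congr 1
      funext y
      have hsplit : ENNReal.ofReal M' - U y = (ENNReal.ofReal M - U y) + ENNReal.ofReal (M' - M) := by
        have hM'eq : ENNReal.ofReal M' = ENNReal.ofReal M + ENNReal.ofReal (M' - M) := by
          rw [← ENNReal.ofReal_add hM.le (by linarith)]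
          congr 1; ring
        rw [hM'eq, ENNReal.sub_add_eq_add_sub (hUM y) (ne_top_of_le_ne_top ENNReal.ofReal_ne_top (hUM y))]
      rw [hsplit, add_mul, add_assoc]
  rw [kMap_apply]
  calc ((ENNReal.ofReal ∘ yukawa (c + M')) ⋆ₗ fun y => φ y + (ENNReal.ofReal M' - U' y) * w y) x
      ≤ (𝐆[c + M'] fun y => φ y + (ENNReal.ofReal M' - U y) * w y) x :=
        lconvolution_mono le_rfl
          (fun y => add_le_add le_rfl (mul_le_mul' (tsub_le_tsub_left (hUU' y) _) le_rfl)) x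
    _ = w x := key

/-- The constant `1` is the truncated solution for the data `U + c`:
`kSup c M U (U + c) 0 = 1` (i.e. `K(U + c) = 1`, `(−Δ + c + U)1 = U + c`).
[cite: CarlenJauslinLieb2020, §2] -/
theorem kSup_potential_add_const (hc : 0 < c) (hM : 0 < M) (hU : Measurable U)
    (hUM : ∀ y, U y ≤ ENNReal.ofReal M) :
    kSup c M U (fun y => U y + ENNReal.ofReal c) 0 = fun _ => 1 := by
  have hφ : Measurable fun y => U y + ENNReal.ofReal c := hU.add measurable_const
  -- T 1 = 1
  have hT1 : kMap c M U (fun y => U y + ENNReal.ofReal c) (fun _ => 1) = fun _ => 1 := by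
    funext x
    rw [kMap_apply]
    have hpt : (fun y => U y + ENNReal.ofReal c + (ENNReal.ofReal M - U y) * (fun _ => (1 : ℝ≥0∞)) y) =
        fun _ => ENNReal.ofReal (c + M) := by
      funext y
      simp only [mul_one]
      rw [add_assoc, add_comm (ENNReal.ofReal c), ← add_assoc, add_tsub_cancel_of_le (hUM y),
        ← ENNReal.ofReal_add hM.le hc.le, add_comm M c]
    rw [hpt]
    change (𝐆[c + M] fun _ => ENNReal.ofReal (c + M)) x = 1
    rw [yukawa_lconv_const (by linarith : 0 < c + M), ← ENNReal.ofReal_mul (by positivity),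
      one_div_mul_cancel (by positivity : c + M ≠ 0), ENNReal.ofReal_one]
  have hle : kSup c M U (fun y => U y + ENNReal.ofReal c) 0 ≤ fun _ => 1 :=
    kSup_le_of_kMap_le hT1.le bot_le
  exact fixed_unique_of_le hc hM hU hφ ENNReal.one_ne_top (measurable_kSup hU hφ measurable_zero)
    measurable_const (kMap_kSup hU hφ measurable_zero bot_le) hT1 hle (fun _ => le_rfl)

end KMap

/-! ## Layer A6: the resolvent `kRes c V φ = ⨅_M kSup …` for an unbounded potential -/

section KRes

variable {c : ℝ} {V φ : Space → ℝ≥0∞}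

/-- `min(V, M+1) ≤ V`. [folklore] -/
theorem trunc_le_self (V : Space → ℝ≥0∞) (M : ℕ) (y : Space) :
    min (V y) (ENNReal.ofReal ((M : ℝ) + 1)) ≤ V y := min_le_left _ _

/-- The truncated potential `min(V, M+1)` is measurable. [folklore] -/
theorem measurable_trunc (hV : Measurable V) (M : ℕ) :
    Measurable fun y => min (V y) (ENNReal.ofReal ((M : ℝ) + 1)) := hV.min measurable_const

/-- The truncations `min(V, M+1)` increase with `M`. [folklore] -/
theorem trunc_mono (V : Space → ℝ≥0∞) {M M' : ℕ} (h : M ≤ M') (y : Space) :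
    min (V y) (ENNReal.ofReal ((M : ℝ) + 1)) ≤ min (V y) (ENNReal.ofReal ((M' : ℝ) + 1)) :=
  min_le_min le_rfl (ENNReal.ofReal_le_ofReal (by exact_mod_cast Nat.succ_le_succ h))

/-- Eventually (in `M`) the truncation does nothing at a point where `V` is finite. [folklore] -/
theorem trunc_eventually_eq (hVy : ∀ y, V y ≠ ∞) (y : Space) :
    ∀ᶠ M : ℕ in atTop, min (V y) (ENNReal.ofReal ((M : ℝ) + 1)) = V y := by
  obtain ⟨n, hn⟩ := ENNReal.exists_nat_gt (hVy y)
  filter_upwards [eventually_ge_atTop n] with M hM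
  refine min_eq_left (hn.le.trans ?_)
  rw [← ENNReal.ofReal_natCast]
  exact ENNReal.ofReal_le_ofReal (by exact_mod_cast Nat.le_succ_of_le hM)

/-- The truncated solutions, as a sequence in `M`, are antitone.
[cite: CarlenJauslinLieb2020, §2] -/
theorem kSup_trunc_antitone (hc : 0 < c) (hV : Measurable V) (hφ : Measurable φ) :
    Antitone fun M : ℕ => kSup c ((M : ℝ) + 1) (fun y => min (V y) (ENNReal.ofReal ((M : ℝ) + 1))) φ 0 := by
  refine antitone_nat_of_succ_le fun M => ?_
  exact kSup_anti_trunc hc (Nat.cast_add_one_pos M) (by push_cast; linarith) (measurable_trunc hV M)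
    (fun _ => min_le_right _ _) (fun y => trunc_mono V M.le_succ y) hφ

/-- Unfolding `kRes` as the pointwise infimum over the truncation levels.
[cite: CarlenJauslinLieb2020, (1.13)–(1.16)] -/
theorem kRes_eq_iInf (c : ℝ) (V φ : Space → ℝ≥0∞) :
    kRes c V φ = fun x => ⨅ M : ℕ,
      kSup c ((M : ℝ) + 1) (fun y => min (V y) (ENNReal.ofReal ((M : ℝ) + 1))) φ 0 x := rfl

/-- `K φ = kRes c V φ` is measurable. [folklore] -/
theorem measurable_kRes (hV : Measurable V) (hφ : Measurable φ) : Measurable (kRes c V φ) := by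
  rw [kRes_eq_iInf]
  exact Measurable.iInf fun M => measurable_kSup (measurable_trunc hV M) hφ measurable_zero

/-- **`K φ ≤ G_c φ`** (CJL-I (1.15)). [cite: CarlenJauslinLieb2020, §2] -/
theorem kRes_le_G (hc : 0 < c) (hφ : Measurable φ) : kRes c V φ ≤ 𝐆[c] φ := fun x =>
  (kRes_le_kSup c V φ 0 x).trans (kSup_le_G hc (Nat.cast_add_one_pos 0) hφ bot_le x)

/-- **`K` is monotone in the data** (`K_e` preserves positivity, CJL-I after (1.13)).
[cite: CarlenJauslinLieb2020, (1.13)–(1.15)] -/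
theorem kRes_mono {φ φ' : Space → ℝ≥0∞} (h : φ ≤ φ') : kRes c V φ ≤ kRes c V φ' := by
  intro x
  rw [kRes_apply, kRes_apply]
  exact iInf_mono fun M => kSup_mono_data le_rfl h le_rfl x

/-- **`K` is additive** on non-negative measurable data. [cite: CarlenJauslinLieb2020, (1.13)] -/
theorem kRes_add (hc : 0 < c) (hV : Measurable V) {φ₁ φ₂ : Space → ℝ≥0∞} (hφ₁ : Measurable φ₁)
    (hφ₂ : Measurable φ₂) (x : Space) :
    kRes c V (fun y => φ₁ y + φ₂ y) x = kRes c V φ₁ x + kRes c V φ₂ x := by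
  rw [kRes_apply, kRes_apply, kRes_apply]
  simp only [kSup_add (measurable_trunc hV _) hφ₁ φ₂]
  have h1 := kSup_trunc_antitone hc hV hφ₁
  have h2 := kSup_trunc_antitone hc hV hφ₂
  refine (ENNReal.iInf_add_iInf fun i j => ⟨max i j, add_le_add (h1 (le_max_left i j) x)
    (h2 (le_max_right i j) x)⟩).symm

/-- `K 0 = 0`. [cite: CarlenJauslinLieb2020, (1.13)] -/
theorem kRes_zero (hc : 0 < c) : kRes c V (fun _ => 0) = 0 := by
  funext x
  refine le_antisymm ((kRes_le_G hc measurable_const x).trans (le_of_eq ?_)) bot_le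
  change (𝐆[c] (0 : Space → ℝ≥0∞)) x = 0
  rw [G_zero]; rfl

/-- **`K` is homogeneous**: `K(k φ) = k K φ` for a finite constant `k`.
[cite: CarlenJauslinLieb2020, (1.13)] -/
theorem kRes_const_mul (hc : 0 < c) (hV : Measurable V) (hφ : Measurable φ) {k : ℝ≥0∞}
    (hk : k ≠ ∞) (x : Space) : kRes c V (fun y => k * φ y) x = k * kRes c V φ x := by
  rcases eq_or_ne k 0 with rfl | hk0
  · simp only [zero_mul]
    rw [kRes_zero hc]; rfl
  rw [kRes_apply, kRes_apply]
  simp only [kSup_const_mul (measurable_trunc hV _) hφ]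
  exact (ENNReal.mul_iInf_of_ne hk0 hk).symm

/-- **`K_c` decreases with `c`** (so `e ↦ K_e f` is monotone decreasing, CJL-I proof of Lemma 8:
"`u₁(x,e) = K_e𝒱` is … monotone decreasing").
[cite: CarlenJauslinLieb2020, §2 (proof of the continuity lemma)] -/
theorem kRes_anti_c {c c' : ℝ} (hcc' : c ≤ c') (V φ : Space → ℝ≥0∞) : kRes c' V φ ≤ kRes c V φ := by
  intro x
  rw [kRes_apply, kRes_apply]
  exact iInf_mono fun M => kSup_anti_c hcc' _ _ _ x

/-- The truncated solutions satisfy the resolvent equation with the truncated potential.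
[cite: CarlenJauslinLieb2020, §2] -/
theorem kSup_trunc_resolvent_eq (hc : 0 < c) (hV : Measurable V) (hφ : Measurable φ) {B : ℝ≥0∞}
    (hB : B ≠ ∞) (hφB : ∀ x, (𝐆[c] φ) x ≤ B) (M : ℕ) (x : Space) :
    kSup c ((M : ℝ) + 1) (fun y => min (V y) (ENNReal.ofReal ((M : ℝ) + 1))) φ 0 x +
      (𝐆[c] fun y => min (V y) (ENNReal.ofReal ((M : ℝ) + 1)) *
        kSup c ((M : ℝ) + 1) (fun y => min (V y) (ENNReal.ofReal ((M : ℝ) + 1))) φ 0 y) x =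
      (𝐆[c] φ) x :=
  resolvent_eq_of_fixed hc (Nat.cast_add_one_pos M) (measurable_trunc hV M) (fun _ => min_le_right _ _)
    hφ hB hφB (measurable_kSup (measurable_trunc hV M) hφ measurable_zero)
    (kMap_kSup (measurable_trunc hV M) hφ measurable_zero bot_le)
    (kSup_le_G hc (Nat.cast_add_one_pos M) hφ bot_le) x

/-- **The resolvent equation `K φ + G_c(V · K φ) = G_c φ`** for `K = kRes c V`
(CJL-I (1.14): `K_e = G_e − G_e 𝒱 K_e`), by dominated convergence in the truncation level.
[cite: CarlenJauslinLieb2020, §2] -/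
theorem kRes_resolvent_eq (hc : 0 < c) (hV : Measurable V) (hVfin : ∀ y, V y ≠ ∞)
    (hGV : ∀ x, (𝐆[c] V) x ≠ ∞) (hφ : Measurable φ) {B : ℝ≥0∞} (hB : B ≠ ∞)
    (hφB : ∀ x, (𝐆[c] φ) x ≤ B) (x : Space) :
    kRes c V φ x + (𝐆[c] fun y => V y * kRes c V φ y) x = (𝐆[c] φ) x := by
  set U : ℕ → Space → ℝ≥0∞ := fun M y => min (V y) (ENNReal.ofReal ((M : ℝ) + 1)) with hU
  set s : ℕ → Space → ℝ≥0∞ := fun M => kSup c ((M : ℝ) + 1) (U M) φ 0 with hs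
  have hs_anti : Antitone s := kSup_trunc_antitone hc hV hφ
  have hs_meas : ∀ M, Measurable (s M) := fun M =>
    measurable_kSup (measurable_trunc hV M) hφ measurable_zero
  have hsB : ∀ M y, s M y ≤ B := fun M y =>
    (kSup_le_G hc (Nat.cast_add_one_pos M) hφ bot_le y).trans (hφB y)
  have hK : ∀ y, kRes c V φ y = ⨅ M, s M y := fun y => rfl
  -- (i) s M x → K x
  have h1 : Tendsto (fun M => s M x) atTop (𝓝 (kRes c V φ x)) := by
    rw [hK]; exact tendsto_atTop_iInf fun M M' h => hs_anti h x
  -- (ii) G(U_M s_M) x → G(V K) x by dominated convergence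
  have h2 : Tendsto (fun M => (𝐆[c] fun y => U M y * s M y) x) atTop
      (𝓝 ((𝐆[c] fun y => V y * kRes c V φ y) x)) := by
    simp only [lconvolution_def]
    refine tendsto_lintegral_of_dominated_convergence
      (fun y => (ENNReal.ofReal ∘ yukawa c) y * (B * V (-y + x))) ?_ ?_ ?_ ?_
    · intro M
      have := hs_meas M
      have := measurable_trunc hV M
      exact (measurable_ofReal_yukawa c).mul ((this.mul (hs_meas M)).comp (by fun_prop))
    · intro M
      refine ae_of_all _ fun y => mul_le_mul' le_rfl ?_
      rw [mul_comm]
      exact mul_le_mul' (hsB M _) (trunc_le_self V M _)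
    · have hm : Measurable fun z => B * V z := hV.const_mul B
      have : (∫⁻ y, (ENNReal.ofReal ∘ yukawa c) y * (B * V (-y + x))) = (𝐆[c] fun z => B * V z) x := by
        rw [lconvolution_def]
      rw [this, G_const_mul c hV B x]
      exact ENNReal.mul_ne_top hB (hGV x)
    · refine ae_of_all _ fun y => ?_
      refine ENNReal.Tendsto.const_mul ?_ (Or.inr ENNReal.ofReal_ne_top)
      have hev := trunc_eventually_eq hVfin (-y + x)
      have hlim : Tendsto (fun M => V (-y + x) * s M (-y + x)) atTop
          (𝓝 (V (-y + x) * kRes c V φ (-y + x))) := by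
        rw [hK]
        exact ENNReal.Tendsto.const_mul (tendsto_atTop_iInf fun M M' h => hs_anti h _)
          (Or.inr (hVfin _))
      refine hlim.congr' ?_
      filter_upwards [hev] with M hM
      rw [show U M (-y + x) = V (-y + x) from hM]
  -- (iii) the sum is constant `= G φ x`
  have h3 : Tendsto (fun M => s M x + (𝐆[c] fun y => U M y * s M y) x) atTop
      (𝓝 (kRes c V φ x + (𝐆[c] fun y => V y * kRes c V φ y) x)) := h1.add h2
  have h4 : (fun M => s M x + (𝐆[c] fun y => U M y * s M y) x) = fun _ => (𝐆[c] φ) x := by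
    funext M
    exact kSup_trunc_resolvent_eq hc hV hφ hB hφB M x
  rw [h4] at h3
  exact tendsto_nhds_unique h3 tendsto_const_nhds

/-- **`K V + c K 1 = 1`** (`(−Δ + c + V)⁻¹ (V + c) = 1`; equivalently CJL's
`K_e𝒱 = 1 − 4e K_e 1 ≤ 1`, the key to Lemma 5). [cite: CarlenJauslinLieb2020, §2] -/
theorem kRes_potential_identity (hc : 0 < c) (hV : Measurable V) (hVfin : ∀ y, V y ≠ ∞)
    (hGV : ∀ x, (𝐆[c] V) x ≠ ∞) (x : Space) :
    kRes c V V x + ENNReal.ofReal c * kRes c V (fun _ => 1) x = 1 := by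
  set U : ℕ → Space → ℝ≥0∞ := fun M y => min (V y) (ENNReal.ofReal ((M : ℝ) + 1)) with hU
  have hUm : ∀ M, Measurable (U M) := fun M => measurable_trunc hV M
  -- K(V + c) = K V + c K 1
  have hsplit : kRes c V (fun y => V y + ENNReal.ofReal c) x =
      kRes c V V x + ENNReal.ofReal c * kRes c V (fun _ => 1) x := by
    rw [← kRes_const_mul hc hV measurable_const ENNReal.ofReal_ne_top x,
      ← kRes_add hc hV hV (measurable_const.const_mul _) x]
    simp only [mul_one]
  rw [← hsplit, kRes_apply]
  -- each truncated solution for the data V + c equals 1 + kSup(V ∸ U_M)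
  have hdec : ∀ M : ℕ, kSup c ((M : ℝ) + 1) (U M) (fun y => V y + ENNReal.ofReal c) 0 x =
      1 + kSup c ((M : ℝ) + 1) (U M) (fun y => V y - U M y) 0 x := by
    intro M
    have hdata : (fun y => V y + ENNReal.ofReal c) =
        fun y => (U M y + ENNReal.ofReal c) + (V y - U M y) := by
      funext y
      rw [add_right_comm, add_tsub_cancel_of_le (trunc_le_self V M y)]
    have hm1 : Measurable fun y => U M y + ENNReal.ofReal c := (hUm M).add measurable_const
    rw [hdata, kSup_add (hUm M) hm1 _ x,
      kSup_potential_add_const hc (Nat.cast_add_one_pos M) (hUm M) (fun _ => min_le_right _ _)]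
  change (⨅ M : ℕ, kSup c ((M : ℝ) + 1) (U M) (fun y => V y + ENNReal.ofReal c) 0 x) = 1
  simp only [hdec]
  rw [← ENNReal.add_iInf]
  -- the remainder tends to 0: it is below G_c(V ∸ U_M), whose infimum vanishes
  suffices h0 : ⨅ M : ℕ, kSup c ((M : ℝ) + 1) (U M) (fun y => V y - U M y) 0 x = 0 by
    rw [h0, add_zero]
  refine le_antisymm ?_ bot_le
  have hle : ∀ M : ℕ, kSup c ((M : ℝ) + 1) (U M) (fun y => V y - U M y) 0 x ≤
      (𝐆[c] fun y => V y - U M y) x := fun M =>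
    kSup_le_G hc (Nat.cast_add_one_pos M) (hV.sub (hUm M)) bot_le x
  refine (iInf_mono hle).trans (le_of_eq ?_)
  -- ⨅_M G_c(V ∸ U_M) x = G_c(⨅_M (V ∸ U_M)) x = 0 (monotone convergence, decreasing)
  simp only [lconvolution_def]
  have hmeas : ∀ M : ℕ, Measurable fun y => (ENNReal.ofReal ∘ yukawa c) y * (V (-y + x) - U M (-y + x)) :=
    fun M => (measurable_ofReal_yukawa c).mul ((hV.sub (hUm M)).comp (by fun_prop))
  have hanti : Antitone fun M : ℕ => fun y => (ENNReal.ofReal ∘ yukawa c) y * (V (-y + x) - U M (-y + x)) := by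
    intro M M' h y
    exact mul_le_mul' le_rfl (tsub_le_tsub_left (trunc_mono V h _) _)
  have hfin : ∫⁻ y, (ENNReal.ofReal ∘ yukawa c) y * (V (-y + x) - U 0 (-y + x)) ≠ ∞ := by
    refine ne_top_of_le_ne_top (hGV x) ?_
    rw [lconvolution_def]
    exact lintegral_mono fun y => mul_le_mul' le_rfl tsub_le_self
  rw [← lintegral_iInf hmeas hanti hfin]
  refine (lintegral_eq_zero_iff (Measurable.iInf hmeas)).2 (ae_of_all _ fun y => ?_)
  simp only [Pi.zero_apply]
  refine le_antisymm ?_ bot_le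
  obtain ⟨M, hM⟩ := (trunc_eventually_eq hVfin (-y + x)).exists
  refine iInf_le_of_le M ?_
  simp [hU, hM]

/-! ## Layer A7: uniqueness for the resolvent equation -/

/-- **Uniqueness of finite solutions of `w + G_c(V w) = G_c φ`** (`G_c φ` bounded): `w = K φ`.
Step 1: `w` is a sub-solution of every truncated map, hence `w ≤ kSup_M` for all `M`, so
`w ≤ K φ`; Step 2: `d = Kφ − w ≥ 0` solves `d + G_c(V d) = 0`. [cite: CarlenJauslinLieb2020, §2] -/
theorem kRes_unique (hc : 0 < c) (hV : Measurable V) (hVfin : ∀ y, V y ≠ ∞)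
    (hGV : ∀ x, (𝐆[c] V) x ≠ ∞) (hφ : Measurable φ) {B : ℝ≥0∞} (hB : B ≠ ∞)
    (hφB : ∀ x, (𝐆[c] φ) x ≤ B) {w : Space → ℝ≥0∞} (hw : Measurable w)
    (heq : ∀ x, w x + (𝐆[c] fun y => V y * w y) x = (𝐆[c] φ) x) : w = kRes c V φ := by
  have hwG : w ≤ 𝐆[c] φ := fun x => (heq x) ▸ le_self_add
  have hwB : ∀ x, w x ≤ B := fun x => (hwG x).trans (hφB x)
  have hVw : Measurable fun y => V y * w y := hV.mul hw
  have hGVw_le : ∀ x, (𝐆[c] fun y => V y * w y) x ≤ B := fun x =>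
    (le_add_self.trans (heq x).le).trans (hφB x)
  -- Step 1: w ≤ kSup for every truncation level
  have step1 : ∀ M : ℕ, w ≤ kSup c ((M : ℝ) + 1) (fun y => min (V y) (ENNReal.ofReal ((M : ℝ) + 1))) φ 0 := by
    intro M
    set m : ℝ := (M : ℝ) + 1 with hm
    have hm0 : 0 < m := Nat.cast_add_one_pos M
    set U : Space → ℝ≥0∞ := fun y => min (V y) (ENNReal.ofReal m) with hU
    have hUm : Measurable U := measurable_trunc hV M
    have hUM : ∀ y, U y ≤ ENNReal.ofReal m := fun _ => min_le_right _ _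
    have hUV : ∀ y, U y ≤ V y := trunc_le_self V M
    -- (b) T w ≥ w
    have hsub : w ≤ kMap c m U φ w := by
      intro x
      have hcm : c < c + m := by linarith
      -- (**) : G_{c+m} φ x + m G_{c+m} w x = w x + G_{c+m}(V w) x
      have R1 := G_resolvent hc hcm hφ x
      have R2 := G_resolvent hc hcm hVw x
      have hGφ_fun : (𝐆[c] φ) = fun z => w z + (𝐆[c] fun y => V y * w y) z := funext fun z => (heq z).symm
      have hX : ENNReal.ofReal (c + m - c) * (𝐆[c + m] (𝐆[c] fun y => V y * w y)) x ≠ ∞ := by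
        refine ENNReal.mul_ne_top ENNReal.ofReal_ne_top (ne_top_of_le_ne_top ?_
          (G_le_of_le (by linarith : 0 < c + m) hGVw_le x))
        exact ENNReal.mul_ne_top ENNReal.ofReal_ne_top hB
      have hstar : (𝐆[c + m] φ) x + ENNReal.ofReal (c + m - c) * (𝐆[c + m] w) x =
          w x + (𝐆[c + m] fun y => V y * w y) x := by
        have e1 : (𝐆[c] φ) x = (𝐆[c + m] φ) x + ENNReal.ofReal (c + m - c) *
            ((𝐆[c + m] w) x + (𝐆[c + m] (𝐆[c] fun y => V y * w y)) x) := by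
          rw [R1]
          congr 2
          rw [hGφ_fun, G_add (c + m) hw]
        have e2 : (𝐆[c] φ) x = w x + (𝐆[c + m] fun y => V y * w y) x +
            ENNReal.ofReal (c + m - c) * (𝐆[c + m] (𝐆[c] fun y => V y * w y)) x := by
          rw [← heq x, R2, add_assoc]
        refine (ENNReal.add_left_inj hX).1 ?_
        calc (𝐆[c + m] φ) x + ENNReal.ofReal (c + m - c) * (𝐆[c + m] w) x +
              ENNReal.ofReal (c + m - c) * (𝐆[c + m] (𝐆[c] fun y => V y * w y)) x
            = (𝐆[c + m] φ) x + ENNReal.ofReal (c + m - c) *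
                ((𝐆[c + m] w) x + (𝐆[c + m] (𝐆[c] fun y => V y * w y)) x) := by rw [mul_add, add_assoc]
          _ = _ := by rw [← e1, e2]
      -- T w x + G_{c+m}(U w) x = w x + G_{c+m}(V w) x ≥ w x + G_{c+m}(U w) x
      have hMUw : Measurable fun y => (ENNReal.ofReal m - U y) * w y := by fun_prop
      have hφMUw : Measurable fun y => φ y + (ENNReal.ofReal m - U y) * w y := by fun_prop
      have hT : kMap c m U φ w x + (𝐆[c + m] fun y => U y * w y) x =
          w x + (𝐆[c + m] fun y => V y * w y) x := by
        rw [kMap_apply, ← hstar, show c + m - c = m by ring]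
        rw [← G_add (c + m) hφMUw, ← G_const_mul (c + m) hw, ← G_add (c + m) hφ]
        congr 1
        funext y
        rw [add_assoc, ← add_mul, tsub_add_cancel_of_le (hUM y)]
      have hfinU : (𝐆[c + m] fun y => U y * w y) x ≠ ∞ := by
        refine ne_top_of_le_ne_top hB (((G_anti (by linarith : c ≤ c + m) _ x).trans ?_))
        exact (G_mono c (fun y => mul_le_mul' (hUV y) le_rfl) x).trans (hGVw_le x)
      have hge : w x + (𝐆[c + m] fun y => U y * w y) x ≤
          kMap c m U φ w x + (𝐆[c + m] fun y => U y * w y) x := by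
        rw [hT]
        exact add_le_add le_rfl (G_mono (c + m) (fun y => mul_le_mul' (hUV y) le_rfl) x)
      exact (ENNReal.add_le_add_iff_right hfinU).1 hge
    -- (c) iterate from w: the limit is a bounded fixed point above kSup-from-0, hence equal to it
    set wstar := kSup c m U φ w with hwstar
    have hwstar_fix : kMap c m U φ wstar = wstar := kMap_kSup hUm hφ hw hsub
    have hwstar_meas : Measurable wstar := measurable_kSup hUm hφ hw
    have hwstar_B : ∀ x, wstar x ≤ B := fun x => (kSup_le_G hc hm0 hφ hwG x).trans (hφB x)
    have hs_fix : kMap c m U φ (kSup c m U φ 0) = kSup c m U φ 0 := kMap_kSup hUm hφ measurable_zero bot_le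
    have hs_meas : Measurable (kSup c m U φ 0) := measurable_kSup hUm hφ measurable_zero
    have hs_le : kSup c m U φ 0 ≤ wstar := kSup_mono_data le_rfl le_rfl bot_le
    have heq' : kSup c m U φ 0 = wstar :=
      fixed_unique_of_le hc hm0 hUm hφ hB hs_meas hwstar_meas hs_fix hwstar_fix hs_le hwstar_B
    rw [heq']
    exact le_kSup_self c m U φ w
  -- Step 2
  have hwK : w ≤ kRes c V φ := fun x => le_iInf fun M => step1 M x
  set d : Space → ℝ≥0∞ := fun x => kRes c V φ x - w x with hd
  have hKm : Measurable (kRes c V φ) := measurable_kRes hV hφ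
  have hdm : Measurable d := hKm.sub hw
  have hKd : ∀ x, kRes c V φ x = w x + d x := fun x => (add_tsub_cancel_of_le (hwK x)).symm
  have hKeq := kRes_resolvent_eq hc hV hVfin hGV hφ hB hφB
  have hd0 : ∀ x, d x + (𝐆[c] fun y => V y * d y) x = 0 := by
    intro x
    have hfin : w x + (𝐆[c] fun y => V y * w y) x ≠ ∞ := by
      rw [heq x]; exact ne_top_of_le_ne_top hB (hφB x)
    have hVd : Measurable fun y => V y * w y := hVw
    have e1 : kRes c V φ x + (𝐆[c] fun y => V y * kRes c V φ y) x =
        (w x + (𝐆[c] fun y => V y * w y) x) + (d x + (𝐆[c] fun y => V y * d y) x) := by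
      have hfun : (fun y => V y * kRes c V φ y) = fun y => V y * w y + V y * d y := by
        funext y; rw [hKd y, mul_add]
      rw [hfun, G_add c hVd, hKd x]
      ring
    have e2 : (w x + (𝐆[c] fun y => V y * w y) x) + (d x + (𝐆[c] fun y => V y * d y) x) =
        (w x + (𝐆[c] fun y => V y * w y) x) + 0 := by
      rw [← e1, hKeq x, add_zero, heq x]
    exact (ENNReal.add_right_inj hfin).1 e2
  funext x
  have : d x = 0 := le_antisymm (le_self_add.trans (hd0 x).le) bot_le
  rw [hKd x, this, add_zero]

/-! ## Layer A8: the resolvent identity in the spectral parameter -/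

/-- **`K_c f = K_{c'} f + (c' − c) K_c (K_{c'} f)`** for `0 < c < c'` (the resolvent identity for
`K = (−Δ + c + V)⁻¹`; gives monotonicity and Lipschitz continuity of `c ↦ K_c f`).
[cite: CarlenJauslinLieb2020, §2] -/
theorem kRes_resolvent_c {c c' : ℝ} (hc : 0 < c) (hcc' : c < c') (hV : Measurable V)
    (hVfin : ∀ y, V y ≠ ∞) (hGV : ∀ x, (𝐆[c] V) x ≠ ∞) (hφ : Measurable φ) {B : ℝ≥0∞}
    (hB : B ≠ ∞) (hφB : ∀ x, (𝐆[c] φ) x ≤ B) (x : Space) :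
    kRes c V φ x = kRes c' V φ x + ENNReal.ofReal (c' - c) * kRes c V (kRes c' V φ) x := by
  have hc' : 0 < c' := hc.trans hcc'
  have hGV' : ∀ x, (𝐆[c'] V) x ≠ ∞ := fun x => ne_top_of_le_ne_top (hGV x) (G_anti hcc'.le V x)
  have hφB' : ∀ x, (𝐆[c'] φ) x ≤ B := fun x => (G_anti hcc'.le φ x).trans (hφB x)
  set A := kRes c' V φ with hA
  have hAm : Measurable A := measurable_kRes hV hφ
  have hAeq := kRes_resolvent_eq hc' hV hVfin hGV' hφ hB hφB'
  have hAG : A ≤ 𝐆[c] φ := fun x => (kRes_le_G hc' hφ x).trans (G_anti hcc'.le φ x)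
  -- bound for the data A at parameter c
  have hBA : ∀ x, (𝐆[c] A) x ≤ ENNReal.ofReal (1 / c) * B := fun x =>
    (G_mono c hAG x).trans (G_le_of_le hc hφB x)
  have hBA_ne : ENNReal.ofReal (1 / c) * B ≠ ∞ := ENNReal.mul_ne_top ENNReal.ofReal_ne_top hB
  set B' := kRes c V A with hB'
  have hB'm : Measurable B' := measurable_kRes hV hAm
  have hB'eq := kRes_resolvent_eq hc hV hVfin hGV hAm hBA_ne hBA
  set k := ENNReal.ofReal (c' - c) with hk
  -- the candidate w := A + k B'
  set w : Space → ℝ≥0∞ := fun x => A x + k * B' x with hw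
  have hwm : Measurable w := by rw [hw]; fun_prop
  have hweq : ∀ x, w x + (𝐆[c] fun y => V y * w y) x = (𝐆[c] φ) x := by
    intro x
    have hVA : Measurable fun y => V y * A y := hV.mul hAm
    have hVB' : Measurable fun y => V y * B' y := hV.mul hB'm
    -- G_c(V w) = G_c(VA) + k G_c(V B')
    have e1 : (𝐆[c] fun y => V y * w y) x = (𝐆[c] fun y => V y * A y) x + k * (𝐆[c] fun y => V y * B' y) x := by
      have hfun : (fun y => V y * w y) = fun y => V y * A y + k * (V y * B' y) := by
        funext y; simp only [hw]; ring
      rw [hfun, G_add c hVA, G_const_mul c hVB']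
    -- G_c φ = G_{c'} φ + k G_c (G_{c'} φ), and G_{c'} φ = A + G_{c'}(VA)
    have e2 : (𝐆[c] φ) x = A x + (𝐆[c'] fun y => V y * A y) x +
        k * ((𝐆[c] A) x + (𝐆[c] (𝐆[c'] fun y => V y * A y)) x) := by
      rw [yukawa_lconv_resolvent hc hcc' hφ x]
      have hfun : (𝐆[c'] φ) = fun z => A z + (𝐆[c'] fun y => V y * A y) z := funext fun z => (hAeq z).symm
      rw [hfun, G_add c hAm]
    have e3 : (𝐆[c] fun y => V y * A y) x = (𝐆[c'] fun y => V y * A y) x +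
        k * (𝐆[c] (𝐆[c'] fun y => V y * A y)) x := yukawa_lconv_resolvent hc hcc' hVA x
    calc w x + (𝐆[c] fun y => V y * w y) x
        = A x + k * B' x + ((𝐆[c] fun y => V y * A y) x + k * (𝐆[c] fun y => V y * B' y) x) := by
          rw [e1]
      _ = A x + (𝐆[c] fun y => V y * A y) x + k * (B' x + (𝐆[c] fun y => V y * B' y) x) := by ring
      _ = A x + (𝐆[c] fun y => V y * A y) x + k * (𝐆[c] A) x := by rw [hB'eq x]
      _ = (𝐆[c] φ) x := by rw [e2, e3]; ring
  have := kRes_unique hc hV hVfin hGV hφ hB hφB hwm hweq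
  have hx := congr_fun this x
  simp only [hw] at hx
  exact hx.symm

end KRes

section LayerB

variable {V : Space → ℝ≥0∞} {e : ℝ}

/-! ### Self-convolution bounds -/

/-- `w ⋆ w ≤ ∫w` pointwise for `w ≤ 1` (`u⋆u ≤ ‖u‖₁‖u‖_∞`, CJL-I proof of Lemma 5).
[cite: CarlenJauslinLieb2020, §2 (proof of Lemma 5)] -/
theorem lconv_self_le {w : Space → ℝ≥0∞} (hw1 : ∀ x, w x ≤ 1) (y : Space) :
    (w ⋆ₗ w) y ≤ ∫⁻ z, w z := by
  rw [lconvolution_def]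
  calc ∫⁻ z, w z * w (-z + y) ≤ ∫⁻ z, w z * 1 := lintegral_mono fun z => mul_le_mul' le_rfl (hw1 _)
    _ = ∫⁻ z, w z := by simp only [mul_one]

/-- `w ⋆ w` is measurable for measurable `w`. [folklore] -/
theorem measurable_lconv_self {w : Space → ℝ≥0∞} (hw : Measurable w) : Measurable (w ⋆ₗ w) :=
  measurable_lconvolution _ hw hw

/-- `∫ w ⋆ w = (∫ w)²` (Tonelli). [cite: CarlenJauslinLieb2020, (1.11)] -/
theorem lintegral_lconv_self {w : Space → ℝ≥0∞} (hw : Measurable w) :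
    ∫⁻ y, (w ⋆ₗ w) y = (∫⁻ z, w z) ^ 2 := by
  rw [lintegral_lconvolution hw hw, sq]

/-! ### The functional `𝐋[V, w] = ∫ V(1 − w)` -/

/-- `∫V(1 − w) ≤ ∫V`. [folklore] -/
theorem L_le (V w : Space → ℝ≥0∞) : 𝐋[V, w] ≤ ∫⁻ z, V z :=
  lintegral_mono fun _ => mul_le_of_le_one_right' tsub_le_self

/-- `w ↦ ∫V(1 − w)` is antitone. [cite: CarlenJauslinLieb2020, §2 (proof of Lemma 4)] -/
theorem L_anti {w w' : Space → ℝ≥0∞} (h : w ≤ w') : 𝐋[V, w'] ≤ 𝐋[V, w] :=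
  lintegral_mono fun z => mul_le_mul' le_rfl (tsub_le_tsub_left (h z) _)

/-- `∫V(1 − 0) = ∫V` (so `ρ₀ = 2e/∫𝒱`, CJL-I proof of Lemma 4).
[cite: CarlenJauslinLieb2020, §2 (proof of Lemma 4)] -/
theorem L_zero (V : Space → ℝ≥0∞) : 𝐋[V, (0 : Space → ℝ≥0∞)] = ∫⁻ z, V z := by
  simp

/-- `V(1 − w)` is measurable. [folklore] -/
theorem measurable_L_integrand (hV : Measurable V) {w : Space → ℝ≥0∞} (hw : Measurable w) :
    Measurable fun z => V z * (1 - w z) := by fun_prop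

/-- `∫ V(1 − w) = ∫ V − ∫ V w` for `w ≤ 1`, `V` finite with finite integral.
[cite: CarlenJauslinLieb2020, §2] -/
theorem L_eq_sub (hV : Measurable V) (hVfin : ∀ y, V y ≠ ∞) (hVint : ∫⁻ y, V y ≠ ∞)
    {w : Space → ℝ≥0∞} (hw : Measurable w) (hw1 : ∀ x, w x ≤ 1) :
    𝐋[V, w] = (∫⁻ z, V z) - ∫⁻ z, V z * w z := by
  have h1 : (fun z => V z * (1 - w z)) = fun z => V z - V z * w z := by
    funext z
    rw [ENNReal.mul_sub (fun _ _ => hVfin z), mul_one]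
  have hm : Measurable fun z => V z * w z := hV.mul hw
  rw [h1, lintegral_sub hm]
  · exact ne_top_of_le_ne_top hVint (lintegral_mono fun z => mul_le_of_le_one_right' (hw1 z))
  · exact ae_of_all _ fun z => mul_le_of_le_one_right' (hw1 z)

/-! ### The data of one step -/

/-- The data `V + 2eρ w⋆w` is measurable. [folklore] -/
theorem measurable_data (e : ℝ) (hV : Measurable V) {w : Space → ℝ≥0∞} (hw : Measurable w)
    (ρ : ℝ≥0∞) : Measurable 𝚽[e, ρ, V, w] := by
  have := measurable_lconv_self hw
  fun_prop

/-- The data `V + 2eρ w⋆w` is monotone in `(ρ, w)` (the induction step `u_{n+1} ≥ u_n` of CJL-I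
Lemma 4). [cite: CarlenJauslinLieb2020, §2 Lemma 4] -/
theorem data_mono (e : ℝ) {w w' : Space → ℝ≥0∞} (hww' : w ≤ w') {ρ ρ' : ℝ≥0∞} (hρ : ρ ≤ ρ') :
    𝚽[e, ρ, V, w] ≤ 𝚽[e, ρ', V, w'] := fun y =>
  add_le_add le_rfl (mul_le_mul' (mul_le_mul' le_rfl hρ) (lconvolution_mono hww' hww' y))

/-- `V ≤ V + 2eρ w⋆w` (so `u_{n} ≥ u₁ = K_e𝒱`, CJL-I (1.17)).
[cite: CarlenJauslinLieb2020, (1.17)] -/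
theorem le_data (e : ℝ) (ρ : ℝ≥0∞) (w : Space → ℝ≥0∞) : V ≤ 𝚽[e, ρ, V, w] := fun _ => le_self_add

/-- `V + 2eρ w⋆w ≤ V + 2eρ‖w‖₁` for `w ≤ 1` (`u⋆u ≤ ‖u‖₁‖u‖_∞`, CJL-I proof of Lemma 5).
[cite: CarlenJauslinLieb2020, §2 (proof of Lemma 5)] -/
theorem data_le (e : ℝ) {w : Space → ℝ≥0∞} (hw1 : ∀ x, w x ≤ 1) (ρ : ℝ≥0∞) (y : Space) :
    𝚽[e, ρ, V, w] y ≤ V y + ENNReal.ofReal (2 * e) * ρ * ∫⁻ z, w z :=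
  add_le_add le_rfl (mul_le_mul' le_rfl (lconv_self_le hw1 y))

/-- `0 < 4e` for `e > 0`. [folklore] -/
theorem four_mul_pos (he : 0 < e) : 0 < 4 * e := by linarith

/-- `G_{4e}` of the data is bounded: `≤ B + 2eρ‖w‖₁/(4e)`. [folklore] -/
theorem G_data_le (he : 0 < e) (hV : Measurable V) {B : ℝ≥0∞} (hVB : ∀ x, (𝐆[4 * e] V) x ≤ B)
    {w : Space → ℝ≥0∞} (hw1 : ∀ x, w x ≤ 1) (ρ : ℝ≥0∞) (x : Space) :
    (𝐆[4 * e] 𝚽[e, ρ, V, w]) x ≤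
      B + ENNReal.ofReal (2 * e) * ρ * (∫⁻ z, w z) / ENNReal.ofReal (4 * e) := by
  calc (𝐆[4 * e] 𝚽[e, ρ, V, w]) x
      ≤ (𝐆[4 * e] fun y => V y + ENNReal.ofReal (2 * e) * ρ * ∫⁻ z, w z) x :=
        G_mono (4 * e) (data_le e hw1 ρ) x
    _ = (𝐆[4 * e] V) x + (𝐆[4 * e] fun _ => ENNReal.ofReal (2 * e) * ρ * ∫⁻ z, w z) x :=
        G_add (4 * e) hV _ x
    _ ≤ B + ENNReal.ofReal (2 * e) * ρ * (∫⁻ z, w z) / ENNReal.ofReal (4 * e) := by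
        refine add_le_add (hVB x) (le_of_eq ?_)
        rw [yukawa_lconv_const (four_mul_pos he), one_div,
          ENNReal.ofReal_inv_of_pos (four_mul_pos he), mul_comm, div_eq_mul_inv]

/-- **Lemma 5 (mechanism): `K(V + κ) ≤ 1` for a constant `κ ≤ 4e`**, from `K V + 4e K 1 = 1`. Hence
the next iterate is `≤ 1` as soon as `2eρ‖w‖₁ ≤ 4e` (CJL use `ρ_n‖u_n‖₁ ≤ 1`).
[cite: CarlenJauslinLieb2020, §2] -/
theorem next_le_one (he : 0 < e) (hV : Measurable V) (hVfin : ∀ y, V y ≠ ∞)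
    (hGV : ∀ x, (𝐆[4 * e] V) x ≠ ∞) {w : Space → ℝ≥0∞} (hw1 : ∀ x, w x ≤ 1)
    {ρ : ℝ≥0∞} (hκ : ENNReal.ofReal (2 * e) * ρ * ∫⁻ z, w z ≤ ENNReal.ofReal (4 * e)) (x : Space) :
    kRes (4 * e) V 𝚽[e, ρ, V, w] x ≤ 1 := by
  have hc := four_mul_pos he
  set κ := ENNReal.ofReal (2 * e) * ρ * ∫⁻ z, w z with hκdef
  have hκfin : κ ≠ ∞ := ne_top_of_le_ne_top ENNReal.ofReal_ne_top hκ
  calc kRes (4 * e) V 𝚽[e, ρ, V, w] x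
      ≤ kRes (4 * e) V (fun y => V y + κ * 1) x := by
        refine kRes_mono (fun y => (data_le e hw1 ρ y).trans (le_of_eq ?_)) x
        rw [mul_one]
    _ = kRes (4 * e) V V x + κ * kRes (4 * e) V (fun _ => 1) x := by
        rw [kRes_add hc hV hV (measurable_const.const_mul _) x, kRes_const_mul hc hV measurable_const hκfin]
    _ ≤ kRes (4 * e) V V x + ENNReal.ofReal (4 * e) * kRes (4 * e) V (fun _ => 1) x :=
        add_le_add le_rfl (mul_le_mul' hκ le_rfl)
    _ = 1 := kRes_potential_identity hc hV hVfin hGV x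

/-- **`∫ K V > 0`**: otherwise `G V = K V + G(V·KV) = 0` a.e., contradicting `∫ G V = ∫V/c > 0`.
[cite: CarlenJauslinLieb2020, §2] -/
theorem lintegral_kRes_potential_ne_zero {c : ℝ} (hc : 0 < c) (hV : Measurable V)
    (hVfin : ∀ y, V y ≠ ∞) {B : ℝ≥0∞} (hB : B ≠ ∞) (hVB : ∀ x, (𝐆[c] V) x ≤ B)
    (hVpos : ∫⁻ y, V y ≠ 0) : ∫⁻ x, kRes c V V x ≠ 0 := by
  have hGV : ∀ x, (𝐆[c] V) x ≠ ∞ := fun x => ne_top_of_le_ne_top hB (hVB x)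
  intro h0
  have hKm : Measurable (kRes c V V) := measurable_kRes hV hV
  have hae : kRes c V V =ᵐ[volume] 0 := (lintegral_eq_zero_iff hKm).1 h0
  have hres := kRes_resolvent_eq hc hV hVfin hGV hV hB hVB
  -- ∫ G V = ∫ K V + ∫ G (V K V) = 0
  have h1 : ∫⁻ x, (𝐆[c] V) x = 0 := by
    have hfun : (fun x => (𝐆[c] V) x) = fun x => kRes c V V x + (𝐆[c] fun y => V y * kRes c V V y) x :=
      funext fun x => (hres x).symm
    have hVK : Measurable fun y => V y * kRes c V V y := hV.mul hKm
    rw [hfun, lintegral_add_left hKm, h0, zero_add, lintegral_G hc hVK]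
    have h2 : ∫⁻ y, V y * kRes c V V y = 0 := by
      refine (lintegral_eq_zero_iff hVK).2 ?_
      filter_upwards [hae] with y hy
      simp [hy]
    rw [h2, mul_zero]
  rw [lintegral_G hc hV] at h1
  rcases mul_eq_zero.1 h1 with h | h
  · exact absurd h (by rw [one_div, ENNReal.ofReal_inv_of_pos hc]; exact ENNReal.inv_ne_zero.2 ENNReal.ofReal_ne_top)
  · exact hVpos h

/-- The elementary real-variable inequality behind CJL-I §2 `(simple17)`: from
`(4e a + J) L = 𝓥 L + 4e² I²` (the integrated equation with `ρ = 2e/L`), `2e I < L`,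
`0 ≤ I ≤ a`, `0 < a` conclude `2e a < 𝓥 − J`. [cite: CarlenJauslinLieb2020, §2] -/
theorem simple17_real {e a J T I L : ℝ} (he : 0 < e) (hL : 0 < L) (hI0 : 0 ≤ I) (hIa : I ≤ a)
    (ha : 0 < a) (hIL : 2 * e * I < L) (hid : (4 * e * a + J) * L = T * L + 4 * e ^ 2 * I ^ 2) :
    2 * e * a < T - J := by
  have key : 4 * e ^ 2 * I ^ 2 < 2 * e * a * L := by
    rcases eq_or_lt_of_le hI0 with hI | hI
    · subst hI
      have : 0 < 2 * e * a * L := by positivity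
      nlinarith
    · have h1 : (2 * e * I) * (2 * e * I) < (2 * e * I) * L := mul_lt_mul_of_pos_left hIL (by positivity)
      have h2 : (2 * e * I) * L ≤ (2 * e * a) * L :=
        mul_le_mul_of_nonneg_right (by nlinarith) hL.le
      nlinarith
  have h3 : (2 * e * a) * L < (T - J) * L := by nlinarith
  exact lt_of_mul_lt_mul_right h3 hL.le

/-- **One step of the iteration (CJL-I Lemmas 4–5).** For `w` measurable, `w ≤ 1`, with
`2e∫w < ∫V(1 − w)` (`(simple17)`), the next iterate `w' = K(V + 2eρ w⋆w)`, `ρ = 2e/∫V(1−w)`, is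
measurable, `≤ 1`, and — if `w ≤ w'` — again satisfies `2e∫w' < ∫V(1 − w')`.
[cite: CarlenJauslinLieb2020, §2] -/
theorem next_props (he : 0 < e) (hV : Measurable V) (hVfin : ∀ y, V y ≠ ∞) (hVint : ∫⁻ y, V y ≠ ∞)
    (hVpos : ∫⁻ y, V y ≠ 0) {B : ℝ≥0∞} (hB : B ≠ ∞) (hVB : ∀ x, (𝐆[4 * e] V) x ≤ B)
    {w : Space → ℝ≥0∞} (hw : Measurable w) (hw1 : ∀ x, w x ≤ 1)
    (hP5 : ENNReal.ofReal (2 * e) * ∫⁻ x, w x < 𝐋[V, w]) :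
    Measurable 𝐍[e, V, w] ∧ (∀ x, 𝐍[e, V, w] x ≤ 1) ∧
      (w ≤ 𝐍[e, V, w] → ENNReal.ofReal (2 * e) * ∫⁻ x, 𝐍[e, V, w] x < 𝐋[V, 𝐍[e, V, w]]) := by
  have hc := four_mul_pos he
  have hGV : ∀ x, (𝐆[4 * e] V) x ≠ ∞ := fun x => ne_top_of_le_ne_top hB (hVB x)
  set L := 𝐋[V, w] with hLdef
  have hL0 : L ≠ 0 := (lt_of_le_of_lt bot_le hP5).ne'
  have hLfin : L ≠ ∞ := ne_top_of_le_ne_top hVint (L_le V w)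
  set I := ∫⁻ x, w x with hIdef
  have h2eI : ENNReal.ofReal (2 * e) * I < L := hP5
  have h2e0 : ENNReal.ofReal (2 * e) ≠ 0 := by simpa using he
  have hIfin : I ≠ ∞ := by
    intro hI
    rw [hI, ENNReal.mul_top h2e0] at h2eI
    exact absurd h2eI (not_lt.2 le_top)
  set ρ := ENNReal.ofReal (2 * e) / L with hρdef
  have hρfin : ρ ≠ ∞ := ENNReal.div_ne_top ENNReal.ofReal_ne_top hL0
  set κ := ENNReal.ofReal (2 * e) * ρ * I with hκdef
  have hκ2e : κ ≤ ENNReal.ofReal (2 * e) := by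
    calc κ = ρ * (ENNReal.ofReal (2 * e) * I) := by rw [hκdef]; ring
      _ ≤ ρ * L := mul_le_mul' le_rfl h2eI.le
      _ = ENNReal.ofReal (2 * e) := ENNReal.div_mul_cancel hL0 hLfin
  have hκ4e : κ ≤ ENNReal.ofReal (4 * e) := hκ2e.trans (ENNReal.ofReal_le_ofReal (by linarith))
  have hκfin : κ ≠ ∞ := ne_top_of_le_ne_top ENNReal.ofReal_ne_top hκ2e
  -- the next iterate
  set w' := 𝐍[e, V, w] with hw'_eq
  have hφm : Measurable 𝚽[e, ρ, V, w] := measurable_data e hV hw ρ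
  have hw'm : Measurable w' := measurable_kRes hV hφm
  have hw'1 : ∀ x, w' x ≤ 1 := fun x => next_le_one he hV hVfin hGV hw1 hκ4e x
  refine ⟨hw'm, hw'1, fun hww' => ?_⟩
  -- bound on G of the data
  have h4e0 : ENNReal.ofReal (4 * e) ≠ 0 := by simpa using hc
  set Bφ := B + κ / ENNReal.ofReal (4 * e) with hBφdef
  have hBφ : ∀ x, (𝐆[4 * e] 𝚽[e, ρ, V, w]) x ≤ Bφ := fun x => G_data_le he hV hVB hw1 ρ x
  have hBφfin : Bφ ≠ ∞ := ENNReal.add_ne_top.2 ⟨hB, ENNReal.div_ne_top hκfin h4e0⟩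
  -- the resolvent equation, integrated
  have hres : ∀ x, w' x + (𝐆[4 * e] fun y => V y * w' y) x = (𝐆[4 * e] 𝚽[e, ρ, V, w]) x :=
    kRes_resolvent_eq hc hV hVfin hGV hφm hBφfin hBφ
  set a := ∫⁻ x, w' x with hadef
  set J := ∫⁻ x, V x * w' x with hJdef
  set T := ∫⁻ x, V x with hTdef
  have hJle : J ≤ T := lintegral_mono fun z => mul_le_of_le_one_right' (hw'1 z)
  have hJfin : J ≠ ∞ := ne_top_of_le_ne_top hVint hJle
  have hint : a + ENNReal.ofReal (1 / (4 * e)) * J =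
      ENNReal.ofReal (1 / (4 * e)) * (T + ENNReal.ofReal (2 * e) * ρ * I ^ 2) := by
    have h1 : ∫⁻ x, (w' x + (𝐆[4 * e] fun y => V y * w' y) x) = ∫⁻ x, (𝐆[4 * e] 𝚽[e, ρ, V, w]) x :=
      lintegral_congr fun x => hres x
    have hVw' : Measurable fun y => V y * w' y := hV.mul hw'm
    rw [lintegral_add_left hw'm, lintegral_G hc hVw', lintegral_G hc hφm] at h1
    rw [h1]
    congr 1
    rw [lintegral_add_left hV, lintegral_const_mul _ (measurable_lconv_self hw), lintegral_lconv_self hw]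
  have hXfin : ENNReal.ofReal (2 * e) * ρ * I ^ 2 ≠ ∞ :=
    ENNReal.mul_ne_top (ENNReal.mul_ne_top ENNReal.ofReal_ne_top hρfin) (ENNReal.pow_ne_top hIfin)
  have hafin : a ≠ ∞ := by
    refine ne_top_of_le_ne_top ?_ (le_self_add.trans hint.le)
    exact ENNReal.mul_ne_top ENNReal.ofReal_ne_top (ENNReal.add_ne_top.2 ⟨hVint, hXfin⟩)
  -- positivity of a: w' ≥ K V and ∫ K V > 0
  have ha0 : a ≠ 0 := by
    have hKV := lintegral_kRes_potential_ne_zero hc hV hVfin hB hVB hVpos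
    refine fun h0 => hKV (le_antisymm ?_ bot_le)
    rw [← h0]
    exact lintegral_mono fun x => kRes_mono (le_data e ρ w) x
  -- pass to real numbers
  have hL'eq : 𝐋[V, w'] = T - J := L_eq_sub hV hVfin hVint hw'm hw'1
  have hL'fin : 𝐋[V, w'] ≠ ∞ := ne_top_of_le_ne_top hVint (L_le V w')
  have hIa : I ≤ a := lintegral_mono fun x => hww' x
  set ar := a.toReal
  set Jr := J.toReal
  set Tr := T.toReal
  set Ir := I.toReal
  set Lr := L.toReal
  have hLr : 0 < Lr := ENNReal.toReal_pos hL0 hLfin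
  have har : 0 < ar := ENNReal.toReal_pos ha0 hafin
  have hIar : Ir ≤ ar := (ENNReal.toReal_le_toReal hIfin hafin).2 hIa
  have hIr0 : 0 ≤ Ir := ENNReal.toReal_nonneg
  have hILr : 2 * e * Ir < Lr := by
    have := (ENNReal.toReal_lt_toReal (ENNReal.mul_ne_top ENNReal.ofReal_ne_top hIfin) hLfin).2 h2eI
    rwa [ENNReal.toReal_mul, ENNReal.toReal_ofReal (by positivity)] at this
  have hρr : ρ.toReal = 2 * e / Lr := by
    rw [hρdef, ENNReal.toReal_div, ENNReal.toReal_ofReal (by positivity)]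
  have hint_r : ar + 1 / (4 * e) * Jr = 1 / (4 * e) * (Tr + 2 * e * (2 * e / Lr) * Ir ^ 2) := by
    have h := congrArg ENNReal.toReal hint
    rw [ENNReal.toReal_add hafin (ENNReal.mul_ne_top ENNReal.ofReal_ne_top hJfin), ENNReal.toReal_mul,
      ENNReal.toReal_ofReal (by positivity), ENNReal.toReal_mul, ENNReal.toReal_ofReal (by positivity),
      ENNReal.toReal_add hVint hXfin, ENNReal.toReal_mul, ENNReal.toReal_mul,
      ENNReal.toReal_ofReal (by positivity), ENNReal.toReal_pow, hρr] at h
    exact h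
  have hid : (4 * e * ar + Jr) * Lr = Tr * Lr + 4 * e ^ 2 * Ir ^ 2 := by
    have he0 : e ≠ 0 := he.ne'
    have hL0r : Lr ≠ 0 := hLr.ne'
    have h1 : 4 * e * (ar + 1 / (4 * e) * Jr) = 4 * e * ar + Jr := by field_simp
    have h2 : 4 * e * (1 / (4 * e) * (Tr + 2 * e * (2 * e / Lr) * Ir ^ 2)) * Lr =
        Tr * Lr + 4 * e ^ 2 * Ir ^ 2 := by
      field_simp
      ring
    rw [← h1, hint_r, h2]
  have hreal : 2 * e * ar < Tr - Jr := simple17_real he hLr hIr0 hIar har hILr hid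
  -- back to `ℝ≥0∞`
  rw [hL'eq]
  refine (ENNReal.toReal_lt_toReal (ENNReal.mul_ne_top ENNReal.ofReal_ne_top hafin)
    (ENNReal.sub_ne_top hVint)).1 ?_
  rw [ENNReal.toReal_mul, ENNReal.toReal_ofReal (by positivity), ENNReal.toReal_sub_of_le hJle hVint]
  exact hreal

/-- **The iteration (CJL-I Lemma 4 and Lemma 5)**: every iterate is measurable, `≤ 1`, satisfies
`2e∫u_n < ∫V(1 − u_n)` (`(simple17)`, so `ρ_n = 2e/∫V(1−u_n)` is finite and positive), and the
sequence increases. [cite: CarlenJauslinLieb2020, §2] -/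
theorem iter_props (he : 0 < e) (hV : Measurable V) (hVfin : ∀ y, V y ≠ ∞) (hVint : ∫⁻ y, V y ≠ ∞)
    (hVpos : ∫⁻ y, V y ≠ 0) {B : ℝ≥0∞} (hB : B ≠ ∞) (hVB : ∀ x, (𝐆[4 * e] V) x ≤ B)
    {u : ℕ → Space → ℝ≥0∞} (h0 : u 0 = 0) (hs : ∀ n, u (n + 1) = 𝐍[e, V, u n]) (n : ℕ) :
    Measurable (u n) ∧ (∀ x, u n x ≤ 1) ∧
      ENNReal.ofReal (2 * e) * ∫⁻ x, u n x < 𝐋[V, u n] ∧ u n ≤ u (n + 1) := by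
  induction n with
  | zero =>
    rw [h0]
    refine ⟨measurable_zero, fun _ => by simp, ?_, fun _ => bot_le⟩
    simp only [Pi.zero_apply, lintegral_zero, mul_zero, tsub_zero, mul_one]
    exact pos_iff_ne_zero.2 hVpos
  | succ n ih =>
    obtain ⟨hm, h1, hP5, hmono⟩ := ih
    obtain ⟨hm', h1', hP5'⟩ := next_props he hV hVfin hVint hVpos hB hVB hm h1 hP5
    rw [← hs n] at hm' h1' hP5'
    refine ⟨hm', h1', hP5' hmono, ?_⟩
    -- monotonicity of the next step: data comparison
    rw [hs (n + 1)]
    conv_lhs => rw [hs n]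
    exact kRes_mono (data_mono e hmono (ENNReal.div_le_div_left (L_anti hmono) _))

end LayerB

section LayerC

variable {V : Space → ℝ≥0∞} {e : ℝ} {u : ℕ → Space → ℝ≥0∞}

/-! ### Two order-theoretic helpers -/

/-- `⨆ₙ f(n+1) = ⨆ₙ f n` for a monotone sequence. [folklore] -/
theorem iSup_succ_of_monotone {α : Type*} [CompleteLattice α] {f : ℕ → α} (hf : Monotone f) :
    ⨆ n, f (n + 1) = ⨆ n, f n :=
  le_antisymm (iSup_le fun n => le_iSup f (n + 1))
    (iSup_le fun n => (hf n.le_succ).trans (le_iSup (fun n => f (n + 1)) n))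

/-! ### Corollaries of the iteration lemma -/

/-- `∫V(1 − w) < ∞` when `∫V < ∞`. [folklore] -/
theorem L_ne_top (hVint : ∫⁻ y, V y ≠ ∞) (w : Space → ℝ≥0∞) : 𝐋[V, w] ≠ ∞ :=
  ne_top_of_le_ne_top hVint (L_le V w)

/-- Each iterate lies below the limit `u = ⨆ u_n`. [cite: CarlenJauslinLieb2020, §2 Lemma 6] -/
theorem le_usol (u : ℕ → Space → ℝ≥0∞) (n : ℕ) : u n ≤ fun x => ⨆ n, u n x :=
  fun x => le_iSup (fun n => u n x) n

/-- `2e ≠ 0` in `ℝ≥0∞` for `e > 0`. [folklore] -/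
theorem ofReal_two_mul_ne_zero (he : 0 < e) : ENNReal.ofReal (2 * e) ≠ 0 := by simpa using he

section Iter

variable (he : 0 < e) (hV : Measurable V) (hVfin : ∀ y, V y ≠ ∞) (hVint : ∫⁻ y, V y ≠ ∞)
  (hVpos : ∫⁻ y, V y ≠ 0) {B : ℝ≥0∞} (hB : B ≠ ∞) (hVB : ∀ x, (𝐆[4 * e] V) x ≤ B)
  (h0 : u 0 = 0) (hs : ∀ n, u (n + 1) = 𝐍[e, V, u n])
include he hV hVfin hVint hVpos hB hVB h0 hs

/-- Every iterate `u_n` is measurable. [cite: CarlenJauslinLieb2020, §2 Lemma 5] -/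
theorem iter_measurable (n : ℕ) : Measurable (u n) :=
  (iter_props he hV hVfin hVint hVpos hB hVB h0 hs n).1

/-- **`u_n ≤ 1`** (CJL-I Lemma 5). [cite: CarlenJauslinLieb2020, §2 Lemma 5] -/
theorem iter_le_one (n : ℕ) (x : Space) : u n x ≤ 1 :=
  (iter_props he hV hVfin hVint hVpos hB hVB h0 hs n).2.1 x

/-- **`2e∫u_n < ∫𝒱(1 − u_n)`**, i.e. `∫u_n < 1/ρ_n` (CJL-I §2 `(simple17)`).
[cite: CarlenJauslinLieb2020, §2 Lemma 4 `(simple17)`] -/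
theorem iter_P5 (n : ℕ) : ENNReal.ofReal (2 * e) * ∫⁻ x, u n x < 𝐋[V, u n] :=
  (iter_props he hV hVfin hVint hVpos hB hVB h0 hs n).2.2.1

/-- **The iterates increase** (CJL-I Lemma 4). [cite: CarlenJauslinLieb2020, §2 Lemma 4] -/
theorem iter_monotone : Monotone u :=
  monotone_nat_of_le_succ fun n => (iter_props he hV hVfin hVint hVpos hB hVB h0 hs n).2.2.2

/-- `∫𝒱(1 − u_n) > 0`, so `ρ_n` is well defined (CJL-I Lemma 4: "both sequences are well defined").
[cite: CarlenJauslinLieb2020, §2 Lemma 4] -/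
theorem iter_L_ne_zero (n : ℕ) : 𝐋[V, u n] ≠ 0 :=
  (lt_of_le_of_lt bot_le (iter_P5 he hV hVfin hVint hVpos hB hVB h0 hs n)).ne'

/-- `∫𝒱(1 − u_n)` decreases with `n` (CJL-I §2, proof of Lemma 4). [cite: CarlenJauslinLieb2020, §2 Lemma 4] -/
theorem iter_L_antitone : Antitone fun n => 𝐋[V, u n] :=
  fun _ _ h => L_anti (iter_monotone he hV hVfin hVint hVpos hB hVB h0 hs h)

/-- **`ρ_n` increases** (CJL-I Lemma 4). [cite: CarlenJauslinLieb2020, §2 Lemma 4] -/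
theorem iter_rho_monotone : Monotone fun n => ENNReal.ofReal (2 * e) / 𝐋[V, u n] :=
  fun _ _ h => ENNReal.div_le_div_left (iter_L_antitone he hV hVfin hVint hVpos hB hVB h0 hs h) _

/-- `ρ_n < ∞`. [cite: CarlenJauslinLieb2020, §2 Lemma 4] -/
theorem iter_rho_ne_top (n : ℕ) : ENNReal.ofReal (2 * e) / 𝐋[V, u n] ≠ ∞ :=
  ENNReal.div_ne_top ENNReal.ofReal_ne_top (iter_L_ne_zero he hV hVfin hVint hVpos hB hVB h0 hs n)

/-- `∫u_n ≤ ∫𝒱/(2e)` (from `(simple17)`; CJL-I proof of Lemma 6: "`∫u ≤ (1/2e)∫𝒱`").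
[cite: CarlenJauslinLieb2020, §2 (proof of Lemma 6)] -/
theorem iter_lintegral_le (n : ℕ) : ∫⁻ x, u n x ≤ (∫⁻ y, V y) / ENNReal.ofReal (2 * e) := by
  have h := (iter_P5 he hV hVfin hVint hVpos hB hVB h0 hs n).le.trans (L_le V _)
  rw [mul_comm] at h
  have h2e0 := ofReal_two_mul_ne_zero he
  exact (ENNReal.le_div_iff_mul_le (Or.inl h2e0) (Or.inl ENNReal.ofReal_ne_top)).2 h

/-- `∫u_n < ∞`: the iterates are integrable (CJL-I Lemma 4).
[cite: CarlenJauslinLieb2020, §2 Lemma 4] -/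
theorem iter_lintegral_ne_top (n : ℕ) : ∫⁻ x, u n x ≠ ∞ :=
  ne_top_of_le_ne_top (ENNReal.div_ne_top hVint (ofReal_two_mul_ne_zero he))
    (iter_lintegral_le he hV hVfin hVint hVpos hB hVB h0 hs n)

omit hVint h0 in
/-- `∫ u₁ > 0` (and hence `∫ u_n > 0` for `n ≥ 1`): `u₁ ≥ K V`. [cite: CarlenJauslinLieb2020, §2] -/
theorem iter_lintegral_one_ne_zero : ∫⁻ x, u 1 x ≠ 0 := by
  have hKV := lintegral_kRes_potential_ne_zero (four_mul_pos he) hV hVfin hB hVB hVpos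
  refine fun h => hKV (le_antisymm ?_ bot_le)
  rw [← h, hs 0]
  exact lintegral_mono fun x => kRes_mono (le_data e _ _) x

/-! ### The limit `usol = ⨆ u_n` -/

/-- The limit `u = ⨆ u_n` is measurable. [cite: CarlenJauslinLieb2020, §2 Lemma 6] -/
theorem usol_measurable : Measurable fun x => ⨆ n, u n x :=
  Measurable.iSup (iter_measurable he hV hVfin hVint hVpos hB hVB h0 hs)

/-- **`u ≤ 1`** for the limit `u = ⨆ u_n` (CJL-I Lemma 6: `u` satisfies (1.5)).
[cite: CarlenJauslinLieb2020, §2 Lemma 6] -/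
theorem usol_le_one (x : Space) : (⨆ n, u n x) ≤ 1 :=
  iSup_le fun n => iter_le_one he hV hVfin hVint hVpos hB hVB h0 hs n x

/-- `∫u = ⨆ ∫u_n` (monotone convergence; CJL-I proof of Lemma 6: `‖u_n − u‖₁ → 0`).
[cite: CarlenJauslinLieb2020, §2 (proof of Lemma 6)] -/
theorem lintegral_usol : ∫⁻ x, ⨆ n, u n x = ⨆ n, ∫⁻ x, u n x :=
  lintegral_iSup (iter_measurable he hV hVfin hVint hVpos hB hVB h0 hs)
    (iter_monotone he hV hVfin hVint hVpos hB hVB h0 hs)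

/-- **`u` is integrable** (CJL-I Lemma 6). [cite: CarlenJauslinLieb2020, §2 Lemma 6] -/
theorem lintegral_usol_ne_top : ∫⁻ x, ⨆ n, u n x ≠ ∞ := by
  rw [lintegral_usol he hV hVfin hVint hVpos hB hVB h0 hs]
  refine ne_top_of_le_ne_top (ENNReal.div_ne_top hVint (ofReal_two_mul_ne_zero he)) (iSup_le ?_)
  exact iter_lintegral_le he hV hVfin hVint hVpos hB hVB h0 hs

omit hVint h0 in
/-- `∫u > 0`. [cite: CarlenJauslinLieb2020, §2 Lemma 6] -/
theorem lintegral_usol_ne_zero : ∫⁻ x, ⨆ n, u n x ≠ 0 := by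
  have h1 := iter_lintegral_one_ne_zero he hV hVfin hVpos hB hVB hs
  refine fun h => h1 (le_antisymm ?_ bot_le)
  rw [← h]
  exact lintegral_mono fun x => le_usol u 1 x

/-- `∫V(1 − usol) = ⨅ₙ ∫V(1 − u_n)` (monotone convergence, decreasing).
[cite: CarlenJauslinLieb2020, §2] -/
theorem L_usol : 𝐋[V, fun x => ⨆ n, u n x] = ⨅ n, 𝐋[V, u n] := by
  have hmeas : ∀ n, Measurable fun z => V z * (1 - u n z) := fun n =>
    measurable_L_integrand hV (iter_measurable he hV hVfin hVint hVpos hB hVB h0 hs n)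
  have hanti : Antitone fun n => fun z => V z * (1 - u n z) := fun n m h z =>
    mul_le_mul' le_rfl (tsub_le_tsub_left (iter_monotone he hV hVfin hVint hVpos hB hVB h0 hs h z) _)
  have hfin : ∫⁻ z, V z * (1 - u 0 z) ≠ ∞ := L_ne_top hVint (u 0)
  rw [← lintegral_iInf hmeas hanti hfin]
  refine lintegral_congr fun z => ?_
  simp only []
  rw [ENNReal.sub_iSup ENNReal.one_ne_top]
  exact ENNReal.mul_iInf' (fun h => absurd h (hVfin z)) (fun _ => inferInstance)

/-- `2e ∫usol ≤ ∫V(1 − usol)` (the limit of `(simple17)`); in particular `∫V(1 − usol) > 0`.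
[cite: CarlenJauslinLieb2020, §2] -/
theorem usol_P5 : ENNReal.ofReal (2 * e) * ∫⁻ x, ⨆ n, u n x ≤ 𝐋[V, fun x => ⨆ n, u n x] := by
  rw [lintegral_usol he hV hVfin hVint hVpos hB hVB h0 hs, L_usol he hV hVfin hVint hVpos hB hVB h0 hs,
    ENNReal.mul_iSup]
  refine iSup_le fun n => le_iInf fun m => ?_
  have hmono := iter_monotone he hV hVfin hVint hVpos hB hVB h0 hs
  calc ENNReal.ofReal (2 * e) * ∫⁻ x, u n x
      ≤ ENNReal.ofReal (2 * e) * ∫⁻ x, u (max n m) x :=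
        mul_le_mul' le_rfl (lintegral_mono fun x => hmono (le_max_left n m) x)
    _ ≤ 𝐋[V, u (max n m)] := (iter_P5 he hV hVfin hVint hVpos hB hVB h0 hs _).le
    _ ≤ 𝐋[V, u m] := iter_L_antitone he hV hVfin hVint hVpos hB hVB h0 hs (le_max_right n m)

/-- `∫𝒱(1 − u) > 0`, so `ρ(e) = 2e/∫𝒱(1 − u)` is finite.
[cite: CarlenJauslinLieb2020, §2 Lemma 6] -/
theorem L_usol_ne_zero : 𝐋[V, fun x => ⨆ n, u n x] ≠ 0 := by
  intro h
  have h1 := usol_P5 he hV hVfin hVint hVpos hB hVB h0 hs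
  rw [h, nonpos_iff_eq_zero, mul_eq_zero] at h1
  rcases h1 with h1 | h1
  · exact ofReal_two_mul_ne_zero he h1
  · exact lintegral_usol_ne_zero he hV hVfin hVpos hB hVB hs h1

/-- `ρ := ⨆ ρ_n = 2e / ∫V(1 − usol)`. [cite: CarlenJauslinLieb2020, §2] -/
theorem rho_usol : (⨆ n, ENNReal.ofReal (2 * e) / 𝐋[V, u n]) =
    ENNReal.ofReal (2 * e) / 𝐋[V, fun x => ⨆ n, u n x] := by
  rw [L_usol he hV hVfin hVint hVpos hB hVB h0 hs, ENNReal.div_eq_inv_mul, ENNReal.inv_iInf,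
    ENNReal.iSup_mul]
  simp only [ENNReal.div_eq_inv_mul]

/-- `ρ(e) < ∞`. [cite: CarlenJauslinLieb2020, §2 Lemma 6] -/
theorem rho_usol_ne_top : ENNReal.ofReal (2 * e) / 𝐋[V, fun x => ⨆ n, u n x] ≠ ∞ :=
  ENNReal.div_ne_top ENNReal.ofReal_ne_top (L_usol_ne_zero he hV hVfin hVint hVpos hB hVB h0 hs)

omit hV hVfin hVpos hB hVB h0 hs in
/-- `ρ(e) > 0`. [cite: CarlenJauslinLieb2020, §2 Lemma 6] -/
theorem rho_usol_ne_zero : ENNReal.ofReal (2 * e) / 𝐋[V, fun x => ⨆ n, u n x] ≠ 0 :=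
  ENNReal.div_ne_zero.2 ⟨ofReal_two_mul_ne_zero he, L_ne_top hVint _⟩

/-- The self-convolutions converge: `usol ⋆ usol = ⨆ₙ u_n ⋆ u_n` pointwise. [folklore] -/
theorem lconv_usol (y : Space) :
    ((fun x => ⨆ n, u n x) ⋆ₗ fun x => ⨆ n, u n x) y = ⨆ n, (u n ⋆ₗ u n) y := by
  have hmono := iter_monotone he hV hVfin hVint hVpos hB hVB h0 hs
  have hmeas := iter_measurable he hV hVfin hVint hVpos hB hVB h0 hs
  simp only [lconvolution_def]
  have h1 : (fun z => (⨆ n, u n z) * ⨆ n, u n (-z + y)) = fun z => ⨆ n, u n z * u n (-z + y) := by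
    funext z
    exact iSup_mul_iSup_of_monotone (fun n m h => hmono h z) (fun n m h => hmono h _)
  have hF : ∀ n, Measurable fun z => u n z * u n (-z + y) := fun n =>
    (hmeas n).mul ((hmeas n).comp (by fun_prop))
  rw [h1, lintegral_iSup hF]
  intro n m h z
  exact mul_le_mul' (hmono h z) (hmono h _)

/-- **The limit equation (CJL-I Lemma 6)** in resolvent form:
`usol + G(V usol) = G V + 2eρ G(usol ⋆ usol)`. [cite: CarlenJauslinLieb2020, §2] -/
theorem usol_resolvent_eq (x : Space) :
    (⨆ n, u n x) + (𝐆[4 * e] fun y => V y * ⨆ n, u n y) x =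
      (𝐆[4 * e] V) x + ENNReal.ofReal (2 * e) * (ENNReal.ofReal (2 * e) / 𝐋[V, fun x => ⨆ n, u n x]) *
        (𝐆[4 * e] ((fun x => ⨆ n, u n x) ⋆ₗ fun x => ⨆ n, u n x)) x := by
  have hc := four_mul_pos he
  have hGV : ∀ x, (𝐆[4 * e] V) x ≠ ∞ := fun x => ne_top_of_le_ne_top hB (hVB x)
  have hmono := iter_monotone he hV hVfin hVint hVpos hB hVB h0 hs
  have hmeas := iter_measurable he hV hVfin hVint hVpos hB hVB h0 hs
  have hle1 := iter_le_one he hV hVfin hVint hVpos hB hVB h0 hs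
  set ρ : ℕ → ℝ≥0∞ := fun n => ENNReal.ofReal (2 * e) / 𝐋[V, u n] with hρdef
  have hρmono : Monotone ρ := iter_rho_monotone he hV hVfin hVint hVpos hB hVB h0 hs
  have hρfin : ∀ n, ρ n ≠ ∞ := iter_rho_ne_top he hV hVfin hVint hVpos hB hVB h0 hs
  -- the equation at level n + 1
  have hstep : ∀ n, u (n + 1) x + (𝐆[4 * e] fun y => V y * u (n + 1) y) x =
      (𝐆[4 * e] V) x + ENNReal.ofReal (2 * e) * ρ n * (𝐆[4 * e] (u n ⋆ₗ u n)) x := by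
    intro n
    have hφm : Measurable 𝚽[e, ρ n, V, u n] := measurable_data e hV (hmeas n) (ρ n)
    set κ := ENNReal.ofReal (2 * e) * ρ n * ∫⁻ z, u n z with hκ
    have hκfin : κ ≠ ∞ := ENNReal.mul_ne_top (ENNReal.mul_ne_top ENNReal.ofReal_ne_top (hρfin n))
      (iter_lintegral_ne_top he hV hVfin hVint hVpos hB hVB h0 hs n)
    have h4e0 : ENNReal.ofReal (4 * e) ≠ 0 := by simpa using hc
    have hBφ : ∀ x, (𝐆[4 * e] 𝚽[e, ρ n, V, u n]) x ≤ B + κ / ENNReal.ofReal (4 * e) := fun x =>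
      G_data_le he hV hVB (hle1 n) (ρ n) x
    have hBφfin : B + κ / ENNReal.ofReal (4 * e) ≠ ∞ :=
      ENNReal.add_ne_top.2 ⟨hB, ENNReal.div_ne_top hκfin h4e0⟩
    have hres := kRes_resolvent_eq hc hV hVfin hGV hφm hBφfin hBφ x
    rw [← hs n] at hres
    rw [hres, G_add (4 * e) hV, G_const_mul (4 * e) (measurable_lconv_self (hmeas n))]
  -- take the supremum over n of both sides
  have hL : (⨆ n, (u (n + 1) x + (𝐆[4 * e] fun y => V y * u (n + 1) y) x)) =
      (⨆ n, u n x) + (𝐆[4 * e] fun y => V y * ⨆ n, u n y) x := by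
    have hm1 : Monotone fun n => u (n + 1) x := fun n m h => hmono (Nat.succ_le_succ h) x
    have hm2 : Monotone fun n => (𝐆[4 * e] fun y => V y * u (n + 1) y) x := fun n m h =>
      G_mono (4 * e) (fun y => mul_le_mul' le_rfl (hmono (Nat.succ_le_succ h) y)) x
    rw [← ENNReal.iSup_add_iSup_of_monotone hm1 hm2]
    congr 1
    · exact iSup_succ_of_monotone (f := fun n => u n x) (fun n m h => hmono h x)
    · have hg : ∀ n, Measurable fun y => V y * u (n + 1) y := fun n => hV.mul (hmeas (n + 1))
      have hgm : Monotone fun n => fun y => V y * u (n + 1) y := fun n m h y =>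
        mul_le_mul' le_rfl (hmono (Nat.succ_le_succ h) y)
      rw [← lconvolution_iSup_right (measurable_ofReal_yukawa _) hg hgm x]
      congr 1
      funext y
      rw [ENNReal.mul_iSup]
      exact iSup_succ_of_monotone (f := fun n => V y * u n y) (fun n m h => mul_le_mul' le_rfl (hmono h y))
  have hR : (⨆ n, ((𝐆[4 * e] V) x + ENNReal.ofReal (2 * e) * ρ n * (𝐆[4 * e] (u n ⋆ₗ u n)) x)) =
      (𝐆[4 * e] V) x + ENNReal.ofReal (2 * e) * (⨆ n, ρ n) *
        (𝐆[4 * e] ((fun x => ⨆ n, u n x) ⋆ₗ fun x => ⨆ n, u n x)) x := by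
    rw [← ENNReal.add_iSup]
    congr 1
    have hT : Monotone fun n => (𝐆[4 * e] (u n ⋆ₗ u n)) x := fun n m h =>
      G_mono (4 * e) (lconvolution_mono (hmono h) (hmono h)) x
    simp only [mul_assoc]
    rw [← ENNReal.mul_iSup, ← iSup_mul_iSup_of_monotone hρmono hT]
    congr 2
    have hg : ∀ n, Measurable (u n ⋆ₗ u n) := fun n => measurable_lconv_self (hmeas n)
    have hgm : Monotone fun n => u n ⋆ₗ u n := fun n m h => lconvolution_mono (hmono h) (hmono h)
    rw [← lconvolution_iSup_right (measurable_ofReal_yukawa _) hg hgm x]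
    congr 1
    funext y
    exact (lconv_usol he hV hVfin hVint hVpos hB hVB h0 hs y).symm
  have hsup : (⨆ n, (u (n + 1) x + (𝐆[4 * e] fun y => V y * u (n + 1) y) x)) =
      ⨆ n, ((𝐆[4 * e] V) x + ENNReal.ofReal (2 * e) * ρ n * (𝐆[4 * e] (u n ⋆ₗ u n)) x) :=
    iSup_congr hstep
  rw [← hL, hsup, hR, rho_usol he hV hVfin hVint hVpos hB hVB h0 hs]

/-- **The mild form of the limit equation**: `usol = G(V(1 − usol) + 2eρ usol ⋆ usol)`.
[cite: CarlenJauslinLieb2020, §2] -/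
theorem usol_mild (x : Space) :
    (⨆ n, u n x) = (𝐆[4 * e] fun y => V y * (1 - ⨆ n, u n y) +
      ENNReal.ofReal (2 * e) * (ENNReal.ofReal (2 * e) / 𝐋[V, fun x => ⨆ n, u n x]) *
        ((fun x => ⨆ n, u n x) ⋆ₗ fun x => ⨆ n, u n x) y) x := by
  have hGV : ∀ x, (𝐆[4 * e] V) x ≠ ∞ := fun x => ne_top_of_le_ne_top hB (hVB x)
  have hum := usol_measurable he hV hVfin hVint hVpos hB hVB h0 hs
  have hu1 := usol_le_one he hV hVfin hVint hVpos hB hVB h0 hs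
  have heq := usol_resolvent_eq he hV hVfin hVint hVpos hB hVB h0 hs x
  have hm1 : Measurable fun y => V y * (1 - ⨆ n, u n y) := measurable_L_integrand hV hum
  have hm2 : Measurable fun y => V y * ⨆ n, u n y := hV.mul hum
  -- G V = G(V(1-usol)) + G(V usol)
  have hsplit : (𝐆[4 * e] V) x = (𝐆[4 * e] fun y => V y * (1 - ⨆ n, u n y)) x +
      (𝐆[4 * e] fun y => V y * ⨆ n, u n y) x := by
    rw [← G_add (4 * e) hm1]
    congr 1
    funext y
    rw [← mul_add, tsub_add_cancel_of_le (hu1 y), mul_one]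
  have hfin : (𝐆[4 * e] fun y => V y * ⨆ n, u n y) x ≠ ∞ :=
    ne_top_of_le_ne_top (hGV x) (G_mono (4 * e) (fun y => mul_le_of_le_one_right' (hu1 y)) x)
  rw [hsplit] at heq
  rw [G_add (4 * e) hm1, G_const_mul (4 * e) (measurable_lconv_self hum)]
  refine (ENNReal.add_left_inj hfin).1 ?_
  rw [heq]
  ring

/-- **`usol = K(V + 2eρ usol ⋆ usol)`** (uniqueness for the linear resolvent equation).
[cite: CarlenJauslinLieb2020, §2] -/
theorem usol_eq_kRes : (fun x => ⨆ n, u n x) =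
    kRes (4 * e) V 𝚽[e, ENNReal.ofReal (2 * e) / 𝐋[V, fun x => ⨆ n, u n x], V, fun x => ⨆ n, u n x] := by
  have hc := four_mul_pos he
  have hGV : ∀ x, (𝐆[4 * e] V) x ≠ ∞ := fun x => ne_top_of_le_ne_top hB (hVB x)
  have hum := usol_measurable he hV hVfin hVint hVpos hB hVB h0 hs
  have hu1 := usol_le_one he hV hVfin hVint hVpos hB hVB h0 hs
  set ρ := ENNReal.ofReal (2 * e) / 𝐋[V, fun x => ⨆ n, u n x] with hρ
  have hρfin : ρ ≠ ∞ := rho_usol_ne_top he hV hVfin hVint hVpos hB hVB h0 hs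
  have hφm : Measurable 𝚽[e, ρ, V, fun x => ⨆ n, u n x] := measurable_data e hV hum ρ
  set κ := ENNReal.ofReal (2 * e) * ρ * ∫⁻ z, ⨆ n, u n z with hκ
  have hκfin : κ ≠ ∞ := ENNReal.mul_ne_top (ENNReal.mul_ne_top ENNReal.ofReal_ne_top hρfin)
    (lintegral_usol_ne_top he hV hVfin hVint hVpos hB hVB h0 hs)
  have h4e0 : ENNReal.ofReal (4 * e) ≠ 0 := by simpa using hc
  have hBφ : ∀ x, (𝐆[4 * e] 𝚽[e, ρ, V, fun x => ⨆ n, u n x]) x ≤ B + κ / ENNReal.ofReal (4 * e) :=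
    fun x => G_data_le he hV hVB hu1 ρ x
  have hBφfin : B + κ / ENNReal.ofReal (4 * e) ≠ ∞ :=
    ENNReal.add_ne_top.2 ⟨hB, ENNReal.div_ne_top hκfin h4e0⟩
  refine kRes_unique hc hV hVfin hGV hφm hBφfin hBφ hum fun x => ?_
  rw [usol_resolvent_eq he hV hVfin hVint hVpos hB hVB h0 hs x, G_add (4 * e) hV,
    G_const_mul (4 * e) (measurable_lconv_self hum)]

end Iter

end LayerC

section LayerD

variable {𝒱 : Space → ℝ} {p : ℝ≥0∞} {e : ℝ}

/-! ### The potential in `ℝ≥0∞` form and the bound on `G_c V` (how `p > 3/2` enters) -/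

/-- `ofReal ∘ 𝒱` is measurable for measurable `𝒱`. [folklore] -/
theorem measurable_ofReal_pot (hVm : Measurable 𝒱) : Measurable fun y => ENNReal.ofReal (𝒱 y) :=
  ENNReal.measurable_ofReal.comp hVm

/-- `∫⁻ ofReal ∘ 𝒱 = ofReal (∫𝒱)` for `𝒱 ≥ 0` integrable. [folklore] -/
theorem lintegral_ofReal_pot (h0 : ∀ x, 0 ≤ 𝒱 x) (h1 : Integrable 𝒱) :
    ∫⁻ y, ENNReal.ofReal (𝒱 y) = ENNReal.ofReal (∫ y, 𝒱 y) :=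
  (ofReal_integral_eq_lintegral_ofReal h1 (ae_of_all _ h0)).symm

/-- `∫⁻ ofReal ∘ 𝒱 ≠ 0` when `∫𝒱 > 0`. [folklore] -/
theorem lintegral_ofReal_pot_ne_zero (h0 : ∀ x, 0 ≤ 𝒱 x) (h1 : Integrable 𝒱) (hpos : 0 < ∫ x, 𝒱 x) :
    ∫⁻ y, ENNReal.ofReal (𝒱 y) ≠ 0 := by
  rw [lintegral_ofReal_pot h0 h1]
  simpa using hpos

/-- An exponent `q` conjugate to `p > 3/2` with `1 ≤ q < 3`. [folklore] -/
theorem conj_exponent_lt_three (hp : 3 / 2 < p) : 1 ≤ (1 - p⁻¹)⁻¹ ∧ (1 - p⁻¹)⁻¹ < 3 := by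
  refine ⟨by rw [ENNReal.one_le_inv]; exact tsub_le_self, ?_⟩
  rw [ENNReal.inv_lt_iff_inv_lt]
  have h1 : p⁻¹ < (3 / 2 : ℝ≥0∞)⁻¹ := ENNReal.inv_lt_inv.2 hp
  have h2 : (3 / 2 : ℝ≥0∞)⁻¹ = 2 / 3 := by
    rw [ENNReal.inv_div (Or.inl (by norm_num)) (Or.inl (by norm_num))]
  rw [h2] at h1
  have h3 : (3 : ℝ≥0∞)⁻¹ + 2 / 3 = 1 := by
    rw [← one_div, ENNReal.div_add_div_same, show (1 : ℝ≥0∞) + 2 = 3 by norm_num,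
      ENNReal.div_self (by norm_num) (by norm_num)]
  apply lt_tsub_iff_right.2
  calc (3 : ℝ≥0∞)⁻¹ + p⁻¹ < 3⁻¹ + 2 / 3 := ENNReal.add_lt_add_left (by simp) h1
    _ = 1 := h3

/-- **`G_c V` is bounded** for `𝒱 ∈ Lᵖ`, `p > 3/2`, `c > 0`: `G_c V ≤ ‖Y_c‖_q ‖𝒱‖_p < ∞`
(Hölder; `Y_c ∈ L^q` for the conjugate `q < 3`). [cite: CarlenJauslinLieb2020, §2] -/
theorem exists_G_pot_bound (hp : 3 / 2 < p) (h0 : ∀ x, 0 ≤ 𝒱 x) (h2 : MemLp 𝒱 p) {c : ℝ}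
    (hc : 0 < c) : ∃ B : ℝ≥0∞, B ≠ ∞ ∧ ∀ x, (𝐆[c] fun y => ENNReal.ofReal (𝒱 y)) x ≤ B := by
  have h32 : (1 : ℝ≥0∞) ≤ 3 / 2 := by
    rw [ENNReal.le_div_iff_mul_le (Or.inl (by norm_num)) (Or.inl (by norm_num)), one_mul]
    exact_mod_cast (by norm_num : (2 : ℕ) ≤ 3)
  have hp1 : 1 ≤ p := h32.trans hp.le
  haveI : p.HolderConjugate (1 - p⁻¹)⁻¹ := ENNReal.HolderConjugate.inv_one_sub_inv' hp1
  obtain ⟨hq1, hq3⟩ := conj_exponent_lt_three hp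
  refine ⟨eLpNorm (yukawa c) (1 - p⁻¹)⁻¹ volume * eLpNorm 𝒱 p volume,
    ENNReal.mul_ne_top (memLp_yukawa hc hq1 hq3).2.ne h2.2.ne, fun x => ?_⟩
  have hfun : (fun y => ENNReal.ofReal (𝒱 y)) = fun y => ‖𝒱 y‖ₑ := by
    funext y; exact (Real.enorm_eq_ofReal (h0 y)).symm
  rw [hfun]
  exact yukawa_lconv_enorm_le c h2.1 x

/-! ### Real and `ℝ≥0∞` convolutions -/

/-- For non-negative measurable real functions, the tree's `conv f g` is the real part of `⋆ₗ`.
[folklore] -/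
theorem conv_eq_toReal_lconv {f g : Space → ℝ} (hf0 : ∀ y, 0 ≤ f y) (hg0 : ∀ y, 0 ≤ g y)
    (hfm : Measurable f) (hgm : Measurable g) (x : Space) :
    conv f g x = (((fun y => ENNReal.ofReal (f y)) ⋆ₗ fun y => ENNReal.ofReal (g y)) x).toReal := by
  have hsub : Measurable fun y : Space => x - y := measurable_const.sub measurable_id
  have hF : Measurable fun y => f y * g (x - y) := hfm.mul (hgm.comp hsub)
  rw [conv_apply, integral_eq_lintegral_of_nonneg_ae (ae_of_all _ fun y => mul_nonneg (hf0 y) (hg0 _))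
    hF.aestronglyMeasurable, lconvolution_def]
  congr 1
  refine lintegral_congr fun y => ?_
  rw [ENNReal.ofReal_mul (hf0 y), neg_add_eq_sub]

/-- Convolution only depends on a.e. classes (translation invariance of Lebesgue measure).
[folklore] -/
theorem conv_congr_ae {f f' g g' : Space → ℝ} (hf : f =ᵐ[volume] f') (hg : g =ᵐ[volume] g') (x : Space) :
    conv f g x = conv f' g' x := by
  rw [conv_apply, conv_apply]
  refine integral_congr_ae ?_
  have hmp := (Measure.measurePreserving_sub_left (volume : Measure Space) x).quasiMeasurePreserving
  have hg' : (fun y => g (x - y)) =ᵐ[volume] fun y => g' (x - y) := hmp.ae_eq_comp hg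
  filter_upwards [hf, hg'] with y hfy hgy
  rw [hfy]
  exact congrArg _ hgy

/-! ### The constructed solution solves the (real) simple equation (CJL-I Lemma 6) -/

/-- **Existence (CJL-I Lemma 6).** For a measurable potential `𝒱 ≥ 0`, `𝒱 ∈ L¹ ∩ Lᵖ` (`p > 3/2`),
`∫𝒱 > 0`, and `e > 0`, the limit `u = ⨆ u_n` of the iteration and `ρ = 2e/∫𝒱(1 − u)` give a
solution `(ρ, e, u)` of the simple equation in the sense of `IsSolution`.
[cite: CarlenJauslinLieb2020, §2] -/
theorem isSolution_of_iter (hp : 3 / 2 < p) (hVm : Measurable 𝒱) (h0 : ∀ x, 0 ≤ 𝒱 x)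
    (h1 : Integrable 𝒱) (h2 : MemLp 𝒱 p) (hpos : 0 < ∫ x, 𝒱 x) (he : 0 < e)
    {u : ℕ → Space → ℝ≥0∞} (hu0 : u 0 = 0)
    (hs : ∀ n, u (n + 1) = 𝐍[e, fun y => ENNReal.ofReal (𝒱 y), u n]) :
    IsSolution 𝒱
      (ENNReal.ofReal (2 * e) / 𝐋[fun y => ENNReal.ofReal (𝒱 y), fun x => ⨆ n, u n x]).toReal e
      fun x => (⨆ n, u n x).toReal := by
  set V : Space → ℝ≥0∞ := fun y => ENNReal.ofReal (𝒱 y) with hVdef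
  have hV : Measurable V := measurable_ofReal_pot hVm
  have hVfin : ∀ y, V y ≠ ∞ := fun y => ENNReal.ofReal_ne_top
  have hVint : ∫⁻ y, V y ≠ ∞ := by rw [hVdef, lintegral_ofReal_pot h0 h1]; exact ENNReal.ofReal_ne_top
  have hVpos : ∫⁻ y, V y ≠ 0 := lintegral_ofReal_pot_ne_zero h0 h1 hpos
  obtain ⟨B, hB, hVB⟩ := exists_G_pot_bound hp h0 h2 (four_mul_pos he)
  have hum := usol_measurable he hV hVfin hVint hVpos hB hVB hu0 hs
  have hu1 := usol_le_one he hV hVfin hVint hVpos hB hVB hu0 hs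
  have huint := lintegral_usol_ne_top he hV hVfin hVint hVpos hB hVB hu0 hs
  set usol : Space → ℝ≥0∞ := fun x => ⨆ n, u n x with husol
  set L := 𝐋[V, fun x => ⨆ n, u n x] with hL
  have hL0 : L ≠ 0 := L_usol_ne_zero he hV hVfin hVint hVpos hB hVB hu0 hs
  have hLfin : L ≠ ∞ := L_ne_top hVint _
  set ρ := ENNReal.ofReal (2 * e) / L with hρ
  have hρfin : ρ ≠ ∞ := ENNReal.div_ne_top ENNReal.ofReal_ne_top hL0
  set ur : Space → ℝ := fun x => (⨆ n, u n x).toReal with hur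
  have hur0 : ∀ x, 0 ≤ ur x := fun x => ENNReal.toReal_nonneg
  have hur1 : ∀ x, ur x ≤ 1 := fun x => by
    have := ENNReal.toReal_mono ENNReal.one_ne_top (hu1 x)
    rwa [ENNReal.toReal_one] at this
  have hurm : Measurable ur := hum.ennreal_toReal
  have hofReal_ur : (fun y => ENNReal.ofReal (ur y)) = usol := by
    funext y
    exact ENNReal.ofReal_toReal (ne_top_of_le_ne_top ENNReal.one_ne_top (hu1 y))
  -- the self-convolution
  have hconv : ∀ y, conv ur ur y = ((usol ⋆ₗ usol) y).toReal := fun y => by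
    rw [conv_eq_toReal_lconv hur0 hur0 hurm hurm y, hofReal_ur]
  have hlconv_fin : ∀ y, (usol ⋆ₗ usol) y ≠ ∞ := fun y =>
    ne_top_of_le_ne_top huint (lconv_self_le hu1 y)
  -- the data function
  set Φ : Space → ℝ≥0∞ := fun y => V y * (1 - ⨆ n, u n y) + ENNReal.ofReal (2 * e) * ρ * (usol ⋆ₗ usol) y
    with hΦ
  have hΦm : Measurable Φ := by
    have hA : Measurable fun y => V y * (1 - ⨆ n, u n y) := measurable_L_integrand hV hum
    have hB' : Measurable fun y => ENNReal.ofReal (2 * e) * ρ * (usol ⋆ₗ usol) y :=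
      (measurable_lconv_self hum).const_mul _
    exact hA.add hB'
  have hΦ1fin : ∀ y, V y * (1 - ⨆ n, u n y) ≠ ∞ := fun y =>
    ENNReal.mul_ne_top (hVfin y) (ne_top_of_le_ne_top ENNReal.one_ne_top tsub_le_self)
  have hΦ2fin : ∀ y, ENNReal.ofReal (2 * e) * ρ * (usol ⋆ₗ usol) y ≠ ∞ := fun y =>
    ENNReal.mul_ne_top (ENNReal.mul_ne_top ENNReal.ofReal_ne_top hρfin) (hlconv_fin y)
  have hΦfin : ∀ y, Φ y ≠ ∞ := fun y => ENNReal.add_ne_top.2 ⟨hΦ1fin y, hΦ2fin y⟩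
  set F : Space → ℝ := fun y => (1 - ur y) * 𝒱 y + 2 * e * ρ.toReal * conv ur ur y with hF
  have hFΦ : ∀ y, F y = (Φ y).toReal := by
    intro y
    have eΦ : (Φ y).toReal = 𝒱 y * (1 - (⨆ n, u n y).toReal) +
        2 * e * ρ.toReal * ((usol ⋆ₗ usol) y).toReal := by
      rw [hΦ]
      simp only []
      rw [ENNReal.toReal_add (hΦ1fin y) (hΦ2fin y), ENNReal.toReal_mul, ENNReal.toReal_sub_of_le (hu1 y)
        ENNReal.one_ne_top, ENNReal.toReal_one, ENNReal.toReal_ofReal (h0 y), ENNReal.toReal_mul,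
        ENNReal.toReal_mul, ENNReal.toReal_ofReal (by positivity)]
    rw [eΦ, hF]
    simp only []
    rw [hconv y, hur]
    ring
  have hF0 : ∀ y, 0 ≤ F y := fun y => by rw [hFΦ y]; exact ENNReal.toReal_nonneg
  have hFm : Measurable F := by
    have : F = fun y => (Φ y).toReal := funext hFΦ
    rw [this]; exact hΦm.ennreal_toReal
  have hofReal_F : (fun y => ENNReal.ofReal (F y)) = Φ := by
    funext y; rw [hFΦ y, ENNReal.ofReal_toReal (hΦfin y)]
  refine ⟨?_, hur0, hur1, ?_, ?_⟩
  · -- integrable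
    exact integrable_toReal_of_lintegral_ne_top hum.aemeasurable huint
  · -- mild form
    intro x
    change ur x = conv (yukawa (4 * e)) F x
    rw [conv_yukawa_eq_toReal_lconv (4 * e) hF0 hFm.aestronglyMeasurable x, hofReal_F]
    simp only [hur]
    congr 1
    exact usol_mild he hV hVfin hVint hVpos hB hVB hu0 hs x
  · -- energy constraint
    change e = ρ.toReal / 2 * ∫ x, (1 - ur x) * 𝒱 x
    have hint : ∫ x, (1 - ur x) * 𝒱 x = L.toReal := by
      rw [integral_eq_lintegral_of_nonneg_ae (ae_of_all _ fun y => mul_nonneg (sub_nonneg.2 (hur1 y)) (h0 y))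
        (((measurable_const.sub hurm).mul hVm).aestronglyMeasurable), hL]
      congr 1
      refine lintegral_congr fun y => ?_
      rw [ENNReal.ofReal_mul (sub_nonneg.2 (hur1 y)), ENNReal.ofReal_sub _ (hur0 y), ENNReal.ofReal_one,
        mul_comm]
      simp only [hur]
      rw [ENNReal.ofReal_toReal (ne_top_of_le_ne_top ENNReal.one_ne_top (hu1 y))]
    have hLr : 0 < L.toReal := ENNReal.toReal_pos hL0 hLfin
    rw [hint, hρ, ENNReal.toReal_div, ENNReal.toReal_ofReal (by positivity)]
    field_simp

/-! ### Every solution with `e > 0` has `ρ > 0`, is measurable; uniqueness (CJL-I Lemma 7) -/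

/-- For a solution at energy `e > 0` (and `𝒱 ≥ 0`): `ρ > 0` and `∫(1 − u)𝒱 > 0` (energy constraint).
[cite: CarlenJauslinLieb2020, §2] -/
theorem IsSolution.rho_pos {ρ : ℝ} {u : Space → ℝ} (hu : IsSolution 𝒱 ρ e u) (h0 : ∀ x, 0 ≤ 𝒱 x)
    (he : 0 < e) : 0 < ρ ∧ 0 < ∫ x, (1 - u x) * 𝒱 x := by
  have hE : e = ρ / 2 * ∫ x, (1 - u x) * 𝒱 x := hu.energy
  have hI : 0 ≤ ∫ x, (1 - u x) * 𝒱 x :=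
    integral_nonneg fun x => mul_nonneg (sub_nonneg.2 (hu.le_one x)) (h0 x)
  constructor
  · by_contra hρ
    have hρ0 : ρ ≤ 0 := not_lt.1 hρ
    nlinarith
  · rcases eq_or_lt_of_le hI with h | h
    · rw [← h, mul_zero] at hE; linarith
    · exact h

/-- **Every solution is measurable** (`𝒱` measurable, `ρ, e ≥ 0`): `u = Y_{4e} ∗ F` pointwise, and `F`
may be replaced by a measurable a.e.-modification without changing the convolution.
[cite: CarlenJauslinLieb2020, §2] -/
theorem IsSolution.measurable_of {ρ : ℝ} {u : Space → ℝ} (hu : IsSolution 𝒱 ρ e u)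
    (hVm : Measurable 𝒱) (h0 : ∀ x, 0 ≤ 𝒱 x) (hρ : 0 ≤ ρ) (he : 0 ≤ e) : Measurable u := by
  -- a measurable modification with values in [0,1]
  set um : Space → ℝ := fun x => max (min (hu.integrable.1.mk u x) 1) 0 with hum_def
  have humm : Measurable um :=
    (hu.integrable.1.stronglyMeasurable_mk.measurable.min measurable_const).max measurable_const
  have hae : u =ᵐ[volume] um := by
    filter_upwards [hu.integrable.1.ae_eq_mk] with x hx
    rw [hum_def]
    simp only []
    rw [← hx, min_eq_left (hu.le_one x), max_eq_left (hu.nonneg x)]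
  have hum0 : ∀ x, 0 ≤ um x := fun x => le_max_right _ _
  have hum1 : ∀ x, um x ≤ 1 := fun x => max_le (min_le_right _ _) zero_le_one
  have hcc : ∀ y, conv u u y = conv um um y := fun y => conv_congr_ae hae hae y
  set Fm : Space → ℝ := fun y => (1 - um y) * 𝒱 y + 2 * e * ρ * conv um um y with hFm_def
  have hFae : (fun y => (1 - u y) * 𝒱 y + 2 * e * ρ * conv u u y) =ᵐ[volume] Fm := by
    filter_upwards [hae] with y hy
    rw [hFm_def, hcc y, hy]
  have hconvm : ∀ y, conv um um y =
      (((fun z => ENNReal.ofReal (um z)) ⋆ₗ fun z => ENNReal.ofReal (um z)) y).toReal :=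
    fun y => conv_eq_toReal_lconv hum0 hum0 humm humm y
  have hUm : Measurable fun z => ENNReal.ofReal (um z) := ENNReal.measurable_ofReal.comp humm
  have hconv_meas : Measurable (conv um um) := by
    have : conv um um = fun y =>
        (((fun z => ENNReal.ofReal (um z)) ⋆ₗ fun z => ENNReal.ofReal (um z)) y).toReal := funext hconvm
    rw [this]
    exact (measurable_lconvolution _ hUm hUm).ennreal_toReal
  have hFm_meas : Measurable Fm := by
    rw [hFm_def]
    exact ((measurable_const.sub humm).mul hVm).add (hconv_meas.const_mul _)
  have hFm0 : ∀ y, 0 ≤ Fm y := fun y => by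
    have h1 : 0 ≤ conv um um y := by rw [hconvm y]; exact ENNReal.toReal_nonneg
    have h2 : 0 ≤ (1 - um y) * 𝒱 y := mul_nonneg (sub_nonneg.2 (hum1 y)) (h0 y)
    rw [hFm_def]
    positivity
  have hrepr : ∀ x, u x = ((𝐆[4 * e] fun y => ENNReal.ofReal (Fm y)) x).toReal := by
    intro x
    rw [hu.mild x, conv_congr_ae EventuallyEq.rfl hFae x]
    exact conv_yukawa_eq_toReal_lconv (4 * e) hFm0 hFm_meas.aestronglyMeasurable x
  rw [show u = fun x => ((𝐆[4 * e] fun y => ENNReal.ofReal (Fm y)) x).toReal from funext hrepr]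
  exact (G_measurable _ (ENNReal.measurable_ofReal.comp hFm_meas)).ennreal_toReal

/-- **Uniqueness (CJL-I Lemma 7).** In the setting of `isSolution_of_iter`, every solution
`(ρ', e, u')` at the same energy `e` coincides with the constructed one: `ρ' = ρ(e)` and `u' = u`
(everywhere). Printed proof: `ũ ≥ u_n` and `ρ̃ ≥ ρ_n` by induction (`ũ = K(V + 2eρ̃ ũ⋆ũ)`,
monotonicity of `K`), then `1/ρ̃ = ∫ũ ≥ ∫u = 1/ρ` forces equality.
[cite: CarlenJauslinLieb2020, §2] -/
theorem isSolution_unique_of_iter (hp : 3 / 2 < p) (hVm : Measurable 𝒱) (h0 : ∀ x, 0 ≤ 𝒱 x)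
    (h1 : Integrable 𝒱) (h2 : MemLp 𝒱 p) (hpos : 0 < ∫ x, 𝒱 x) (he : 0 < e)
    {u : ℕ → Space → ℝ≥0∞} (hu0 : u 0 = 0)
    (hs : ∀ n, u (n + 1) = 𝐍[e, fun y => ENNReal.ofReal (𝒱 y), u n])
    {ρ' : ℝ} {u' : Space → ℝ} (hsol : IsSolution 𝒱 ρ' e u') :
    ρ' = (ENNReal.ofReal (2 * e) / 𝐋[fun y => ENNReal.ofReal (𝒱 y), fun x => ⨆ n, u n x]).toReal ∧
      u' = fun x => (⨆ n, u n x).toReal := by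
  set V : Space → ℝ≥0∞ := fun y => ENNReal.ofReal (𝒱 y) with hVdef
  have hV : Measurable V := measurable_ofReal_pot hVm
  have hVfin : ∀ y, V y ≠ ∞ := fun y => ENNReal.ofReal_ne_top
  have hVint : ∫⁻ y, V y ≠ ∞ := by rw [hVdef, lintegral_ofReal_pot h0 h1]; exact ENNReal.ofReal_ne_top
  have hVpos : ∫⁻ y, V y ≠ 0 := lintegral_ofReal_pot_ne_zero h0 h1 hpos
  have hc := four_mul_pos he
  obtain ⟨B, hB, hVB⟩ := exists_G_pot_bound hp h0 h2 hc
  have hGV : ∀ x, (𝐆[4 * e] V) x ≠ ∞ := fun x => ne_top_of_le_ne_top hB (hVB x)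
  -- the given solution, in `ℝ≥0∞`
  obtain ⟨hρ', hI'⟩ := hsol.rho_pos h0 he
  have hu'm : Measurable u' := hsol.measurable_of hVm h0 hρ'.le he.le
  set ut : Space → ℝ≥0∞ := fun x => ENNReal.ofReal (u' x) with hut
  have hutm : Measurable ut := ENNReal.measurable_ofReal.comp hu'm
  have hut1 : ∀ x, ut x ≤ 1 := fun x => ENNReal.ofReal_le_one.2 (hsol.le_one x)
  have hut_int : ∫⁻ x, ut x = ENNReal.ofReal (1 / ρ') := by
    rw [hut, ← ofReal_integral_eq_lintegral_ofReal hsol.integrable (ae_of_all _ hsol.nonneg),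
      hsol.integral_eq h1 hρ' he]
  have hut_fin : ∫⁻ x, ut x ≠ ∞ := by rw [hut_int]; exact ENNReal.ofReal_ne_top
  set Lt := 𝐋[V, ut] with hLt
  have hLt_real : ∫ x, (1 - u' x) * 𝒱 x = Lt.toReal := by
    rw [integral_eq_lintegral_of_nonneg_ae (ae_of_all _ fun y => mul_nonneg (sub_nonneg.2 (hsol.le_one y)) (h0 y))
      (((measurable_const.sub hu'm).mul hVm).aestronglyMeasurable), hLt]
    congr 1
    refine lintegral_congr fun y => ?_
    rw [ENNReal.ofReal_mul (sub_nonneg.2 (hsol.le_one y)), ENNReal.ofReal_sub _ (hsol.nonneg y),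
      ENNReal.ofReal_one, mul_comm]
  have hLt_fin : Lt ≠ ∞ := L_ne_top hVint _
  have hLt0 : Lt ≠ 0 := by
    intro h; rw [h, ENNReal.toReal_zero] at hLt_real; rw [hLt_real] at hI'; exact lt_irrefl _ hI'
  set ρt := ENNReal.ofReal ρ' with hρt
  have hρt_eq : ρt = ENNReal.ofReal (2 * e) / Lt := by
    have hE : e = ρ' / 2 * ∫ x, (1 - u' x) * 𝒱 x := hsol.energy
    have hρ'eq : ρ' = 2 * e / Lt.toReal := by
      rw [hLt_real] at hE
      have hLr : 0 < Lt.toReal := ENNReal.toReal_pos hLt0 hLt_fin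
      field_simp
      linarith
    rw [hρt, hρ'eq, ENNReal.ofReal_div_of_pos (ENNReal.toReal_pos hLt0 hLt_fin), ENNReal.ofReal_toReal hLt_fin]
  have hρt_fin : ρt ≠ ∞ := ENNReal.ofReal_ne_top
  -- the mild equation for `ut` in `ℝ≥0∞`
  have hconv : ∀ y, conv u' u' y = ((ut ⋆ₗ ut) y).toReal := fun y =>
    conv_eq_toReal_lconv hsol.nonneg hsol.nonneg hu'm hu'm y
  have hlconv_fin : ∀ y, (ut ⋆ₗ ut) y ≠ ∞ := fun y => ne_top_of_le_ne_top hut_fin (lconv_self_le hut1 y)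
  set Φ : Space → ℝ≥0∞ := fun y => V y * (1 - ut y) + ENNReal.ofReal (2 * e) * ρt * (ut ⋆ₗ ut) y with hΦ
  have hΦm : Measurable Φ := by
    have hA : Measurable fun y => V y * (1 - ut y) := measurable_L_integrand hV hutm
    have hB' : Measurable fun y => ENNReal.ofReal (2 * e) * ρt * (ut ⋆ₗ ut) y :=
      (measurable_lconv_self hutm).const_mul _
    exact hA.add hB'
  have hΦ1fin : ∀ y, V y * (1 - ut y) ≠ ∞ := fun y =>
    ENNReal.mul_ne_top (hVfin y) (ne_top_of_le_ne_top ENNReal.one_ne_top tsub_le_self)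
  have hΦ2fin : ∀ y, ENNReal.ofReal (2 * e) * ρt * (ut ⋆ₗ ut) y ≠ ∞ := fun y =>
    ENNReal.mul_ne_top (ENNReal.mul_ne_top ENNReal.ofReal_ne_top hρt_fin) (hlconv_fin y)
  have hΦfin : ∀ y, Φ y ≠ ∞ := fun y => ENNReal.add_ne_top.2 ⟨hΦ1fin y, hΦ2fin y⟩
  set F : Space → ℝ := fun y => (1 - u' y) * 𝒱 y + 2 * e * ρ' * conv u' u' y with hF
  have hFΦ : ∀ y, F y = (Φ y).toReal := by
    intro y
    have eΦ : (Φ y).toReal = 𝒱 y * (1 - u' y) + 2 * e * ρ' * ((ut ⋆ₗ ut) y).toReal := by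
      rw [hΦ]
      simp only []
      rw [ENNReal.toReal_add (hΦ1fin y) (hΦ2fin y), ENNReal.toReal_mul, ENNReal.toReal_sub_of_le (hut1 y)
        ENNReal.one_ne_top, ENNReal.toReal_one, ENNReal.toReal_mul, ENNReal.toReal_mul,
        ENNReal.toReal_ofReal (by positivity : (0:ℝ) ≤ 2 * e), hρt, ENNReal.toReal_ofReal hρ'.le, hut]
      simp only []
      rw [ENNReal.toReal_ofReal (hsol.nonneg y)]
      simp only [hVdef, ENNReal.toReal_ofReal (h0 y)]
    rw [eΦ, hF]
    simp only []
    rw [hconv y]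
    ring
  have hF0 : ∀ y, 0 ≤ F y := fun y => by rw [hFΦ y]; exact ENNReal.toReal_nonneg
  have hFm : Measurable F := by
    rw [show F = fun y => (Φ y).toReal from funext hFΦ]; exact hΦm.ennreal_toReal
  have hofReal_F : (fun y => ENNReal.ofReal (F y)) = Φ := by
    funext y; rw [hFΦ y, ENNReal.ofReal_toReal (hΦfin y)]
  -- Φ ≤ V + 2e (as ρt (ut ⋆ ut) ≤ ρt ∫ut = ρt/ρ' = 1) so G Φ is finite
  have hΦle : ∀ y, Φ y ≤ V y + ENNReal.ofReal (2 * e) * ρt * ∫⁻ x, ut x := fun y =>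
    add_le_add (mul_le_of_le_one_right' tsub_le_self) (mul_le_mul' le_rfl (lconv_self_le hut1 y))
  have hGΦfin : ∀ x, (𝐆[4 * e] Φ) x ≠ ∞ := by
    intro x
    refine ne_top_of_le_ne_top ?_ (G_mono (4 * e) hΦle x)
    rw [G_add (4 * e) hV, yukawa_lconv_const hc]
    exact ENNReal.add_ne_top.2 ⟨hGV x, ENNReal.mul_ne_top ENNReal.ofReal_ne_top
      (ENNReal.mul_ne_top (ENNReal.mul_ne_top ENNReal.ofReal_ne_top hρt_fin) hut_fin)⟩
  have hmild : ∀ x, ut x = (𝐆[4 * e] Φ) x := by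
    intro x
    have h := hsol.mild x
    change u' x = conv (yukawa (4 * e)) F x at h
    rw [conv_yukawa_eq_toReal_lconv (4 * e) hF0 hFm.aestronglyMeasurable x, hofReal_F] at h
    rw [hut]
    simp only []
    rw [h, ENNReal.ofReal_toReal (hGΦfin x)]
  -- resolvent form and identification with K
  have hres : ∀ x, ut x + (𝐆[4 * e] fun y => V y * ut y) x = (𝐆[4 * e] 𝚽[e, ρt, V, ut]) x := by
    intro x
    have hsplit : (𝐆[4 * e] 𝚽[e, ρt, V, ut]) x = (𝐆[4 * e] Φ) x + (𝐆[4 * e] fun y => V y * ut y) x := by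
      rw [← G_add (4 * e) hΦm]
      congr 1
      funext y
      rw [hΦ]
      simp only []
      calc V y + ENNReal.ofReal (2 * e) * ρt * (ut ⋆ₗ ut) y
          = V y * (1 - ut y) + V y * ut y + ENNReal.ofReal (2 * e) * ρt * (ut ⋆ₗ ut) y := by
            rw [← mul_add, tsub_add_cancel_of_le (hut1 y), mul_one]
        _ = _ := by ring
    rw [hsplit, hmild x]
  have hφm : Measurable 𝚽[e, ρt, V, ut] := measurable_data e hV hutm ρt
  set κ := ENNReal.ofReal (2 * e) * ρt * ∫⁻ z, ut z with hκ
  have hκfin : κ ≠ ∞ := ENNReal.mul_ne_top (ENNReal.mul_ne_top ENNReal.ofReal_ne_top hρt_fin) hut_fin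
  have h4e0 : ENNReal.ofReal (4 * e) ≠ 0 := by simpa using hc
  have hBφ : ∀ x, (𝐆[4 * e] 𝚽[e, ρt, V, ut]) x ≤ B + κ / ENNReal.ofReal (4 * e) := fun x =>
    G_data_le he hV hVB hut1 ρt x
  have hBφfin : B + κ / ENNReal.ofReal (4 * e) ≠ ∞ :=
    ENNReal.add_ne_top.2 ⟨hB, ENNReal.div_ne_top hκfin h4e0⟩
  have hutK : ut = kRes (4 * e) V 𝚽[e, ρt, V, ut] := kRes_unique hc hV hVfin hGV hφm hBφfin hBφ hutm hres
  -- induction: u n ≤ ut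
  have hle : ∀ n, u n ≤ ut := by
    intro n
    induction n with
    | zero => rw [hu0]; exact bot_le
    | succ n ih =>
      rw [hs n, hutK]
      refine kRes_mono (data_mono e ih ?_)
      rw [hρt_eq]
      exact ENNReal.div_le_div_left (L_anti ih) _
  have husol_le : (fun x => ⨆ n, u n x) ≤ ut := fun x => iSup_le fun n => hle n x
  -- the constructed solution
  have hsolr := isSolution_of_iter hp hVm h0 h1 h2 hpos he hu0 hs
  set L := 𝐋[V, fun x => ⨆ n, u n x] with hL
  set ρr := (ENNReal.ofReal (2 * e) / L).toReal with hρr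
  set ur : Space → ℝ := fun x => (⨆ n, u n x).toReal with hur
  change IsSolution 𝒱 ρr e ur at hsolr
  obtain ⟨hρr0, -⟩ := hsolr.rho_pos h0 he
  -- ρr ≤ ρ'
  have hρle : ρr ≤ ρ' := by
    refine ENNReal.toReal_le_of_le_ofReal hρ'.le ?_
    change ENNReal.ofReal (2 * e) / L ≤ ρt
    rw [hρt_eq]
    exact ENNReal.div_le_div_left (L_anti husol_le) _
  -- ur ≤ u' pointwise, ∫u' = 1/ρ' ≤ 1/ρr = ∫ur, hence u' = ur a.e.
  have hu1 := usol_le_one he hV hVfin hVint hVpos hB hVB hu0 hs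
  have hptw : ∀ x, ur x ≤ u' x := fun x => by
    have h := ENNReal.toReal_mono ENNReal.ofReal_ne_top (husol_le x)
    rw [ENNReal.toReal_ofReal (hsol.nonneg x)] at h
    exact h
  have hint_le : ∫ x, u' x ≤ ∫ x, ur x := by
    rw [hsol.integral_eq h1 hρ' he, hsolr.integral_eq h1 hρr0 he]
    exact one_div_le_one_div_of_le hρr0 hρle
  have hae : u' =ᵐ[volume] ur := by
    have hdiff_int : Integrable fun x => u' x - ur x := hsol.integrable.sub hsolr.integrable
    have hdiff0 : 0 ≤ᵐ[volume] fun x => u' x - ur x := ae_of_all _ fun x => sub_nonneg.2 (hptw x)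
    have hzero : ∫ x, (u' x - ur x) = 0 := by
      refine le_antisymm ?_ (integral_nonneg fun x => sub_nonneg.2 (hptw x))
      rw [integral_sub hsol.integrable hsolr.integrable]
      linarith
    have h := (integral_eq_zero_iff_of_nonneg_ae hdiff0 hdiff_int).1 hzero
    filter_upwards [h] with x hx
    simpa [sub_eq_zero] using hx
  -- ρ' = ρr
  have hρeq : ρ' = ρr := by
    have h1' := hsol.integral_eq h1 hρ' he
    rw [integral_congr_ae hae, hsolr.integral_eq h1 hρr0 he] at h1'
    have := congrArg (fun t : ℝ => t⁻¹) h1'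
    simpa using this.symm
  refine ⟨hρeq, ?_⟩
  -- everywhere equality via the mild forms
  funext x
  rw [hsol.mild x, hsolr.mild x]
  refine conv_congr_ae EventuallyEq.rfl ?_ x
  have hcc : ∀ y, conv u' u' y = conv ur ur y := fun y => conv_congr_ae hae hae y
  filter_upwards [hae] with y hy
  rw [hy, hcc y, hρeq]

end LayerD

section LayerE

variable {V : Space → ℝ≥0∞}

/-! ### E1: `∫ V d → 0` when `∫ d → 0` for `d ≤ 1` -/

/-- Pointwise: `V d ≤ (V ∸ k) + k d` for `d ≤ 1`. [folklore] -/
theorem pot_mul_le_tsub_add {v d k : ℝ≥0∞} (hd : d ≤ 1) : v * d ≤ (v - k) + k * d := by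
  calc v * d ≤ ((v - k) + k) * d := mul_le_mul' le_tsub_add le_rfl
    _ = (v - k) * d + k * d := add_mul _ _ _
    _ ≤ (v - k) + k * d := add_le_add (mul_le_of_le_one_right' hd) le_rfl

/-- The tails `∫ (V ∸ k)` vanish as `k → ∞` (`V` finite with finite integral). [folklore] -/
theorem iInf_lintegral_tsub_const (hV : Measurable V) (hVfin : ∀ y, V y ≠ ∞) (hVint : ∫⁻ y, V y ≠ ∞) :
    ⨅ k : ℕ, ∫⁻ y, (V y - k) = 0 := by
  have hmeas : ∀ k : ℕ, Measurable fun y => V y - k := fun k => hV.sub measurable_const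
  have hanti : Antitone fun k : ℕ => fun y => V y - k := fun k k' h y =>
    tsub_le_tsub_left (by exact_mod_cast h) _
  have hfin : ∫⁻ y, (V y - ((0 : ℕ) : ℝ≥0∞)) ≠ ∞ := by simpa using hVint
  rw [← lintegral_iInf hmeas hanti hfin]
  refine (lintegral_eq_zero_iff (Measurable.iInf hmeas)).2 (ae_of_all _ fun y => ?_)
  simp only [Pi.zero_apply]
  refine le_antisymm ?_ bot_le
  obtain ⟨k, hk⟩ := ENNReal.exists_nat_gt (hVfin y)
  exact (iInf_le _ k).trans (tsub_eq_zero_of_le hk.le).le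

/-- **`∫ V dᵢ → 0` along a filter when `∫ dᵢ → 0` and `dᵢ ≤ 1`** (uniform integrability of the
single function `V`; this replaces Hölder in the continuity argument). [folklore] -/
theorem tendsto_lintegral_pot_mul {ι : Type*} {l : Filter ι} (hV : Measurable V)
    (hVfin : ∀ y, V y ≠ ∞) (hVint : ∫⁻ y, V y ≠ ∞) {d : ι → Space → ℝ≥0∞}
    (hd1 : ∀ᶠ i in l, ∀ x, d i x ≤ 1) (hd : Tendsto (fun i => ∫⁻ x, d i x) l (𝓝 0)) :
    Tendsto (fun i => ∫⁻ x, V x * d i x) l (𝓝 0) := by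
  rw [ENNReal.tendsto_nhds_zero]
  intro ε hε
  have hε2 : ε / 2 ≠ 0 := by simpa using hε.ne'
  -- choose the truncation level
  have hlt : ⨅ k : ℕ, ∫⁻ y, (V y - k) < ε / 2 := by
    rw [iInf_lintegral_tsub_const hV hVfin hVint]; exact pos_iff_ne_zero.2 hε2
  obtain ⟨k, hk⟩ := iInf_lt_iff.1 hlt
  -- eventually k ∫ d ≤ ε/2
  have h2 : Tendsto (fun i => (k : ℝ≥0∞) * ∫⁻ x, d i x) l (𝓝 0) := by
    have := ENNReal.Tendsto.const_mul hd (Or.inr (ENNReal.natCast_ne_top k))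
    rwa [mul_zero] at this
  have h3 : ∀ᶠ i in l, (k : ℝ≥0∞) * ∫⁻ x, d i x ≤ ε / 2 :=
    (ENNReal.tendsto_nhds_zero.1 h2) (ε / 2) (pos_iff_ne_zero.2 hε2)
  filter_upwards [hd1, h3] with i hi1 hi3
  have hmeas_k : Measurable fun y => V y - k := hV.sub measurable_const
  calc ∫⁻ x, V x * d i x ≤ ∫⁻ x, ((V x - k) + k * d i x) := lintegral_mono fun x => pot_mul_le_tsub_add (hi1 x)
    _ = (∫⁻ x, (V x - k)) + ∫⁻ x, k * d i x := lintegral_add_left hmeas_k _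
    _ ≤ ε / 2 + ε / 2 := by
        refine add_le_add hk.le ?_
        rw [lintegral_const_mul' _ _ (ENNReal.natCast_ne_top k)]
        exact hi3
    _ = ε := ENNReal.add_halves ε

/-! ### E2/E3: continuity of `𝐋[V, ·]` under `L¹` convergence -/

/-- `∫V(1 − w) ≤ ∫V(1 − w₀) + ∫V(w₀ ∸ w)`. [folklore] -/
theorem L_le_L_add (hV : Measurable V) {w w₀ : Space → ℝ≥0∞} (hw₀ : Measurable w₀) :
    𝐋[V, w] ≤ 𝐋[V, w₀] + ∫⁻ x, V x * (w₀ x - w x) := by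
  have hm : Measurable fun z => V z * (1 - w₀ z) := measurable_L_integrand hV hw₀
  rw [← lintegral_add_left hm]
  refine lintegral_mono fun z => ?_
  rw [← mul_add]
  exact mul_le_mul' le_rfl (tsub_le_tsub_add_tsub)

/-- If `∫|wᵢ − w₀| → 0` (both one-sided parts) with `wᵢ, w₀ ≤ 1`, then `∫V(1 − wᵢ) → ∫V(1 − w₀)`.
[folklore] -/
theorem tendsto_L {ι : Type*} {l : Filter ι} (hV : Measurable V) (hVfin : ∀ y, V y ≠ ∞)
    (hVint : ∫⁻ y, V y ≠ ∞) {w : ι → Space → ℝ≥0∞} {w₀ : Space → ℝ≥0∞}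
    (hw : ∀ᶠ i in l, Measurable (w i) ∧ ∀ x, w i x ≤ 1) (hw₀ : Measurable w₀) (hw₀1 : ∀ x, w₀ x ≤ 1)
    (hD : Tendsto (fun i => (∫⁻ x, (w i x - w₀ x)) + ∫⁻ x, (w₀ x - w i x)) l (𝓝 0)) :
    Tendsto (fun i => 𝐋[V, w i]) l (𝓝 𝐋[V, w₀]) := by
  have hD1 : Tendsto (fun i => ∫⁻ x, (w i x - w₀ x)) l (𝓝 0) :=
    tendsto_of_tendsto_of_tendsto_of_le_of_le' tendsto_const_nhds hD
      (Eventually.of_forall fun _ => bot_le) (Eventually.of_forall fun _ => le_self_add)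
  have hD2 : Tendsto (fun i => ∫⁻ x, (w₀ x - w i x)) l (𝓝 0) :=
    tendsto_of_tendsto_of_tendsto_of_le_of_le' tendsto_const_nhds hD
      (Eventually.of_forall fun _ => bot_le) (Eventually.of_forall fun _ => le_add_self)
  have hA : Tendsto (fun i => ∫⁻ x, V x * (w₀ x - w i x)) l (𝓝 0) :=
    tendsto_lintegral_pot_mul hV hVfin hVint
      (Eventually.of_forall fun i x => tsub_le_self.trans (hw₀1 x)) hD2
  have hA' : Tendsto (fun i => ∫⁻ x, V x * (w i x - w₀ x)) l (𝓝 0) :=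
    tendsto_lintegral_pot_mul hV hVfin hVint
      (hw.mono fun i hi x => tsub_le_self.trans (hi.2 x)) hD1
  have hLfin : 𝐋[V, w₀] ≠ ∞ := L_ne_top hVint _
  refine tendsto_of_tendsto_of_tendsto_of_le_of_le' (g := fun i => 𝐋[V, w₀] - ∫⁻ x, V x * (w i x - w₀ x))
    (h := fun i => 𝐋[V, w₀] + ∫⁻ x, V x * (w₀ x - w i x)) ?_ ?_ ?_ ?_
  · have := ENNReal.Tendsto.sub (tendsto_const_nhds (x := 𝐋[V, w₀])) hA' (Or.inl hLfin)
    rwa [tsub_zero] at this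
  · have := (tendsto_const_nhds (x := 𝐋[V, w₀])).add hA
    rwa [add_zero] at this
  · filter_upwards [hw] with i hi
    exact tsub_le_iff_right.2 (L_le_L_add hV hi.1)
  · exact Eventually.of_forall fun i => L_le_L_add hV hw₀

/-- Similarly `∫wᵢ → ∫w₀`. [folklore] -/
theorem tendsto_lintegral_of_D {ι : Type*} {l : Filter ι} {w : ι → Space → ℝ≥0∞}
    {w₀ : Space → ℝ≥0∞} (hw : ∀ᶠ i in l, Measurable (w i)) (hw₀ : Measurable w₀)
    (hfin : ∫⁻ x, w₀ x ≠ ∞)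
    (hD : Tendsto (fun i => (∫⁻ x, (w i x - w₀ x)) + ∫⁻ x, (w₀ x - w i x)) l (𝓝 0)) :
    Tendsto (fun i => ∫⁻ x, w i x) l (𝓝 (∫⁻ x, w₀ x)) := by
  have hD1 : Tendsto (fun i => ∫⁻ x, (w i x - w₀ x)) l (𝓝 0) :=
    tendsto_of_tendsto_of_tendsto_of_le_of_le' tendsto_const_nhds hD
      (Eventually.of_forall fun _ => bot_le) (Eventually.of_forall fun _ => le_self_add)
  have hD2 : Tendsto (fun i => ∫⁻ x, (w₀ x - w i x)) l (𝓝 0) :=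
    tendsto_of_tendsto_of_tendsto_of_le_of_le' tendsto_const_nhds hD
      (Eventually.of_forall fun _ => bot_le) (Eventually.of_forall fun _ => le_add_self)
  refine tendsto_of_tendsto_of_tendsto_of_le_of_le' (g := fun i => (∫⁻ x, w₀ x) - ∫⁻ x, (w₀ x - w i x))
    (h := fun i => (∫⁻ x, w₀ x) + ∫⁻ x, (w i x - w₀ x)) ?_ ?_ ?_ ?_
  · have := ENNReal.Tendsto.sub (tendsto_const_nhds (x := ∫⁻ x, w₀ x)) hD2 (Or.inl hfin)
    rwa [tsub_zero] at this
  · have := (tendsto_const_nhds (x := ∫⁻ x, w₀ x)).add hD1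
    rwa [add_zero] at this
  · filter_upwards [hw] with i hi
    refine tsub_le_iff_right.2 ?_
    calc ∫⁻ x, w₀ x ≤ ∫⁻ x, (w i x + (w₀ x - w i x)) := lintegral_mono fun x => le_add_tsub
      _ = (∫⁻ x, w i x) + ∫⁻ x, (w₀ x - w i x) := lintegral_add_left hi _
  · refine Eventually.of_forall fun i => ?_
    calc ∫⁻ x, w i x ≤ ∫⁻ x, (w₀ x + (w i x - w₀ x)) := lintegral_mono fun x => le_add_tsub
      _ = (∫⁻ x, w₀ x) + ∫⁻ x, (w i x - w₀ x) := lintegral_add_left hw₀ _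

/-! ### E4/E5: `L¹`-Lipschitz bounds for `K` in the data and in the parameter -/

/-- `K f ∸ K f' ≤ G_c(f ∸ f')` pointwise. [cite: CarlenJauslinLieb2020, §2] -/
theorem kRes_tsub_le {c : ℝ} (hc : 0 < c) (hV : Measurable V) {f f' : Space → ℝ≥0∞}
    (hf : Measurable f) (hf' : Measurable f') (x : Space) :
    kRes c V f x - kRes c V f' x ≤ (𝐆[c] fun y => f y - f' y) x := by
  refine tsub_le_iff_right.2 ?_
  calc kRes c V f x ≤ kRes c V (fun y => f' y + (f y - f' y)) x := kRes_mono (fun y => le_add_tsub) x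
    _ = kRes c V f' x + kRes c V (fun y => f y - f' y) x := kRes_add hc hV hf' (hf.sub hf') x
    _ ≤ kRes c V f' x + (𝐆[c] fun y => f y - f' y) x := add_le_add le_rfl (kRes_le_G hc (hf.sub hf') x)
    _ = _ := add_comm _ _

/-- `∫(K f ∸ K f') ≤ (1/c) ∫(f ∸ f')`. [cite: CarlenJauslinLieb2020, §2] -/
theorem lintegral_kRes_tsub_le {c : ℝ} (hc : 0 < c) (hV : Measurable V) {f f' : Space → ℝ≥0∞}
    (hf : Measurable f) (hf' : Measurable f') :
    ∫⁻ x, (kRes c V f x - kRes c V f' x) ≤ ENNReal.ofReal (1 / c) * ∫⁻ y, (f y - f' y) := by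
  calc ∫⁻ x, (kRes c V f x - kRes c V f' x) ≤ ∫⁻ x, (𝐆[c] fun y => f y - f' y) x :=
        lintegral_mono fun x => kRes_tsub_le hc hV hf hf' x
    _ = ENNReal.ofReal (1 / c) * ∫⁻ y, (f y - f' y) := lintegral_G hc (hf.sub hf')

/-- `∫|K_c f − K_{c'} f| ≤ |c' − c| ∫f /(c c')` (from the resolvent identity in the parameter;
one of the two one-sided differences vanishes by monotonicity). [cite: CarlenJauslinLieb2020, §2] -/
theorem lintegral_kRes_param_dist_le {c c' : ℝ} (hc : 0 < c) (hc' : 0 < c') (hV : Measurable V)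
    (hVfin : ∀ y, V y ≠ ∞) (hGV : ∀ x, (𝐆[min c c'] V) x ≠ ∞) {f : Space → ℝ≥0∞} (hf : Measurable f)
    {B : ℝ≥0∞} (hB : B ≠ ∞) (hfB : ∀ x, (𝐆[min c c'] f) x ≤ B) :
    (∫⁻ x, (kRes c V f x - kRes c' V f x)) + ∫⁻ x, (kRes c' V f x - kRes c V f x) ≤
      ENNReal.ofReal |c' - c| * (ENNReal.ofReal (1 / c) * (ENNReal.ofReal (1 / c') * ∫⁻ y, f y)) := by
  -- the one-sided estimate for a ≤ b
  have key : ∀ {a b : ℝ}, 0 < a → a ≤ b → (∀ x, (𝐆[a] V) x ≠ ∞) → (∀ x, (𝐆[a] f) x ≤ B) →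
      (∫⁻ x, (kRes a V f x - kRes b V f x)) ≤
        ENNReal.ofReal (b - a) * (ENNReal.ofReal (1 / a) * (ENNReal.ofReal (1 / b) * ∫⁻ y, f y)) := by
    intro a b ha hab hGVa hfBa
    rcases eq_or_lt_of_le hab with h | h
    · subst h; simp
    have hb : 0 < b := ha.trans h
    have hres := kRes_resolvent_c ha h hV hVfin hGVa hf hB hfBa
    have hKb : Measurable (kRes b V f) := measurable_kRes hV hf
    calc ∫⁻ x, (kRes a V f x - kRes b V f x)
        = ∫⁻ x, ENNReal.ofReal (b - a) * kRes a V (kRes b V f) x := by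
          refine lintegral_congr fun x => ?_
          rw [hres x, ENNReal.add_sub_cancel_left]
          exact ne_top_of_le_ne_top hB ((kRes_le_G hb hf x).trans ((G_anti hab f x).trans (hfBa x)))
      _ = ENNReal.ofReal (b - a) * ∫⁻ x, kRes a V (kRes b V f) x :=
          lintegral_const_mul _ (measurable_kRes hV hKb)
      _ ≤ ENNReal.ofReal (b - a) * ∫⁻ x, (𝐆[a] (𝐆[b] f)) x := by
          refine mul_le_mul' le_rfl (lintegral_mono fun x => ?_)
          exact (kRes_le_G ha hKb x).trans (G_mono a (kRes_le_G hb hf) x)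
      _ = ENNReal.ofReal (b - a) * (ENNReal.ofReal (1 / a) * (ENNReal.ofReal (1 / b) * ∫⁻ y, f y)) := by
          rw [lintegral_G ha (G_measurable b hf), lintegral_G hb hf]
  rcases le_total c c' with h | h
  · have hmin : min c c' = c := min_eq_left h
    rw [hmin] at hGV hfB
    have h1 := key hc h hGV hfB
    have h2 : ∫⁻ x, (kRes c' V f x - kRes c V f x) = 0 := by
      refine (lintegral_eq_zero_iff ((measurable_kRes hV hf).sub (measurable_kRes hV hf))).2
        (ae_of_all _ fun x => ?_)
      exact tsub_eq_zero_of_le (kRes_anti_c h V f x)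
    rw [h2, add_zero, abs_of_nonneg (by linarith)]
    exact h1
  · have hmin : min c c' = c' := min_eq_right h
    rw [hmin] at hGV hfB
    have h1 := key hc' h hGV hfB
    have h2 : ∫⁻ x, (kRes c V f x - kRes c' V f x) = 0 := by
      refine (lintegral_eq_zero_iff ((measurable_kRes hV hf).sub (measurable_kRes hV hf))).2
        (ae_of_all _ fun x => ?_)
      exact tsub_eq_zero_of_le (kRes_anti_c h V f x)
    rw [h2, zero_add, abs_of_nonpos (by linarith), neg_sub]
    calc ∫⁻ x, (kRes c' V f x - kRes c V f x)
        ≤ ENNReal.ofReal (c - c') * (ENNReal.ofReal (1 / c') * (ENNReal.ofReal (1 / c) * ∫⁻ y, f y)) := h1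
      _ = ENNReal.ofReal (c - c') * (ENNReal.ofReal (1 / c) * (ENNReal.ofReal (1 / c') * ∫⁻ y, f y)) := by
          ring

/-! ### E6/E7: differences of self-convolutions and of the data -/

/-- Left additivity of `⋆ₗ`, lambda form. [folklore] -/
theorem lconvolution_add_left' {f f' g : Space → ℝ≥0∞} (hf : Measurable f) (hg : Measurable g) (x : Space) :
    ((fun y => f y + f' y) ⋆ₗ g) x = (f ⋆ₗ g) x + (f' ⋆ₗ g) x := by
  simp only [lconvolution_def, add_mul]
  exact lintegral_add_left (hf.mul (hg.comp (by fun_prop))) _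

/-- Right additivity of `⋆ₗ`, lambda form. [folklore] -/
theorem lconvolution_add_right' {f g : Space → ℝ≥0∞} (hf : Measurable f) (hg : Measurable g)
    (h : Space → ℝ≥0∞) (x : Space) :
    (f ⋆ₗ fun y => g y + h y) x = (f ⋆ₗ g) x + (f ⋆ₗ h) x :=
  lconvolution_add_right hf hg h x

/-- `∫(w⋆w ∸ w₀⋆w₀) ≤ (∫d)² + 2(∫d)(∫w₀)`, `d = w ∸ w₀`. [folklore] -/
theorem lintegral_lconv_self_tsub_le {w w₀ : Space → ℝ≥0∞} (hw : Measurable w) (hw₀ : Measurable w₀) :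
    ∫⁻ y, ((w ⋆ₗ w) y - (w₀ ⋆ₗ w₀) y) ≤
      (∫⁻ x, (w x - w₀ x)) ^ 2 + 2 * ((∫⁻ x, (w x - w₀ x)) * ∫⁻ x, w₀ x) := by
  set d : Space → ℝ≥0∞ := fun x => w x - w₀ x with hd
  have hdm : Measurable d := hw.sub hw₀
  have hws : w ≤ fun x => d x + w₀ x := fun x => le_tsub_add
  have hsm : Measurable fun x => d x + w₀ x := hdm.add hw₀
  -- (d + w₀) ⋆ (d + w₀) = d⋆d + d⋆w₀ + (w₀⋆d + w₀⋆w₀)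
  have hexp : ∀ y, ((fun x => d x + w₀ x) ⋆ₗ fun x => d x + w₀ x) y =
      ((d ⋆ₗ d) y + (d ⋆ₗ w₀) y) + ((w₀ ⋆ₗ d) y + (w₀ ⋆ₗ w₀) y) := by
    intro y
    rw [lconvolution_add_left' hdm hsm y, lconvolution_add_right' hdm hdm, lconvolution_add_right' hw₀ hdm]
  have hpt : ∀ y, (w ⋆ₗ w) y - (w₀ ⋆ₗ w₀) y ≤ (d ⋆ₗ d) y + (d ⋆ₗ w₀) y + (w₀ ⋆ₗ d) y := by
    intro y
    refine tsub_le_iff_right.2 ?_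
    calc (w ⋆ₗ w) y ≤ ((fun x => d x + w₀ x) ⋆ₗ fun x => d x + w₀ x) y := lconvolution_mono hws hws y
      _ = _ := by rw [hexp y]; ring
  have hm1 : Measurable fun y => (d ⋆ₗ d) y + (d ⋆ₗ w₀) y :=
    (measurable_lconvolution _ hdm hdm).add (measurable_lconvolution _ hdm hw₀)
  calc ∫⁻ y, ((w ⋆ₗ w) y - (w₀ ⋆ₗ w₀) y)
      ≤ ∫⁻ y, ((d ⋆ₗ d) y + (d ⋆ₗ w₀) y + (w₀ ⋆ₗ d) y) := lintegral_mono hpt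
    _ = (∫⁻ y, (d ⋆ₗ d) y) + (∫⁻ y, (d ⋆ₗ w₀) y) + ∫⁻ y, (w₀ ⋆ₗ d) y := by
        rw [lintegral_add_left hm1, lintegral_add_left (measurable_lconvolution _ hdm hdm)]
    _ = (∫⁻ x, d x) ^ 2 + 2 * ((∫⁻ x, d x) * ∫⁻ x, w₀ x) := by
        rw [lintegral_lconvolution hdm hdm, lintegral_lconvolution hdm hw₀, lintegral_lconvolution hw₀ hdm]
        ring

/-- The data difference: `∫((V + λ g) ∸ (V + λ₀ g₀)) ≤ (λ ∸ λ₀)∫g + λ₀ ∫(g ∸ g₀)`.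
[cite: CarlenJauslinLieb2020, §2] -/
theorem lintegral_data_tsub_le (V : Space → ℝ≥0∞) {lam lam₀ : ℝ≥0∞} {g g₀ : Space → ℝ≥0∞}
    (hg : Measurable g) (hg₀ : Measurable g₀) :
    ∫⁻ y, ((V y + lam * g y) - (V y + lam₀ * g₀ y)) ≤
      (lam - lam₀) * (∫⁻ y, g y) + lam₀ * ∫⁻ y, (g y - g₀ y) := by
  have hpt : ∀ y, (V y + lam * g y) - (V y + lam₀ * g₀ y) ≤ (lam - lam₀) * g y + lam₀ * (g y - g₀ y) := by
    intro y
    refine tsub_le_iff_right.2 ?_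
    have h1 : lam * g y ≤ (lam - lam₀) * g y + lam₀ * (g y - g₀ y) + lam₀ * g₀ y :=
      calc lam * g y ≤ ((lam - lam₀) + lam₀) * g y := mul_le_mul' le_tsub_add le_rfl
        _ = (lam - lam₀) * g y + lam₀ * g y := add_mul _ _ _
        _ ≤ (lam - lam₀) * g y + lam₀ * ((g y - g₀ y) + g₀ y) :=
            add_le_add le_rfl (mul_le_mul' le_rfl le_tsub_add)
        _ = (lam - lam₀) * g y + lam₀ * (g y - g₀ y) + lam₀ * g₀ y := by rw [mul_add, add_assoc]
    calc V y + lam * g y ≤ V y + ((lam - lam₀) * g y + lam₀ * (g y - g₀ y) + lam₀ * g₀ y) :=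
          add_le_add le_rfl h1
      _ = (lam - lam₀) * g y + lam₀ * (g y - g₀ y) + (V y + lam₀ * g₀ y) := by ring
  have hm : Measurable fun y => (lam - lam₀) * g y := hg.const_mul _
  have hgd : Measurable fun y => g y - g₀ y := hg.sub hg₀
  calc ∫⁻ y, ((V y + lam * g y) - (V y + lam₀ * g₀ y))
      ≤ ∫⁻ y, ((lam - lam₀) * g y + lam₀ * (g y - g₀ y)) := lintegral_mono hpt
    _ = (lam - lam₀) * (∫⁻ y, g y) + lam₀ * ∫⁻ y, (g y - g₀ y) := by
        rw [lintegral_add_left hm, lintegral_const_mul _ hg, lintegral_const_mul _ hgd]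

/-- Bound on `G_m` of the data at an arbitrary parameter `m > 0`. [folklore] -/
theorem G_data_le' {m : ℝ} (hm : 0 < m) (hV : Measurable V) {B : ℝ≥0∞} (hVB : ∀ x, (𝐆[m] V) x ≤ B)
    {w : Space → ℝ≥0∞} (hw1 : ∀ x, w x ≤ 1) (lam : ℝ≥0∞) (x : Space) :
    (𝐆[m] fun y => V y + lam * (w ⋆ₗ w) y) x ≤ B + lam * ((∫⁻ z, w z) / ENNReal.ofReal m) := by
  rw [G_add m hV]
  refine add_le_add (hVB x) ?_
  calc (𝐆[m] fun y => lam * (w ⋆ₗ w) y) x ≤ (𝐆[m] fun _ => lam * ∫⁻ z, w z) x :=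
        G_mono m (fun y => mul_le_mul' le_rfl (lconv_self_le hw1 y)) x
    _ = lam * ((∫⁻ z, w z) / ENNReal.ofReal m) := by
        rw [yukawa_lconv_const hm, one_div, ENNReal.ofReal_inv_of_pos hm, div_eq_mul_inv]
        ring

/-! ### The `ρ = 1/∫u` identity in `ℝ≥0∞` form -/

section RhoInv

variable {e : ℝ} {u : ℕ → Space → ℝ≥0∞}
variable (he : 0 < e) (hV : Measurable V) (hVfin : ∀ y, V y ≠ ∞) (hVint : ∫⁻ y, V y ≠ ∞)
  (hVpos : ∫⁻ y, V y ≠ 0) {B : ℝ≥0∞} (hB : B ≠ ∞) (hVB : ∀ x, (𝐆[4 * e] V) x ≤ B)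
  (h0 : u 0 = 0) (hs : ∀ n, u (n + 1) = 𝐍[e, V, u n])
include he hV hVfin hVint hVpos hB hVB h0 hs

/-- **`ρ = 1/∫u`** for the limit of the iteration (CJL-I (1.6): `∫u = 1/ρ`), in `ℝ≥0∞`:
integrating the mild equation gives `4e a L = L² + 4e² a²`, i.e. `L = 2e a`.
[cite: CarlenJauslinLieb2020, §2] -/
theorem rho_usol_eq_inv_lintegral :
    ENNReal.ofReal (2 * e) / 𝐋[V, fun x => ⨆ n, u n x] = (∫⁻ x, ⨆ n, u n x)⁻¹ := by
  have hc := four_mul_pos he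
  have hum := usol_measurable he hV hVfin hVint hVpos hB hVB h0 hs
  have hu1 := usol_le_one he hV hVfin hVint hVpos hB hVB h0 hs
  set a := ∫⁻ x, ⨆ n, u n x with ha
  have hafin : a ≠ ∞ := lintegral_usol_ne_top he hV hVfin hVint hVpos hB hVB h0 hs
  have ha0 : a ≠ 0 := lintegral_usol_ne_zero he hV hVfin hVpos hB hVB hs
  set L := 𝐋[V, fun x => ⨆ n, u n x] with hL
  have hL0 : L ≠ 0 := L_usol_ne_zero he hV hVfin hVint hVpos hB hVB h0 hs
  have hLfin : L ≠ ∞ := L_ne_top hVint _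
  set ρ := ENNReal.ofReal (2 * e) / L with hρ
  have hρfin : ρ ≠ ∞ := ENNReal.div_ne_top ENNReal.ofReal_ne_top hL0
  -- integrate the mild equation
  have hm1 : Measurable fun y => V y * (1 - ⨆ n, u n y) := measurable_L_integrand hV hum
  have hΦm : Measurable fun y => V y * (1 - ⨆ n, u n y) +
      ENNReal.ofReal (2 * e) * ρ * ((fun x => ⨆ n, u n x) ⋆ₗ fun x => ⨆ n, u n x) y :=
    hm1.add ((measurable_lconv_self hum).const_mul _)
  have hint : a = ENNReal.ofReal (1 / (4 * e)) * (L + ENNReal.ofReal (2 * e) * ρ * a ^ 2) := by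
    have h1 : ∫⁻ x, (⨆ n, u n x) = ∫⁻ x, (𝐆[4 * e] fun y => V y * (1 - ⨆ n, u n y) +
        ENNReal.ofReal (2 * e) * ρ * ((fun x => ⨆ n, u n x) ⋆ₗ fun x => ⨆ n, u n x) y) x :=
      lintegral_congr fun x => usol_mild he hV hVfin hVint hVpos hB hVB h0 hs x
    calc a = ∫⁻ x, (⨆ n, u n x) := ha
      _ = _ := h1
      _ = ENNReal.ofReal (1 / (4 * e)) * (L + ENNReal.ofReal (2 * e) * ρ * a ^ 2) := by
          rw [lintegral_G hc hΦm, lintegral_add_left hm1, lintegral_const_mul _ (measurable_lconv_self hum),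
            lintegral_lconv_self hum]
  -- to real numbers
  set ar := a.toReal
  set Lr := L.toReal
  have har : 0 < ar := ENNReal.toReal_pos ha0 hafin
  have hLr : 0 < Lr := ENNReal.toReal_pos hL0 hLfin
  have hρr : ρ.toReal = 2 * e / Lr := by rw [hρ, ENNReal.toReal_div, ENNReal.toReal_ofReal (by positivity)]
  have hXfin : ENNReal.ofReal (2 * e) * ρ * a ^ 2 ≠ ∞ :=
    ENNReal.mul_ne_top (ENNReal.mul_ne_top ENNReal.ofReal_ne_top hρfin) (ENNReal.pow_ne_top hafin)
  have hint_r : ar = 1 / (4 * e) * (Lr + 2 * e * (2 * e / Lr) * ar ^ 2) := by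
    have h := congrArg ENNReal.toReal hint
    rw [ENNReal.toReal_mul, ENNReal.toReal_ofReal (by positivity), ENNReal.toReal_add hLfin hXfin,
      ENNReal.toReal_mul, ENNReal.toReal_mul, ENNReal.toReal_ofReal (by positivity), ENNReal.toReal_pow,
      hρr] at h
    exact h
  have hLeq : Lr = 2 * e * ar := by
    have he0 : e ≠ 0 := he.ne'
    have hL0r : Lr ≠ 0 := hLr.ne'
    have h1 : 4 * e * ar * Lr = Lr ^ 2 + 4 * e ^ 2 * ar ^ 2 := by
      have h := hint_r
      field_simp at h
      nlinarith [h]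
    have h2 : (Lr - 2 * e * ar) ^ 2 = 0 := by nlinarith [h1]
    have h3 : Lr - 2 * e * ar = 0 := pow_eq_zero_iff (two_ne_zero) |>.1 h2
    linarith
  -- back to `ℝ≥0∞`
  have hLa : L = ENNReal.ofReal (2 * e) * a := by
    rw [← ENNReal.ofReal_toReal hLfin, ← ENNReal.ofReal_toReal hafin, ← ENNReal.ofReal_mul (by positivity)]
    exact congrArg ENNReal.ofReal hLeq
  rw [hρ, hLa, ← mul_one (ENNReal.ofReal (2 * e)), mul_assoc, one_mul,
    ENNReal.mul_div_mul_left _ _ (ofReal_two_mul_ne_zero he) ENNReal.ofReal_ne_top, one_div]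

end RhoInv

/-! ### E8: `L¹`-continuity of the iterates in the parameter `e` -/

section Family

variable {u : ℝ → ℕ → Space → ℝ≥0∞}
variable (hV : Measurable V) (hVfin : ∀ y, V y ≠ ∞) (hVint : ∫⁻ y, V y ≠ ∞) (hVpos : ∫⁻ y, V y ≠ 0)
  (hGVall : ∀ c : ℝ, 0 < c → ∃ B : ℝ≥0∞, B ≠ ∞ ∧ ∀ x, (𝐆[c] V) x ≤ B)
  (hu0 : ∀ e, u e 0 = 0) (hs : ∀ e n, u e (n + 1) = 𝐍[e, V, u e n])
include hV hVfin hVint hVpos hGVall hu0 hs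

/-- The iteration lemma for the family `u(e)`, `e > 0`: measurability, `u_n ≤ 1`, `(simple17)`,
monotonicity. [cite: CarlenJauslinLieb2020, §2 Lemmas 4–5] -/
theorem fam_props {e : ℝ} (he : 0 < e) (n : ℕ) :
    Measurable (u e n) ∧ (∀ x, u e n x ≤ 1) ∧
      ENNReal.ofReal (2 * e) * ∫⁻ x, u e n x < 𝐋[V, u e n] ∧ u e n ≤ u e (n + 1) := by
  obtain ⟨B, hB, hVB⟩ := hGVall (4 * e) (four_mul_pos he)
  exact iter_props he hV hVfin hVint hVpos hB hVB (hu0 e) (hs e) n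

/-- `∫u_n(e) ≤ ∫𝒱/(2e)` for the family. [cite: CarlenJauslinLieb2020, §2 (proof of Lemma 6)] -/
theorem fam_lintegral_le {e : ℝ} (he : 0 < e) (n : ℕ) : ∫⁻ x, u e n x ≤ (∫⁻ y, V y) / ENNReal.ofReal (2 * e) := by
  obtain ⟨B, hB, hVB⟩ := hGVall (4 * e) (four_mul_pos he)
  exact iter_lintegral_le he hV hVfin hVint hVpos hB hVB (hu0 e) (hs e) n

/-- `∫u_n(e) < ∞` for the family. [cite: CarlenJauslinLieb2020, §2 Lemma 4] -/
theorem fam_lintegral_ne_top {e : ℝ} (he : 0 < e) (n : ℕ) : ∫⁻ x, u e n x ≠ ∞ := by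
  obtain ⟨B, hB, hVB⟩ := hGVall (4 * e) (four_mul_pos he)
  exact iter_lintegral_ne_top he hV hVfin hVint hVpos hB hVB (hu0 e) (hs e) n

/-- `∫𝒱(1 − u_n(e)) > 0` for the family. [cite: CarlenJauslinLieb2020, §2 Lemma 4] -/
theorem fam_L_ne_zero {e : ℝ} (he : 0 < e) (n : ℕ) : 𝐋[V, u e n] ≠ 0 :=
  (lt_of_le_of_lt bot_le (fam_props hV hVfin hVint hVpos hGVall hu0 hs he n).2.2.1).ne'

/-- `ρ_n(e) < ∞` for the family. [cite: CarlenJauslinLieb2020, §2 Lemma 4] -/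
theorem fam_rho_ne_top {e : ℝ} (he : 0 < e) (n : ℕ) : ENNReal.ofReal (2 * e) / 𝐋[V, u e n] ≠ ∞ :=
  ENNReal.div_ne_top ENNReal.ofReal_ne_top (fam_L_ne_zero hV hVfin hVint hVpos hGVall hu0 hs he n)

omit hV hVfin hVint hVpos hGVall hu0 hs in
/-- `e ↦ 2e` is continuous into `ℝ≥0∞` (within `(0,∞)`). [folklore] -/
theorem tendsto_ofReal_two_mul {e₀ : ℝ} :
    Tendsto (fun e : ℝ => ENNReal.ofReal (2 * e)) (𝓝[Ioi 0] e₀) (𝓝 (ENNReal.ofReal (2 * e₀))) :=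
  tendsto_nhdsWithin_of_tendsto_nhds
    ((ENNReal.continuous_ofReal.tendsto _).comp ((continuous_const.mul continuous_id).tendsto e₀))

/-- Continuity of `ρ_n` at `e₀` from `L¹`-continuity of `u_n`. [cite: CarlenJauslinLieb2020, §2] -/
theorem fam_tendsto_rho_of_D (n : ℕ) {e₀ : ℝ} (he₀ : 0 < e₀)
    (hD : Tendsto (fun e => (∫⁻ x, (u e n x - u e₀ n x)) + ∫⁻ x, (u e₀ n x - u e n x))
      (𝓝[Ioi 0] e₀) (𝓝 0)) :
    Tendsto (fun e => ENNReal.ofReal (2 * e) / 𝐋[V, u e n]) (𝓝[Ioi 0] e₀)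
      (𝓝 (ENNReal.ofReal (2 * e₀) / 𝐋[V, u e₀ n])) := by
  have hprops := fun {e : ℝ} (he : 0 < e) => fam_props hV hVfin hVint hVpos hGVall hu0 hs he n
  have hw : ∀ᶠ e in 𝓝[Ioi 0] e₀, Measurable (u e n) ∧ ∀ x, u e n x ≤ 1 := by
    filter_upwards [self_mem_nhdsWithin] with e he
    exact ⟨(hprops he).1, (hprops he).2.1⟩
  have hL := tendsto_L hV hVfin hVint hw (hprops he₀).1 (hprops he₀).2.1 hD
  exact ENNReal.Tendsto.div tendsto_ofReal_two_mul (Or.inl (ofReal_two_mul_ne_zero he₀)) hL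
    (Or.inl (L_ne_top hVint _))

/-- **`L¹`-continuity of `e ↦ u_n(e)`** (the heart of CJL-I Lemma 8: `u_n(x,e)` depends continuously
on `e`), by induction on `n` from the `L¹` bounds `‖K_c f − K_{c'} f‖₁ ≤ |c−c'|‖f‖₁/(cc')`,
`‖K f − K f'‖₁ ≤ ‖f − f'‖₁/c`, `‖u⋆u − v⋆v‖₁ ≤ ‖u−v‖₁(‖u−v‖₁ + 2‖v‖₁)`, `∫V|u−v| → 0`.
[cite: CarlenJauslinLieb2020, §2] -/
theorem fam_tendsto_D (n : ℕ) : ∀ {e₀ : ℝ}, 0 < e₀ →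
    Tendsto (fun e => (∫⁻ x, (u e n x - u e₀ n x)) + ∫⁻ x, (u e₀ n x - u e n x))
      (𝓝[Ioi 0] e₀) (𝓝 0) := by
  induction n with
  | zero =>
    intro e₀ _
    simp only [hu0, Pi.zero_apply, tsub_zero, lintegral_zero, add_zero]
    exact tendsto_const_nhds
  | succ n ih =>
    intro e₀ he₀
    have hD := ih he₀
    set l : Filter ℝ := 𝓝[Ioi 0] e₀ with hl
    have hprops := fun {e : ℝ} (he : 0 < e) => fam_props hV hVfin hVint hVpos hGVall hu0 hs he n
    -- data at e₀
    have hm₀ : Measurable (u e₀ n) := (hprops he₀).1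
    have h1₀ : ∀ x, u e₀ n x ≤ 1 := (hprops he₀).2.1
    set I₀ := ∫⁻ x, u e₀ n x with hI₀
    have hI₀fin : I₀ ≠ ∞ := fam_lintegral_ne_top hV hVfin hVint hVpos hGVall hu0 hs he₀ n
    set L₀ := 𝐋[V, u e₀ n] with hL₀
    have hL₀0 : L₀ ≠ 0 := fam_L_ne_zero hV hVfin hVint hVpos hGVall hu0 hs he₀ n
    have hL₀fin : L₀ ≠ ∞ := L_ne_top hVint _
    set ρ₀ := ENNReal.ofReal (2 * e₀) / L₀ with hρ₀
    have hρ₀fin : ρ₀ ≠ ∞ := ENNReal.div_ne_top ENNReal.ofReal_ne_top hL₀0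
    set lam₀ := ENNReal.ofReal (2 * e₀) * ρ₀ with hlam₀
    have hlam₀fin : lam₀ ≠ ∞ := ENNReal.mul_ne_top ENNReal.ofReal_ne_top hρ₀fin
    -- uniform bounds on (e₀/2, ∞)
    obtain ⟨B₀, hB₀, hVB₀⟩ := hGVall (2 * e₀) (by positivity)
    set M := (∫⁻ y, V y) / ENNReal.ofReal e₀ with hM
    have hMfin : M ≠ ∞ := ENNReal.div_ne_top hVint (by simpa using he₀)
    have hev_pos : ∀ᶠ e in l, 0 < e := self_mem_nhdsWithin
    have hev_half : ∀ᶠ e in l, e₀ / 2 < e :=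
      mem_nhdsWithin_of_mem_nhds (Ioi_mem_nhds (by linarith))
    -- notation for the parameter-dependent quantities
    set lam : ℝ → ℝ≥0∞ := fun e => ENNReal.ofReal (2 * e) * (ENNReal.ofReal (2 * e) / 𝐋[V, u e n]) with hlam
    set D : ℝ → ℝ≥0∞ := fun e => (∫⁻ x, (u e n x - u e₀ n x)) + ∫⁻ x, (u e₀ n x - u e n x) with hDdef
    -- convergences
    have Tρ := fam_tendsto_rho_of_D hV hVfin hVint hVpos hGVall hu0 hs n he₀ hD
    have Tlam : Tendsto lam l (𝓝 lam₀) :=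
      ENNReal.Tendsto.mul tendsto_ofReal_two_mul (Or.inr hρ₀fin) Tρ (Or.inr ENNReal.ofReal_ne_top)
    have Tparam : Tendsto (fun e : ℝ => ENNReal.ofReal |4 * e₀ - 4 * e|) l (𝓝 0) := by
      have hc : Continuous fun e : ℝ => ENNReal.ofReal |4 * e₀ - 4 * e| :=
        ENNReal.continuous_ofReal.comp ((continuous_const.sub (continuous_const.mul continuous_id)).abs)
      have := hc.tendsto e₀
      simp only [sub_self, abs_zero, ENNReal.ofReal_zero] at this
      exact tendsto_nhdsWithin_of_tendsto_nhds this
    have TD2 : Tendsto (fun e => D e ^ 2) l (𝓝 0) := by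
      have := ((ENNReal.continuous_pow 2).tendsto 0).comp hD
      rwa [zero_pow two_ne_zero] at this
    -- the majorant
    set R : ℝ → ℝ≥0∞ := fun e =>
      ENNReal.ofReal |4 * e₀ - 4 * e| * (ENNReal.ofReal (1 / (2 * e₀)) * (ENNReal.ofReal (1 / (4 * e₀)) *
        ((∫⁻ y, V y) + lam e * M ^ 2))) +
      ENNReal.ofReal (1 / (4 * e₀)) *
        (((lam e - lam₀) * M ^ 2 + lam₀ * (D e ^ 2 + 2 * (D e * I₀))) +
         ((lam₀ - lam e) * I₀ ^ 2 + lam e * (D e ^ 2 + 2 * (D e * M)))) with hR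
    have TR : Tendsto R l (𝓝 0) := by
      have T1 : Tendsto (fun e => ENNReal.ofReal |4 * e₀ - 4 * e| * (ENNReal.ofReal (1 / (2 * e₀)) *
          (ENNReal.ofReal (1 / (4 * e₀)) * ((∫⁻ y, V y) + lam e * M ^ 2)))) l (𝓝 0) := by
        have Tin : Tendsto (fun e => ENNReal.ofReal (1 / (2 * e₀)) * (ENNReal.ofReal (1 / (4 * e₀)) *
            ((∫⁻ y, V y) + lam e * M ^ 2))) l
            (𝓝 (ENNReal.ofReal (1 / (2 * e₀)) * (ENNReal.ofReal (1 / (4 * e₀)) * ((∫⁻ y, V y) + lam₀ * M ^ 2)))) := by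
          refine ENNReal.Tendsto.const_mul ?_ (Or.inr ENNReal.ofReal_ne_top)
          refine ENNReal.Tendsto.const_mul ?_ (Or.inr ENNReal.ofReal_ne_top)
          exact tendsto_const_nhds.add (ENNReal.Tendsto.mul_const Tlam (Or.inr (ENNReal.pow_ne_top (n := 2) hMfin)))
        have hfin : ENNReal.ofReal (1 / (2 * e₀)) * (ENNReal.ofReal (1 / (4 * e₀)) * ((∫⁻ y, V y) + lam₀ * M ^ 2)) ≠ ∞ :=
          ENNReal.mul_ne_top ENNReal.ofReal_ne_top (ENNReal.mul_ne_top ENNReal.ofReal_ne_top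
            (ENNReal.add_ne_top.2 ⟨hVint, ENNReal.mul_ne_top hlam₀fin (ENNReal.pow_ne_top hMfin)⟩))
        have := ENNReal.Tendsto.mul Tparam (Or.inr hfin) Tin (Or.inr ENNReal.zero_ne_top)
        rwa [zero_mul] at this
      have T2 : Tendsto (fun e => (lam e - lam₀) * M ^ 2) l (𝓝 0) := by
        have h := ENNReal.Tendsto.sub Tlam (tendsto_const_nhds (x := lam₀)) (Or.inl hlam₀fin)
        rw [tsub_self] at h
        have := ENNReal.Tendsto.mul_const h (Or.inr (ENNReal.pow_ne_top (n := 2) hMfin))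
        rwa [zero_mul] at this
      have Tinner : ∀ {C : ℝ≥0∞}, C ≠ ∞ → Tendsto (fun e => D e ^ 2 + 2 * (D e * C)) l (𝓝 0) := by
        intro C hC
        have h1 : Tendsto (fun e => D e * C) l (𝓝 0) := by
          have := ENNReal.Tendsto.mul_const hD (Or.inr hC)
          rwa [zero_mul] at this
        have h2 : Tendsto (fun e => 2 * (D e * C)) l (𝓝 0) := by
          have := ENNReal.Tendsto.const_mul h1 (Or.inr (ENNReal.ofNat_ne_top (n := 2)))
          rwa [mul_zero] at this
        have := TD2.add h2
        rwa [add_zero] at this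
      have T3 : Tendsto (fun e => lam₀ * (D e ^ 2 + 2 * (D e * I₀))) l (𝓝 0) := by
        have := ENNReal.Tendsto.const_mul (Tinner hI₀fin) (Or.inr hlam₀fin)
        rwa [mul_zero] at this
      have T4 : Tendsto (fun e => (lam₀ - lam e) * I₀ ^ 2) l (𝓝 0) := by
        have h := ENNReal.Tendsto.sub (tendsto_const_nhds (x := lam₀)) Tlam (Or.inl hlam₀fin)
        rw [tsub_self] at h
        have := ENNReal.Tendsto.mul_const h (Or.inr (ENNReal.pow_ne_top (n := 2) hI₀fin))
        rwa [zero_mul] at this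
      have T5 : Tendsto (fun e => lam e * (D e ^ 2 + 2 * (D e * M))) l (𝓝 0) := by
        have := ENNReal.Tendsto.mul Tlam (Or.inr ENNReal.zero_ne_top) (Tinner hMfin) (Or.inr hlam₀fin)
        rwa [mul_zero] at this
      have T6 : Tendsto (fun e => ENNReal.ofReal (1 / (4 * e₀)) *
          (((lam e - lam₀) * M ^ 2 + lam₀ * (D e ^ 2 + 2 * (D e * I₀))) +
           ((lam₀ - lam e) * I₀ ^ 2 + lam e * (D e ^ 2 + 2 * (D e * M))))) l (𝓝 0) := by
        have h := (T2.add T3).add (T4.add T5)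
        simp only [add_zero] at h
        have := ENNReal.Tendsto.const_mul (a := ENNReal.ofReal (1 / (4 * e₀))) h (Or.inr ENNReal.ofReal_ne_top)
        rwa [mul_zero] at this
      have := T1.add T6
      rwa [add_zero] at this
    -- the eventual bound D_{n+1} ≤ R
    have hbound : ∀ᶠ e in l,
        (∫⁻ x, (u e (n + 1) x - u e₀ (n + 1) x)) + ∫⁻ x, (u e₀ (n + 1) x - u e (n + 1) x) ≤ R e := by
      filter_upwards [hev_pos, hev_half] with e he heh
      have hm : Measurable (u e n) := (hprops he).1
      have h1 : ∀ x, u e n x ≤ 1 := (hprops he).2.1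
      have hc : 0 < 4 * e := four_mul_pos he
      have hc₀ : 0 < 4 * e₀ := four_mul_pos he₀
      have hmin : 2 * e₀ ≤ min (4 * e) (4 * e₀) := le_min (by linarith) (by linarith)
      -- finiteness of the parameter-dependent scalars at e
      have hLe0 : 𝐋[V, u e n] ≠ 0 := fam_L_ne_zero hV hVfin hVint hVpos hGVall hu0 hs he n
      have hlamfin : lam e ≠ ∞ :=
        ENNReal.mul_ne_top ENNReal.ofReal_ne_top (ENNReal.div_ne_top ENNReal.ofReal_ne_top hLe0)
      have hIe : ∫⁻ x, u e n x ≤ M := by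
        refine (fam_lintegral_le hV hVfin hVint hVpos hGVall hu0 hs he n).trans ?_
        exact ENNReal.div_le_div_left (ENNReal.ofReal_le_ofReal (by linarith)) _
      have hIefin : ∫⁻ x, u e n x ≠ ∞ := ne_top_of_le_ne_top hMfin hIe
      -- the data
      set φ : Space → ℝ≥0∞ := fun y => V y + lam e * (u e n ⋆ₗ u e n) y with hφ
      set φ₀ : Space → ℝ≥0∞ := fun y => V y + lam₀ * (u e₀ n ⋆ₗ u e₀ n) y with hφ₀
      have hφm : Measurable φ := hV.add ((measurable_lconv_self hm).const_mul _)
      have hφ₀m : Measurable φ₀ := hV.add ((measurable_lconv_self hm₀).const_mul _)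
      have hue : u e (n + 1) = kRes (4 * e) V φ := by rw [hs e n]
      have hue₀ : u e₀ (n + 1) = kRes (4 * e₀) V φ₀ := by rw [hs e₀ n]
      -- bounds on G of the data at the parameter min(4e, 4e₀) ≥ 2e₀
      have hGVmin : ∀ x, (𝐆[min (4 * e) (4 * e₀)] V) x ≠ ∞ := fun x =>
        ne_top_of_le_ne_top hB₀ ((G_anti hmin V x).trans (hVB₀ x))
      have hφB : ∀ x, (𝐆[min (4 * e) (4 * e₀)] φ) x ≤ B₀ + lam e * (M / ENNReal.ofReal (2 * e₀)) := by
        intro x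
        refine (G_anti hmin φ x).trans ((G_data_le' (by positivity) hV hVB₀ h1 (lam e) x).trans ?_)
        exact add_le_add le_rfl (mul_le_mul' le_rfl (ENNReal.div_le_div_right hIe _))
      have hφBfin : B₀ + lam e * (M / ENNReal.ofReal (2 * e₀)) ≠ ∞ :=
        ENNReal.add_ne_top.2 ⟨hB₀, ENNReal.mul_ne_top hlamfin (ENNReal.div_ne_top hMfin (by simpa using he₀))⟩
      -- (i) the parameter difference
      have hpar := lintegral_kRes_param_dist_le hc hc₀ hV hVfin hGVmin hφm hφBfin hφB
      -- (ii) the data differences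
      have hdat1 := lintegral_kRes_tsub_le hc₀ hV hφm hφ₀m
      have hdat2 := lintegral_kRes_tsub_le hc₀ hV hφ₀m hφm
      -- (iii) triangle inequalities
      have hK1 : Measurable (kRes (4 * e) V φ) := measurable_kRes hV hφm
      have hK2 : Measurable (kRes (4 * e₀) V φ) := measurable_kRes hV hφm
      have hK3 : Measurable (kRes (4 * e₀) V φ₀) := measurable_kRes hV hφ₀m
      have hd12 : Measurable fun x => kRes (4 * e) V φ x - kRes (4 * e₀) V φ x := hK1.sub hK2
      have hd32 : Measurable fun x => kRes (4 * e₀) V φ₀ x - kRes (4 * e₀) V φ x := hK3.sub hK2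
      have htri1 : ∫⁻ x, (kRes (4 * e) V φ x - kRes (4 * e₀) V φ₀ x) ≤
          (∫⁻ x, (kRes (4 * e) V φ x - kRes (4 * e₀) V φ x)) +
            ∫⁻ x, (kRes (4 * e₀) V φ x - kRes (4 * e₀) V φ₀ x) := by
        rw [← lintegral_add_left hd12]
        exact lintegral_mono fun x => tsub_le_tsub_add_tsub
      have htri2 : ∫⁻ x, (kRes (4 * e₀) V φ₀ x - kRes (4 * e) V φ x) ≤
          (∫⁻ x, (kRes (4 * e₀) V φ₀ x - kRes (4 * e₀) V φ x)) +
            ∫⁻ x, (kRes (4 * e₀) V φ x - kRes (4 * e) V φ x) := by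
        rw [← lintegral_add_left hd32]
        exact lintegral_mono fun x => tsub_le_tsub_add_tsub
      -- (iv) bounds on the ingredients
      have hIφ : ∫⁻ y, φ y ≤ (∫⁻ y, V y) + lam e * M ^ 2 := by
        rw [hφ, lintegral_add_left hV, lintegral_const_mul _ (measurable_lconv_self hm), lintegral_lconv_self hm]
        exact add_le_add le_rfl (mul_le_mul' le_rfl (pow_le_pow_left' hIe 2))
      have hce : ENNReal.ofReal (1 / (4 * e)) ≤ ENNReal.ofReal (1 / (2 * e₀)) :=
        ENNReal.ofReal_le_ofReal (one_div_le_one_div_of_le (by positivity) (by linarith))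
      have hg1 := lintegral_lconv_self_tsub_le hm hm₀
      have hg2 := lintegral_lconv_self_tsub_le hm₀ hm
      have hD1 : ∫⁻ x, (u e n x - u e₀ n x) ≤ D e := le_self_add
      have hD2 : ∫⁻ x, (u e₀ n x - u e n x) ≤ D e := le_add_self
      have hX : ∫⁻ y, (φ y - φ₀ y) ≤ (lam e - lam₀) * M ^ 2 + lam₀ * (D e ^ 2 + 2 * (D e * I₀)) := by
        refine (lintegral_data_tsub_le V (measurable_lconv_self hm) (measurable_lconv_self hm₀)).trans ?_
        refine add_le_add ?_ (mul_le_mul' le_rfl (hg1.trans ?_))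
        · rw [lintegral_lconv_self hm]
          exact mul_le_mul' le_rfl (pow_le_pow_left' hIe 2)
        · exact add_le_add (pow_le_pow_left' hD1 2) (mul_le_mul' le_rfl (mul_le_mul' hD1 le_rfl))
      have hY : ∫⁻ y, (φ₀ y - φ y) ≤ (lam₀ - lam e) * I₀ ^ 2 + lam e * (D e ^ 2 + 2 * (D e * M)) := by
        refine (lintegral_data_tsub_le V (measurable_lconv_self hm₀) (measurable_lconv_self hm)).trans ?_
        refine add_le_add ?_ (mul_le_mul' le_rfl (hg2.trans ?_))
        · rw [lintegral_lconv_self hm₀]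
        · exact add_le_add (pow_le_pow_left' hD2 2) (mul_le_mul' le_rfl (mul_le_mul' hD2 hIe))
      -- assemble
      rw [hue, hue₀]
      calc (∫⁻ x, (kRes (4 * e) V φ x - kRes (4 * e₀) V φ₀ x)) +
            ∫⁻ x, (kRes (4 * e₀) V φ₀ x - kRes (4 * e) V φ x)
          ≤ ((∫⁻ x, (kRes (4 * e) V φ x - kRes (4 * e₀) V φ x)) +
              ∫⁻ x, (kRes (4 * e₀) V φ x - kRes (4 * e₀) V φ₀ x)) +
            ((∫⁻ x, (kRes (4 * e₀) V φ₀ x - kRes (4 * e₀) V φ x)) +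
              ∫⁻ x, (kRes (4 * e₀) V φ x - kRes (4 * e) V φ x)) := add_le_add htri1 htri2
        _ = ((∫⁻ x, (kRes (4 * e) V φ x - kRes (4 * e₀) V φ x)) +
              ∫⁻ x, (kRes (4 * e₀) V φ x - kRes (4 * e) V φ x)) +
            ((∫⁻ x, (kRes (4 * e₀) V φ x - kRes (4 * e₀) V φ₀ x)) +
              ∫⁻ x, (kRes (4 * e₀) V φ₀ x - kRes (4 * e₀) V φ x)) := by ring
        _ ≤ ENNReal.ofReal |4 * e₀ - 4 * e| * (ENNReal.ofReal (1 / (4 * e)) *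
              (ENNReal.ofReal (1 / (4 * e₀)) * ∫⁻ y, φ y)) +
            ((ENNReal.ofReal (1 / (4 * e₀)) * ∫⁻ y, (φ y - φ₀ y)) +
              ENNReal.ofReal (1 / (4 * e₀)) * ∫⁻ y, (φ₀ y - φ y)) := add_le_add hpar (add_le_add hdat1 hdat2)
        _ ≤ R e := by
            rw [hR]
            refine add_le_add ?_ ?_
            · exact mul_le_mul' le_rfl (mul_le_mul' hce (mul_le_mul' le_rfl hIφ))
            · rw [← mul_add]
              exact mul_le_mul' le_rfl (add_le_add hX hY)
    exact tendsto_of_tendsto_of_tendsto_of_le_of_le' tendsto_const_nhds TR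
      (Eventually.of_forall fun _ => bot_le) hbound

/-- Continuity of `e ↦ ∫u_n(e)` and of `e ↦ ρ_n(e)` on `(0, ∞)`.
[cite: CarlenJauslinLieb2020, §2] -/
theorem fam_tendsto_lintegral (n : ℕ) {e₀ : ℝ} (he₀ : 0 < e₀) :
    Tendsto (fun e => ∫⁻ x, u e n x) (𝓝[Ioi 0] e₀) (𝓝 (∫⁻ x, u e₀ n x)) := by
  have hprops := fun {e : ℝ} (he : 0 < e) => fam_props hV hVfin hVint hVpos hGVall hu0 hs he n
  have hw : ∀ᶠ e in 𝓝[Ioi 0] e₀, Measurable (u e n) := by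
    filter_upwards [self_mem_nhdsWithin] with e he
    exact (hprops he).1
  exact tendsto_lintegral_of_D hw (hprops he₀).1
    (fam_lintegral_ne_top hV hVfin hVint hVpos hGVall hu0 hs he₀ n)
    (fam_tendsto_D hV hVfin hVint hVpos hGVall hu0 hs n he₀)

/-- **`e ↦ ρ_n(e)` is continuous on `(0,∞)`** (CJL-I proof of Lemma 8: "the continuity of `ρ_n(e)`
for each `n`"). [cite: CarlenJauslinLieb2020, §2 (proof of Lemma 8)] -/
theorem fam_tendsto_rho (n : ℕ) {e₀ : ℝ} (he₀ : 0 < e₀) :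
    Tendsto (fun e => ENNReal.ofReal (2 * e) / 𝐋[V, u e n]) (𝓝[Ioi 0] e₀)
      (𝓝 (ENNReal.ofReal (2 * e₀) / 𝐋[V, u e₀ n])) :=
  fam_tendsto_rho_of_D hV hVfin hVint hVpos hGVall hu0 hs n he₀
    (fam_tendsto_D hV hVfin hVint hVpos hGVall hu0 hs n he₀)

/-- For `e > 0`: `ρ(e) = ⨆ₙ ρ_n(e) = (∫ u(e))⁻¹` and it is finite and positive.
[cite: CarlenJauslinLieb2020, §2] -/
theorem fam_rho_eq_inv {e : ℝ} (he : 0 < e) :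
    (⨆ n, ENNReal.ofReal (2 * e) / 𝐋[V, u e n]) = (∫⁻ x, ⨆ n, u e n x)⁻¹ := by
  obtain ⟨B, hB, hVB⟩ := hGVall (4 * e) (four_mul_pos he)
  rw [rho_usol he hV hVfin hVint hVpos hB hVB (hu0 e) (hs e)]
  exact rho_usol_eq_inv_lintegral he hV hVfin hVint hVpos hB hVB (hu0 e) (hs e)

/-- `ρ(e) < ∞` for the family (`e > 0`). [cite: CarlenJauslinLieb2020, §2 Lemma 6] -/
theorem fam_rho_ne_top' {e : ℝ} (he : 0 < e) : (⨆ n, ENNReal.ofReal (2 * e) / 𝐋[V, u e n]) ≠ ∞ := by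
  obtain ⟨B, hB, hVB⟩ := hGVall (4 * e) (four_mul_pos he)
  rw [rho_usol he hV hVfin hVint hVpos hB hVB (hu0 e) (hs e)]
  exact rho_usol_ne_top he hV hVfin hVint hVpos hB hVB (hu0 e) (hs e)

/-- **CJL-I Lemma 8, first part: `e ↦ ρ(e)` is continuous on `(0, ∞)`.** `ρ = sup ρ_n` with `ρ_n`
continuous gives lower semicontinuity; `1/ρ = ∫u = sup ∫u_n` with `∫u_n` continuous gives upper
semicontinuity. [cite: CarlenJauslinLieb2020, §2] -/
theorem fam_continuousOn_rho :
    ContinuousOn (fun e => (⨆ n, ENNReal.ofReal (2 * e) / 𝐋[V, u e n]).toReal) (Ioi 0) := by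
  intro e₀ he₀
  have he₀' : 0 < e₀ := he₀
  set ρf : ℝ → ℝ≥0∞ := fun e => ⨆ n, ENNReal.ofReal (2 * e) / 𝐋[V, u e n] with hρf
  have hfin : ρf e₀ ≠ ∞ := fam_rho_ne_top' hV hVfin hVint hVpos hGVall hu0 hs he₀'
  suffices T : Tendsto ρf (𝓝[Ioi 0] e₀) (𝓝 (ρf e₀)) from (ENNReal.tendsto_toReal hfin).comp T
  rw [tendsto_order]
  constructor
  · intro a ha
    obtain ⟨n, hn⟩ := lt_iSup_iff.1 ha
    have hT := fam_tendsto_rho hV hVfin hVint hVpos hGVall hu0 hs n he₀'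
    filter_upwards [hT.eventually_const_lt hn] with e he
    exact he.trans_le (le_iSup (fun n => ENNReal.ofReal (2 * e) / 𝐋[V, u e n]) n)
  · intro b hb
    -- b⁻¹ < (ρ e₀)⁻¹ = ∫ u(e₀) = ⨆ ∫ u_n(e₀)
    have hb' : b⁻¹ < ∫⁻ x, ⨆ n, u e₀ n x := by
      have h := ENNReal.inv_lt_inv.2 hb
      rwa [show ρf e₀ = (∫⁻ x, ⨆ n, u e₀ n x)⁻¹ from
        fam_rho_eq_inv hV hVfin hVint hVpos hGVall hu0 hs he₀', inv_inv] at h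
    obtain ⟨B, hB, hVB⟩ := hGVall (4 * e₀) (four_mul_pos he₀')
    rw [lintegral_usol he₀' hV hVfin hVint hVpos hB hVB (hu0 e₀) (hs e₀)] at hb'
    obtain ⟨n, hn⟩ := lt_iSup_iff.1 hb'
    have hT := fam_tendsto_lintegral hV hVfin hVint hVpos hGVall hu0 hs n he₀'
    filter_upwards [hT.eventually_const_lt hn, self_mem_nhdsWithin] with e he hepos
    have hepos' : 0 < e := hepos
    have h1 : b⁻¹ < ∫⁻ x, ⨆ n, u e n x :=
      he.trans_le (lintegral_mono fun x => le_iSup (fun n => u e n x) n)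
    rw [show ρf e = (∫⁻ x, ⨆ n, u e n x)⁻¹ from fam_rho_eq_inv hV hVfin hVint hVpos hGVall hu0 hs hepos',
      ← inv_inv b, ENNReal.inv_lt_inv]
    exact h1

end Family

end LayerE

section LayerF

variable {V : Space → ℝ≥0∞}

/-! ### The first iterate `u₁ = K_{4e} V` -/

/-- The first iterate is `u₁ = K_{4e} V` (`u₀ = 0`, `0 ⋆ 0 = 0`; CJL-I (1.17), §2).
[cite: CarlenJauslinLieb2020, (1.17)] -/
theorem next_zero (e : ℝ) (V : Space → ℝ≥0∞) : 𝐍[e, V, (0 : Space → ℝ≥0∞)] = kRes (4 * e) V V := by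
  congr 1
  funext y
  simp

/-- `K V ≤ 1`. [cite: CarlenJauslinLieb2020, §2] -/
theorem kRes_pot_le_one {c : ℝ} (hc : 0 < c) (hV : Measurable V) (hVfin : ∀ y, V y ≠ ∞)
    (hGV : ∀ x, (𝐆[c] V) x ≠ ∞) (x : Space) : kRes c V V x ≤ 1 :=
  (le_self_add).trans (kRes_potential_identity hc hV hVfin hGV x).le

/-- `c ∫ K V = ∫ V(1 − K V)` (integrating the resolvent equation).
[cite: CarlenJauslinLieb2020, §2] -/
theorem lintegral_kRes_pot {c : ℝ} (hc : 0 < c) (hV : Measurable V)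
    (hVfin : ∀ y, V y ≠ ∞) (hVint : ∫⁻ y, V y ≠ ∞) {B : ℝ≥0∞} (hB : B ≠ ∞) (hVB : ∀ x, (𝐆[c] V) x ≤ B) :
    ENNReal.ofReal c * ∫⁻ x, kRes c V V x = 𝐋[V, kRes c V V] := by
  have hGV : ∀ x, (𝐆[c] V) x ≠ ∞ := fun x => ne_top_of_le_ne_top hB (hVB x)
  have hKm : Measurable (kRes c V V) := measurable_kRes hV hV
  have hK1 : ∀ x, kRes c V V x ≤ 1 := kRes_pot_le_one hc hV hVfin hGV
  have hres := kRes_resolvent_eq hc hV hVfin hGV hV hB hVB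
  have hVK : Measurable fun y => V y * kRes c V V y := hV.mul hKm
  set a := ∫⁻ x, kRes c V V x with ha
  set J := ∫⁻ y, V y * kRes c V V y with hJ
  have hJle : J ≤ ∫⁻ y, V y := lintegral_mono fun y => mul_le_of_le_one_right' (hK1 y)
  have hJfin : J ≠ ∞ := ne_top_of_le_ne_top hVint hJle
  have hint : a + ENNReal.ofReal (1 / c) * J = ENNReal.ofReal (1 / c) * ∫⁻ y, V y := by
    have h1 : ∫⁻ x, (kRes c V V x + (𝐆[c] fun y => V y * kRes c V V y) x) = ∫⁻ x, (𝐆[c] V) x :=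
      lintegral_congr fun x => hres x
    rw [lintegral_add_left hKm, lintegral_G hc hVK, lintegral_G hc hV] at h1
    exact h1
  have hc0' : ENNReal.ofReal c ≠ 0 := by simpa using hc
  have hinv : ENNReal.ofReal c * ENNReal.ofReal (1 / c) = 1 := by
    rw [← ENNReal.ofReal_mul hc.le, mul_one_div_cancel hc.ne', ENNReal.ofReal_one]
  have h2 : ENNReal.ofReal c * a + J = ∫⁻ y, V y := by
    have := congrArg (fun t => ENNReal.ofReal c * t) hint
    simp only [mul_add, ← mul_assoc, hinv, one_mul] at this
    exact this
  rw [L_eq_sub hV hVfin hVint hKm hK1]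
  exact ENNReal.eq_sub_of_add_eq hJfin h2

/-- The mild form for `K V`: `K V = G_c(V(1 − K V))`. [cite: CarlenJauslinLieb2020, §2] -/
theorem kRes_pot_mild {c : ℝ} (hc : 0 < c) (hV : Measurable V) (hVfin : ∀ y, V y ≠ ∞)
    {B : ℝ≥0∞} (hB : B ≠ ∞) (hVB : ∀ x, (𝐆[c] V) x ≤ B) (x : Space) :
    kRes c V V x = (𝐆[c] fun y => V y * (1 - kRes c V V y)) x := by
  have hGV : ∀ x, (𝐆[c] V) x ≠ ∞ := fun x => ne_top_of_le_ne_top hB (hVB x)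
  have hKm : Measurable (kRes c V V) := measurable_kRes hV hV
  have hK1 : ∀ x, kRes c V V x ≤ 1 := kRes_pot_le_one hc hV hVfin hGV
  have hres := kRes_resolvent_eq hc hV hVfin hGV hV hB hVB x
  have hm1 : Measurable fun y => V y * (1 - kRes c V V y) := measurable_L_integrand hV hKm
  have hsplit : (𝐆[c] V) x = (𝐆[c] fun y => V y * (1 - kRes c V V y)) x +
      (𝐆[c] fun y => V y * kRes c V V y) x := by
    rw [← G_add c hm1]
    congr 1
    funext y
    rw [← mul_add, tsub_add_cancel_of_le (hK1 y), mul_one]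
  have hfin : (𝐆[c] fun y => V y * kRes c V V y) x ≠ ∞ :=
    ne_top_of_le_ne_top (hGV x) (G_mono c (fun y => mul_le_of_le_one_right' (hK1 y)) x)
  rw [hsplit] at hres
  exact (ENNReal.add_left_inj hfin).1 hres

/-! ### The low-energy obstruction: `inf_e ∫V(1 − K_{4e}V) > 0` -/

/-- **`ℓ := ∫V(1 − φ) > 0` for `φ = supₖ K_{4/(k+1)} V`** (replaces the false bound (con4B) in
the printed proof of `lim_{e→0} ρ(e) = 0`): otherwise `K_k = G_{c_k}(V(1 − K_k)) ≤ G_0(V(1 − K_k)) ↓ 0`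
forces `φ = 0` and `V = 0` a.e. Needs the Newton potential `G_0 V` to be finite.
[cite: CarlenJauslinLieb2020, §2] -/
theorem lowEnergy_L_ne_zero (hV : Measurable V) (hVfin : ∀ y, V y ≠ ∞) (hVpos : ∫⁻ y, V y ≠ 0)
    (hGVall : ∀ c : ℝ, 0 < c → ∃ B : ℝ≥0∞, B ≠ ∞ ∧ ∀ x, (𝐆[c] V) x ≤ B)
    (hG0 : ∀ x, (𝐆[0] V) x ≠ ∞) :
    𝐋[V, fun x => ⨆ k : ℕ, kRes (4 / ((k : ℝ) + 1)) V V x] ≠ 0 := by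
  set c : ℕ → ℝ := fun k => 4 / ((k : ℝ) + 1) with hcdef
  have hcpos : ∀ k, 0 < c k := fun k => by rw [hcdef]; positivity
  have hcanti : ∀ {k k' : ℕ}, k ≤ k' → c k' ≤ c k := fun {k k'} h => by
    simp only [hcdef]
    exact div_le_div_of_nonneg_left (by norm_num) (by positivity) (by exact_mod_cast Nat.succ_le_succ h)
  set K : ℕ → Space → ℝ≥0∞ := fun k => kRes (c k) V V with hK
  have hKm : ∀ k, Measurable (K k) := fun k => measurable_kRes hV hV
  have hKmono : Monotone K := fun k k' h => kRes_anti_c (hcanti h) V V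
  have hK1 : ∀ k x, K k x ≤ 1 := fun k x => by
    obtain ⟨B, hB, hVB⟩ := hGVall (c k) (hcpos k)
    exact kRes_pot_le_one (hcpos k) hV hVfin (fun x => ne_top_of_le_ne_top hB (hVB x)) x
  have hmild : ∀ k x, K k x ≤ (𝐆[0] fun y => V y * (1 - K k y)) x := fun k x => by
    obtain ⟨B, hB, hVB⟩ := hGVall (c k) (hcpos k)
    rw [hK]
    simp only []
    rw [kRes_pot_mild (hcpos k) hV hVfin hB hVB x]
    exact G_anti (hcpos k).le _ x
  intro hℓ
  -- V(1 − φ) = 0 a.e.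
  have hφm : Measurable fun x => ⨆ k, K k x := Measurable.iSup hKm
  have hae : (fun z => V z * (1 - ⨆ k, K k z)) =ᵐ[volume] 0 :=
    (lintegral_eq_zero_iff (measurable_L_integrand hV hφm)).1 hℓ
  -- g_k x := G_0(V(1 − K_k)) x decreases to 0
  have hg_lim : ∀ x, ⨅ k, (𝐆[0] fun y => V y * (1 - K k y)) x = 0 := by
    intro x
    simp only [lconvolution_def]
    have hmeas : ∀ k, Measurable fun y => (ENNReal.ofReal ∘ yukawa 0) y * (V (-y + x) * (1 - K k (-y + x))) :=
      fun k => (measurable_ofReal_yukawa 0).mul ((measurable_L_integrand hV (hKm k)).comp (by fun_prop))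
    have hanti : Antitone fun k => fun y => (ENNReal.ofReal ∘ yukawa 0) y * (V (-y + x) * (1 - K k (-y + x))) :=
      fun k k' h y => mul_le_mul' le_rfl (mul_le_mul' le_rfl (tsub_le_tsub_left (hKmono h _) _))
    have hfin : ∫⁻ y, (ENNReal.ofReal ∘ yukawa 0) y * (V (-y + x) * (1 - K 0 (-y + x))) ≠ ∞ := by
      refine ne_top_of_le_ne_top (hG0 x) ?_
      rw [lconvolution_def]
      exact lintegral_mono fun y => mul_le_mul' le_rfl (mul_le_of_le_one_right' tsub_le_self)
    rw [← lintegral_iInf hmeas hanti hfin]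
    -- the pointwise infimum is Y_0 · (V(1 − φ)) ∘ shift, which vanishes a.e.
    have hshift : (fun y => V (-y + x) * (1 - ⨆ k, K k (-y + x))) =ᵐ[volume] 0 := by
      have hmp := (Measure.measurePreserving_sub_left (volume : Measure Space) x).quasiMeasurePreserving
      have h := hmp.ae_eq_comp hae
      have h2 : (fun y => V (x - y) * (1 - ⨆ k, K k (x - y))) =ᵐ[volume] 0 := h
      simpa only [neg_add_eq_sub] using h2
    refine (lintegral_eq_zero_iff (Measurable.iInf hmeas)).2 ?_
    filter_upwards [hshift] with y hy
    simp only [Pi.zero_apply] at hy ⊢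
    have h1 : (⨅ k, (ENNReal.ofReal ∘ yukawa 0) y * (V (-y + x) * (1 - K k (-y + x)))) =
        (ENNReal.ofReal ∘ yukawa 0) y * ⨅ k, (V (-y + x) * (1 - K k (-y + x))) :=
      (ENNReal.mul_iInf' (fun h => absurd h ENNReal.ofReal_ne_top) (fun _ => inferInstance)).symm
    have h2 : (⨅ k, (V (-y + x) * (1 - K k (-y + x)))) = V (-y + x) * (1 - ⨆ k, K k (-y + x)) := by
      rw [ENNReal.sub_iSup ENNReal.one_ne_top]
      exact (ENNReal.mul_iInf' (fun h => absurd h (hVfin _)) (fun _ => inferInstance)).symm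
    rw [h1, h2, hy, mul_zero]
  -- hence every K_k vanishes identically
  have hK0 : ∀ k x, K k x = 0 := by
    intro k x
    refine le_antisymm ?_ bot_le
    have h : K k x ≤ ⨅ m, (𝐆[0] fun y => V y * (1 - K (k + m) y)) x :=
      le_iInf fun m => (hKmono (Nat.le_add_right k m) x).trans (hmild (k + m) x)
    refine h.trans ?_
    rw [← hg_lim x]
    refine le_iInf fun m => ?_
    refine (iInf_le _ m).trans ?_
    exact G_mono 0 (fun y => mul_le_mul' le_rfl (tsub_le_tsub_left (hKmono (Nat.le_add_left m k) y) _)) x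
  -- so φ = 0 and ℓ = ∫ V ≠ 0
  have hK0' : ∀ (k : ℕ) (x : Space), kRes (4 / ((k : ℝ) + 1)) V V x = 0 := hK0
  apply hVpos
  rw [← hℓ]
  refine lintegral_congr fun z => ?_
  simp [hK0']

/-! ### The limits of `ρ(e)` -/

section Family

variable {u : ℝ → ℕ → Space → ℝ≥0∞}
variable (hV : Measurable V) (hVfin : ∀ y, V y ≠ ∞) (hVint : ∫⁻ y, V y ≠ ∞) (hVpos : ∫⁻ y, V y ≠ 0)
  (hGVall : ∀ c : ℝ, 0 < c → ∃ B : ℝ≥0∞, B ≠ ∞ ∧ ∀ x, (𝐆[c] V) x ≤ B)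
  (hu0 : ∀ e, u e 0 = 0) (hs : ∀ e n, u e (n + 1) = 𝐍[e, V, u e n])
include hV hVfin hVint hVpos hGVall hu0 hs

/-- **`ρ(e) ≤ 4e / ℓ`** for `e > 0`, `ℓ = ∫V(1 − φ)`: since `1/ρ(e) = ∫u ≥ ∫u₁ = ∫K_{4e}V` and
`4e ∫K_{4e}V = ∫V(1 − K_{4e}V) ≥ ℓ`. [cite: CarlenJauslinLieb2020, §2] -/
theorem fam_rho_le {e : ℝ} (he : 0 < e) :
    (⨆ n, ENNReal.ofReal (2 * e) / 𝐋[V, u e n]) ≤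
      ENNReal.ofReal (4 * e) / 𝐋[V, fun x => ⨆ k : ℕ, kRes (4 / ((k : ℝ) + 1)) V V x] := by
  have hc := four_mul_pos he
  obtain ⟨B, hB, hVB⟩ := hGVall (4 * e) hc
  have h4e0 : ENNReal.ofReal (4 * e) ≠ 0 := by simpa using hc
  rw [fam_rho_eq_inv hV hVfin hVint hVpos hGVall hu0 hs he]
  -- ∫ u ≥ ∫ u₁ = ∫ K_{4e} V
  have hu1 : u e 1 = kRes (4 * e) V V := by rw [hs e 0, hu0 e, next_zero]
  have hle1 : ∫⁻ x, kRes (4 * e) V V x ≤ ∫⁻ x, ⨆ n, u e n x := by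
    rw [← hu1]
    exact lintegral_mono fun x => le_iSup (fun n => u e n x) 1
  refine (ENNReal.inv_le_inv.2 hle1).trans ?_
  -- (∫K)⁻¹ = 4e / (4e ∫K) = 4e / L_e ≤ 4e / ℓ
  rw [← one_div, ← ENNReal.mul_div_mul_left 1 _ h4e0 ENNReal.ofReal_ne_top, mul_one,
    lintegral_kRes_pot hc hV hVfin hVint hB hVB]
  refine ENNReal.div_le_div_left (L_anti fun x => ?_) _
  -- K_{4e} V ≤ φ
  obtain ⟨k, hk⟩ := exists_nat_gt (1 / e)
  have hck : 4 / ((k : ℝ) + 1) ≤ 4 * e := by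
    rw [div_le_iff₀ (by positivity)]
    have : 1 / e < (k : ℝ) + 1 := hk.trans (by linarith)
    rw [div_lt_iff₀ he] at this
    nlinarith
  exact (kRes_anti_c hck V V x).trans (le_iSup (fun k : ℕ => kRes (4 / ((k : ℝ) + 1)) V V x) k)

/-- **CJL-I Lemma 8: `ρ(e) → 0` as `e → 0⁺`.** [cite: CarlenJauslinLieb2020, §2] -/
theorem fam_tendsto_zero (hG0 : ∀ x, (𝐆[0] V) x ≠ ∞) :
    Tendsto (fun e => (⨆ n, ENNReal.ofReal (2 * e) / 𝐋[V, u e n]).toReal) (𝓝[>] 0) (𝓝 0) := by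
  set ℓ := 𝐋[V, fun x => ⨆ k : ℕ, kRes (4 / ((k : ℝ) + 1)) V V x] with hℓ
  have hℓ0 : ℓ ≠ 0 := lowEnergy_L_ne_zero hV hVfin hVpos hGVall hG0
  have T1 : Tendsto (fun e : ℝ => ENNReal.ofReal (4 * e) * ℓ⁻¹) (𝓝[>] 0) (𝓝 0) := by
    have hc : Tendsto (fun e : ℝ => ENNReal.ofReal (4 * e)) (𝓝 0) (𝓝 0) := by
      have hc4 : Continuous fun e : ℝ => ENNReal.ofReal (4 * e) :=
        ENNReal.continuous_ofReal.comp (continuous_const.mul continuous_id)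
      have := hc4.tendsto 0
      simpa using this
    have hc' : Tendsto (fun e : ℝ => ENNReal.ofReal (4 * e)) (𝓝[>] 0) (𝓝 0) :=
      tendsto_nhdsWithin_of_tendsto_nhds hc
    have := ENNReal.Tendsto.mul_const hc' (Or.inr (ENNReal.inv_ne_top.2 hℓ0))
    rwa [zero_mul] at this
  have T2 : Tendsto (fun e => ⨆ n, ENNReal.ofReal (2 * e) / 𝐋[V, u e n]) (𝓝[>] 0) (𝓝 0) := by
    refine tendsto_of_tendsto_of_tendsto_of_le_of_le' tendsto_const_nhds T1
      (Eventually.of_forall fun _ => bot_le) ?_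
    filter_upwards [self_mem_nhdsWithin] with e he
    have h := fam_rho_le hV hVfin hVint hVpos hGVall hu0 hs (show 0 < e from he)
    rwa [div_eq_mul_inv] at h
  have h := (ENNReal.tendsto_toReal ENNReal.zero_ne_top).comp T2
  rw [ENNReal.toReal_zero] at h
  exact h

/-- **CJL-I Lemma 8: `ρ(e) → ∞` as `e → ∞`** (`ρ(e) ≥ ρ₀(e) = 2e/∫V`).
[cite: CarlenJauslinLieb2020, §2] -/
theorem fam_tendsto_atTop :
    Tendsto (fun e => (⨆ n, ENNReal.ofReal (2 * e) / 𝐋[V, u e n]).toReal) atTop atTop := by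
  set T := (∫⁻ y, V y).toReal with hT
  have hT0 : 0 < T := ENNReal.toReal_pos hVpos hVint
  have h1 : Tendsto (fun e : ℝ => 2 * e / T) atTop atTop :=
    (tendsto_id.const_mul_atTop two_pos).atTop_div_const hT0
  refine tendsto_atTop_mono' atTop ?_ h1
  filter_upwards [eventually_gt_atTop 0] with e he
  have hfin := fam_rho_ne_top' hV hVfin hVint hVpos hGVall hu0 hs he
  have hle : ENNReal.ofReal (2 * e) / 𝐋[V, u e 0] ≤ ⨆ n, ENNReal.ofReal (2 * e) / 𝐋[V, u e n] :=
    le_iSup (fun n => ENNReal.ofReal (2 * e) / 𝐋[V, u e n]) 0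
  have h2 := ENNReal.toReal_mono hfin hle
  rw [hu0 e] at h2
  simp only [Pi.zero_apply, tsub_zero, mul_one] at h2
  rw [ENNReal.toReal_div, ENNReal.toReal_ofReal (by positivity)] at h2
  exact h2

end Family

end LayerF

/-! ## Layer G: assembly of CJL-I Theorem 1 -/

section LayerG

variable {𝒱 : Space → ℝ} {p : ℝ≥0∞}

/-- Being a solution only depends on the potential up to null sets.
[cite: CarlenJauslinLieb2020, §2] -/
theorem IsSolution.congr_pot_ae {𝒱' : Space → ℝ} (hae : 𝒱 =ᵐ[volume] 𝒱') {ρ e : ℝ} {u : Space → ℝ}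
    (hu : IsSolution 𝒱 ρ e u) : IsSolution 𝒱' ρ e u := by
  refine ⟨hu.integrable, hu.nonneg, hu.le_one, fun x => ?_, ?_⟩
  · rw [hu.mild x]
    refine conv_congr_ae EventuallyEq.rfl ?_ x
    filter_upwards [hae] with y hy
    rw [hy]
  · have h := hu.energy
    unfold EnergyConstraint at h ⊢
    rw [h]
    congr 1
    refine integral_congr_ae ?_
    filter_upwards [hae] with y hy
    rw [hy]

/-- **The Newton potential of `𝒱` is finite** (`d = 3`, `𝒱 ∈ L¹ ∩ Lᵖ`, `p > 3/2`):
`Y_0 ≤ e·Y_1 + 1/(4π)` pointwise, so `G_0 V ≤ e G_1 V + ∫V/(4π) < ∞`. [folklore] -/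
theorem yukawa_zero_le (y : Space) : yukawa 0 y ≤ Real.exp 1 * yukawa 1 y + (4 * π)⁻¹ := by
  have hpi : 0 < 4 * π := by positivity
  have hpi' : 0 ≤ (4 * π)⁻¹ := by positivity
  have hY1 : 0 ≤ yukawa 1 y := yukawa_nonneg 1 y
  have heY1 : 0 ≤ Real.exp 1 * yukawa 1 y := mul_nonneg (Real.exp_pos 1).le hY1
  rw [yukawa_zero]
  by_cases hy : y = 0
  · subst hy; simp; positivity
  have hr : 0 < ‖y‖ := norm_pos_iff.2 hy
  rcases le_or_gt ‖y‖ 1 with h | h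
  · -- ‖y‖ ≤ 1: exp(1 - ‖y‖) ≥ 1
    have h1 : (4 * π * ‖y‖)⁻¹ ≤ Real.exp 1 * yukawa 1 y := by
      rw [yukawa_eq, Real.sqrt_one, one_mul, ← mul_div_assoc, ← Real.exp_add]
      rw [inv_eq_one_div, div_le_div_iff_of_pos_right (by positivity)]
      exact Real.one_le_exp (by linarith)
    linarith
  · have h1 : (4 * π * ‖y‖)⁻¹ ≤ (4 * π)⁻¹ := by
      rw [inv_le_inv₀ (by positivity) hpi]
      nlinarith
    nlinarith

/-- **The Newton potential `G_0 V = (4π|x|)⁻¹ ∗ 𝒱` is finite everywhere** for `𝒱 ∈ L¹ ∩ Lᵖ(ℝ³)`, `p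
> 3/2` (via `Y_0 ≤ e·Y_1 + 1/(4π)` and the Hölder bound on `G_1 V`). [folklore] -/
theorem newton_pot_ne_top (hVm : Measurable 𝒱) (h0 : ∀ x, 0 ≤ 𝒱 x) (h1 : Integrable 𝒱)
    {B : ℝ≥0∞} (hB : B ≠ ∞) (hVB : ∀ x, (𝐆[1] fun y => ENNReal.ofReal (𝒱 y)) x ≤ B) (x : Space) :
    (𝐆[0] fun y => ENNReal.ofReal (𝒱 y)) x ≠ ∞ := by
  set V : Space → ℝ≥0∞ := fun y => ENNReal.ofReal (𝒱 y) with hV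
  have hVmeas : Measurable V := measurable_ofReal_pot hVm
  have hker : ∀ y, (ENNReal.ofReal ∘ yukawa 0) y ≤
      ENNReal.ofReal (Real.exp 1) * (ENNReal.ofReal ∘ yukawa 1) y + ENNReal.ofReal ((4 * π)⁻¹) := by
    intro y
    simp only [Function.comp_apply]
    rw [← ENNReal.ofReal_mul (Real.exp_pos 1).le,
      ← ENNReal.ofReal_add (mul_nonneg (Real.exp_pos 1).le (yukawa_nonneg 1 y)) (by positivity)]
    exact ENNReal.ofReal_le_ofReal (yukawa_zero_le y)
  have hm1 : Measurable fun y => ENNReal.ofReal (Real.exp 1) * (ENNReal.ofReal ∘ yukawa 1) y * V (-y + x) :=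
    ((measurable_ofReal_yukawa 1).const_mul _).mul (hVmeas.comp (by fun_prop))
  have hVs : Measurable fun y => V (-y + x) := hVmeas.comp (by fun_prop)
  have hYV : Measurable fun y => (ENNReal.ofReal ∘ yukawa 1) y * V (-y + x) :=
    (measurable_ofReal_yukawa 1).mul hVs
  have hshift : ∫⁻ y, V (-y + x) = ∫⁻ y, V y := by
    have h := (Measure.measurePreserving_sub_left (volume : Measure Space) x).lintegral_comp hVmeas
    simpa only [neg_add_eq_sub] using h
  refine ne_top_of_le_ne_top ?_ (show (𝐆[0] V) x ≤ ENNReal.ofReal (Real.exp 1) * (𝐆[1] V) x +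
    ENNReal.ofReal ((4 * π)⁻¹) * ∫⁻ y, V y from ?_)
  · refine ENNReal.add_ne_top.2 ⟨ENNReal.mul_ne_top ENNReal.ofReal_ne_top (ne_top_of_le_ne_top hB (hVB x)),
      ENNReal.mul_ne_top ENNReal.ofReal_ne_top ?_⟩
    rw [hV, lintegral_ofReal_pot h0 h1]; exact ENNReal.ofReal_ne_top
  · simp only [lconvolution_def]
    calc ∫⁻ y, (ENNReal.ofReal ∘ yukawa 0) y * V (-y + x)
        ≤ ∫⁻ y, (ENNReal.ofReal (Real.exp 1) * (ENNReal.ofReal ∘ yukawa 1) y * V (-y + x) +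
            ENNReal.ofReal ((4 * π)⁻¹) * V (-y + x)) := by
          refine lintegral_mono fun y => ?_
          rw [← add_mul]
          exact mul_le_mul' (hker y) le_rfl
      _ = (ENNReal.ofReal (Real.exp 1) * ∫⁻ y, ((ENNReal.ofReal ∘ yukawa 1) y * V (-y + x))) +
            ENNReal.ofReal ((4 * π)⁻¹) * ∫⁻ y, V y := by
          rw [lintegral_add_left hm1, lintegral_const_mul _ hVs, hshift, ← lintegral_const_mul _ hYV]
          simp only [mul_assoc]

/-- **CJL-I Theorem 1 for a measurable potential** (the general case follows by modifying `𝒱` on a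
null set). [cite: CarlenJauslinLieb2020, §2] -/
theorem thm1_of_measurable (hp : 3 / 2 < p) (hVm : Measurable 𝒱) (h0 : ∀ x, 0 ≤ 𝒱 x)
    (h1 : Integrable 𝒱) (h2 : MemLp 𝒱 p) (hpos : 0 < ∫ x, 𝒱 x) :
    ∃ ρf : ℝ → ℝ, ContinuousOn ρf (Ioi 0) ∧ Tendsto ρf (𝓝[>] 0) (𝓝 0) ∧
      Tendsto ρf atTop atTop ∧
      ∀ e : ℝ, 0 < e →
        (∃! u : Space → ℝ, IsSolution 𝒱 (ρf e) e u) ∧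
        ∀ ρ : ℝ, ρ ≠ ρf e → ∀ u : Space → ℝ, ¬ IsSolution 𝒱 ρ e u := by
  set V : Space → ℝ≥0∞ := fun y => ENNReal.ofReal (𝒱 y) with hVdef
  have hV : Measurable V := measurable_ofReal_pot hVm
  have hVfin : ∀ y, V y ≠ ∞ := fun y => ENNReal.ofReal_ne_top
  have hVint : ∫⁻ y, V y ≠ ∞ := by rw [hVdef, lintegral_ofReal_pot h0 h1]; exact ENNReal.ofReal_ne_top
  have hVpos : ∫⁻ y, V y ≠ 0 := lintegral_ofReal_pot_ne_zero h0 h1 hpos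
  have hGVall : ∀ c : ℝ, 0 < c → ∃ B : ℝ≥0∞, B ≠ ∞ ∧ ∀ x, (𝐆[c] V) x ≤ B := fun c hc =>
    exists_G_pot_bound hp h0 h2 hc
  obtain ⟨B1, hB1, hVB1⟩ := hGVall 1 one_pos
  have hG0 : ∀ x, (𝐆[0] V) x ≠ ∞ := newton_pot_ne_top hVm h0 h1 hB1 hVB1
  -- the iteration, for every parameter e
  set u : ℝ → ℕ → Space → ℝ≥0∞ := fun e n =>
    Nat.rec (motive := fun _ => Space → ℝ≥0∞) 0 (fun _ w => 𝐍[e, V, w]) n with hu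
  have hu0 : ∀ e, u e 0 = 0 := fun e => rfl
  have hs : ∀ e n, u e (n + 1) = 𝐍[e, V, u e n] := fun e n => rfl
  set ρf : ℝ → ℝ := fun e => (⨆ n, ENNReal.ofReal (2 * e) / 𝐋[V, u e n]).toReal with hρf
  refine ⟨ρf, fam_continuousOn_rho hV hVfin hVint hVpos hGVall hu0 hs,
    fam_tendsto_zero hV hVfin hVint hVpos hGVall hu0 hs hG0,
    fam_tendsto_atTop hV hVfin hVint hVpos hGVall hu0 hs, fun e he => ?_⟩
  obtain ⟨B, hB, hVB⟩ := hGVall (4 * e) (four_mul_pos he)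
  have hρ : ρf e = (ENNReal.ofReal (2 * e) / 𝐋[V, fun x => ⨆ n, u e n x]).toReal := by
    rw [hρf]
    simp only []
    rw [rho_usol he hV hVfin hVint hVpos hB hVB (hu0 e) (hs e)]
  have hsol : IsSolution 𝒱 (ρf e) e fun x => (⨆ n, u e n x).toReal := by
    rw [hρ]
    exact isSolution_of_iter hp hVm h0 h1 h2 hpos he (hu0 e) (hs e)
  have huniq : ∀ {ρ' : ℝ} {u' : Space → ℝ}, IsSolution 𝒱 ρ' e u' →
      ρ' = ρf e ∧ u' = fun x => (⨆ n, u e n x).toReal := by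
    intro ρ' u' hsol'
    have h := isSolution_unique_of_iter hp hVm h0 h1 h2 hpos he (hu0 e) (hs e) hsol'
    rw [hρ]
    exact h
  refine ⟨⟨fun x => (⨆ n, u e n x).toReal, hsol, fun u' hu' => (huniq hu').2⟩, ?_⟩
  intro ρ hρne u' hu'
  exact hρne (huniq hu').1

/-- **CJL-I Theorem 1 (existence and uniqueness) holds** (`CarlenJauslinLieb2020_thm1`): proved
from the monotone iteration of CJL-I §2 (Lemmas 4–8), with two repairs of the printed argument
recorded in the module docstring (`u_n ≤ 1` via `K_e𝒱 + 4eK_e1 = 1`; `ρ(e) → 0` via the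
positivity of `∫𝒱(1 − φ)` instead of the false bound `ρ ≤ 4e/‖𝒱‖₁`).
[cite: CarlenJauslinLieb2020, Theorem 1 and §2] -/
theorem CarlenJauslinLieb2020_thm1_holds : CarlenJauslinLieb2020_thm1 := by
  intro 𝒱 p hp h0 h1 h2 hpos
  -- replace 𝒱 by a non-negative measurable modification
  set 𝒱m : Space → ℝ := fun x => max (h1.1.mk 𝒱 x) 0 with h𝒱m
  have hae : 𝒱 =ᵐ[volume] 𝒱m := by
    filter_upwards [h1.1.ae_eq_mk] with x hx
    rw [h𝒱m]
    simp only []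
    rw [← hx, max_eq_left (h0 x)]
  have hVm : Measurable 𝒱m := h1.1.stronglyMeasurable_mk.measurable.max measurable_const
  have h0m : ∀ x, 0 ≤ 𝒱m x := fun x => le_max_right _ _
  have h1m : Integrable 𝒱m := h1.congr hae
  have h2m : MemLp 𝒱m p := h2.ae_eq hae
  have hposm : 0 < ∫ x, 𝒱m x := by rwa [← integral_congr_ae hae]
  obtain ⟨ρf, hc, hz, ht, hsol⟩ := thm1_of_measurable hp hVm h0m h1m h2m hposm
  refine ⟨ρf, hc, hz, ht, fun e he => ?_⟩
  obtain ⟨⟨u, hu, huniq⟩, hnone⟩ := hsol e he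
  refine ⟨⟨u, hu.congr_pot_ae hae.symm, fun u' hu' => huniq u' (hu'.congr_pot_ae hae)⟩, ?_⟩
  intro ρ hρ u' hu'
  exact hnone ρ hρ u' (hu'.congr_pot_ae hae)

end LayerG

end LiebSimpleEquation

end Literature.MathematicalPhysics.QuantumManyBody
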